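import Literature.NumberTheory.Sieve.HyperKloostermanPrimePower
import Literature.NumberTheory.Sieve.TernaryDivisorAPAuxiliaryBound
import Literature.NumberTheory.LFunctions.KloostermanSalie
import HarnessLib

/-!
# Heath-Brown's sum `S(k, t₁, t₂, ρ, σ; q)` and its opening at prime powers — PROVED

Topic `Literature/NumberTheory/Sieve` (towards Heath-Brown, Acta Arith. 47 (1986), §3 Lemmas 1–4 and
§4 Lemma 5, the principal estimate behind the level `1/2 + 1/85` of Fouvry–Tenenbaum's Lemma 4.13;
companion of `HyperKloostermanPrimePower.lean`).  Source: [HeathBrown1986d3] p. 35, "The sum in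
which we are interested is `S(k, t₁, t₂, ρ, σ; q) = ∑*_{j=1}^{q} e_q(kj) K₂(ρ, σ, jt₁; q) conj K₂(ρ, σ, jt₂; q)`",
and p. 38: "Since `K₂(ρ, σ, jtᵢ; q) = K₂(1, 1, jρσtᵢ; q)` (`(ρσ, q) = 1`) … On noting that
`K₂(1, 1, jtᵢ; p^f) = 0` for `p ∣ j`, by (3.3), we have … `S = ∑_{j} ∑*_{m} e_{p^f}(F(j, m))` where
(3.11) `F(j, m) = m₁ + m₂ − m₃ − m₄ + j(km₁m₂m₃m₄ + t₁m₃m₄ − t₂m₁m₂)`."  Everything here is PROVED.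

## What is formalized (namespace `HeathBrown1986`)

* `SS q k t₁ t₂ ρ σ` — the sum `S(k, t₁, t₂, ρ, σ; q)`; `conj_stdAddChar`, `conj_K2`
  (`conj K₂(a; q) = K₂(−a; q)`); `K2_units_scale` (`K₂(ρ, σ, c; q) = K₂(1, 1, ρσc; q)` for units
  `ρ, σ`); `F311` = the phase (3.11); `sum_stdAddChar_mul_right`, `sum_comm5`;
* **`SS_primePow_eq`**: for `f ≥ 2`, `S(k, t₁, t₂, 1, 1; p^f) = ∑_{j} ∑*_{m₁,…,m₄} e_{p^f}(F(j, m))`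
  (the terms `p ∣ j` vanish by (3.3) = `K2_primePow_eq_zero_of_degenerate`, both `K₂` are opened, and
  the free sum over `j` detects `k + t₁m̄₁m̄₂ ≡ t₂m̄₃m̄₄ ⟺ km₁m₂m₃m₄ + t₁m₃m₄ − t₂m₁m₂ ≡ 0`);
* `D0`, …, `D4` = the partial derivatives (3.12)–(3.16) of `F`; `isUnit_add_pow_mul_iff`,
  `castHom_pow_mul`; **`sum_peel`**: the one-variable peeling step of the `p`-adic stationary phase
  (exact first-order expansion `Φ(x + p^k y) = Φ(x) + p^k y D(x)` + `p^k`-periodic weight ⇒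
  `∑_x ω(x)e(Φ(x)/p^m) = ∑_{u<p^k} ω(u) p^l[D(u) ≡ 0 (p^l)] e(Φ(u)/p^m)`);
* **`sum5_F311_even_eq`** (Lemma 2 for `F`, `f = 2g`, as an identity: five peels, `F` being multilinear
  in `m` and linear in `j`) and **`norm_SS_even_le`**:
  `|S(k, t₁, t₂, 1, 1; p^{2g})| ≤ p^{5g} · #B`, `#B` = the number of `(j, m) (mod p^g)`, `p ∤ mᵢ`, at
  which (3.12)–(3.16) all vanish `(mod p^g)` [HB Lemma 2, even case, for this `F`].

* **Lemma 3, even exponent**: `critical_structure` (the critical equations solved, HB pp. 39–40: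
  `m₂ = m₁`, `m₄ = m₃`, `τ = m₃m̄₁` with `τ³ = t̄₁t₂`, `k m₁² = t₁(τ − 1)`, `j(t₂m₁ − km₁m₃²) = 1`),
  `card_filter_isUnit_and_sq_eq_le` (`≤ 4` square roots among units), `card_filter_isUnit_and_mul_sq_eq_le`
  (`#{x unit : kx² = d} ≤ 4(k, p^g)`, lifting from `p^{g−e}`), `card_critical_le` (`#B ≤ 12(k, p^g)`),
  `sum_range5_indicator_eq_card`, and **`norm_SS_even_le_gcd`**:
  `|S(k, t₁, t₂, 1, 1; p^{2g})| ≤ 12 p^{5g} (k, p^g)` for `p ∤ t₁`, `g ≥ 1` [HB Lemma 3, `f` even].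

* towards the odd exponent `f = 2g + 1`: `sum_range_split5` (five digit splittings at once),
  `sum5_F311_eq` (the five peels for any splitting `m = k + l`, `l ≤ k`), `map_D0`–`map_D4`,
  **`norm_SS_odd_stage1`** (`|S(…; p^{2g+1})| ≤ p^{5g} ∑_{w ∈ B} |∑_{t (mod p)^5} e(F(w + p^g t)/p^{2g+1})|`),
  and the exact second-order Taylor expansion **`F311_taylor2`**
  (`F(w + Ps) = F(w) + P(s·∇F) + P²Q₃₁₁ + P³R₃₁₁`, with the Hessian form `Q311` and remainder `R311`
  as explicit definitions).

* **Lemma 3, odd exponent** (`p` odd): `PhiQ` (the quadratic phase `c·x + Q_w(x)` on `𝔽_p^5`), `M0`–`M4`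
  (the Hessian matrix rows), `PhiQ_add_sub` (differencing identity), `sum_stdAddChar_linear5`,
  **`norm_sq_sum_PhiQ_le`** (Weyl differencing: `|∑_v e(Φ(v)/p)|² ≤ p⁵ #ker M`), `kernel_determined` and
  **`card_kernel_le`** (at a critical point the kernel is determined by one coordinate: `#ker M ≤ p`,
  HB p. 40, rank `≥ 4`), `stdAddChar_pow_sq_mul_prime`, `map_Q311`, **`norm_inner5_le`** (the inner
  `(s mod p)^5`-sum at a critical point is `e(F(W))` times a quadratic Weyl sum mod `p`, of modulus
  `≤ p³`), `sum_range5_indicator_eq_card_odd`, `norm_SS_odd_le_of_inner` (assembly from any inner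
  bound `B`) and **`norm_SS_odd_le_gcd`**: `|S(k, t₁, t₂, 1, 1; p^{2g+1})| ≤ 12 (k, p^g) p^{5g+3}` for
  odd `p`, `g ≥ 1`, `p ∤ t₁`; the rank-`5` refinement `kernel_trivial`, `card_kernel_le_one`,
  `norm_sq_inner5_le` (`#ker M = 1` unless `p ∣ 3k`) and **`norm_SS_odd_le_gcd_sqrt`**:
  `|S| ≤ 12 (k, p^g) p^{5g+2} √p (3k, p)^{1/2}` [HB Lemma 3, `f` odd, as printed up to `(3,p)`];
  `norm_SS_odd_le_gcd_triv` (all `p`, inner bound `p⁵`).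
* **Lemma 3, vanishing clause**: `critical_sub_eq` (`T₂ − T₁ = K m₁²(τ² + τ + 1)` at a critical
  point), `gcd_val_dvd_of_critical`, **`SS_even_eq_zero_of_not_dvd`**, **`SS_odd_eq_zero_of_not_dvd`**:
  `S(k, t₁, t₂, 1, 1; p^f) = 0` unless `(k, p^g) ∣ t₂ − t₁` (`f = 2g` or `2g + 1`, `g ≥ 1`, `p ∤ t₁`).

Not yet here: the product formula (3.4), the reduction (3.5), Lemma 1 and Lemma 4, and §4.

## References

* D. R. Heath-Brown, *The divisor function d₃(n) in arithmetic progressions*, Acta Arith. 47 (1986)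
  29–56, §3 pp. 35–40, (3.11)–(3.17), Lemmas 2–3. [HeathBrown1986d3]
-/

open Finset

noncomputable section

open Literature.NumberTheory.LFunctions (sum_zmod_eq_sum_range sum_range_mul_eq_sum_sum
  isUnit_iff_cast_ne_zero isUnit_natCast_iff_not_dvd sum_range_stdAddChar_pow_mul norm_stdAddChar
  isUnit_natCast_of_not_dvd eq_or_eq_neg_of_sq_eq_sq_of_odd mem_of_sq_eq_sq_two card_filter_range_pow_eq
  isUnit_natCast_add_pow_mul_iff exists_eq_pow_mul_of_castHom_eq_zero)

namespace Literature.NumberTheory.Sieve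

namespace HeathBrown1986

/-- **Heath-Brown's sum** `S(k, t₁, t₂, ρ, σ; q) = ∑*_{j mod q} e_q(kj) K₂(ρ, σ, jt₁; q) conj K₂(ρ, σ, jt₂; q)`.
[cite: HeathBrown1986d3, §3 p.35] -/
def SS (q : ℕ) [NeZero q] (k t₁ t₂ ρ σ : ZMod q) : ℂ := by
  classical
  exact ∑ j : ZMod q, if IsUnit j then
    (ZMod.stdAddChar (k * j) : ℂ) * K2 q ρ σ (j * t₁) * starRingEnd ℂ (K2 q ρ σ (j * t₂)) else 0

variable {q : ℕ} [NeZero q]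

/-- `conj e_q(x) = e_q(−x)`. [folklore] -/
theorem conj_stdAddChar (x : ZMod q) :
    starRingEnd ℂ (ZMod.stdAddChar x : ℂ) = ZMod.stdAddChar (-x) := by
  have hchar : 0 < ringChar (ZMod q) := by
    rw [ZMod.ringChar_zmod_n]; exact Nat.pos_of_ne_zero (NeZero.ne q)
  rw [AddChar.starComp_apply hchar, AddChar.inv_apply]

/-- `conj K₂(a₁, a₂, a₃; q) = K₂(−a₁, −a₂, −a₃; q)`. [folklore] -/
theorem conj_K2 (a₁ a₂ a₃ : ZMod q) :
    starRingEnd ℂ (K2 q a₁ a₂ a₃) = K2 q (-a₁) (-a₂) (-a₃) := by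
  classical
  unfold K2
  rw [map_sum]
  refine Finset.sum_congr rfl fun x _ => ?_
  rw [map_sum]
  refine Finset.sum_congr rfl fun y _ => ?_
  split_ifs
  · rw [conj_stdAddChar]; congr 1; ring
  · exact map_zero _

/-- Scaling out units: `K₂(ρ, σ, c; q) = K₂(1, 1, ρσc; q)` for units `ρ, σ` (substitute
`x ↦ ρ̄x`, `y ↦ σ̄y`). [cite: HeathBrown1986d3, §3 p.38] -/
theorem K2_units_scale {ρ σ : ZMod q} (hρ : IsUnit ρ) (hσ : IsUnit σ) (c : ZMod q) :
    K2 q ρ σ c = K2 q 1 1 (ρ * σ * c) := by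
  classical
  obtain ⟨r, rfl⟩ := hρ
  obtain ⟨s, rfl⟩ := hσ
  unfold K2
  -- `x = r⁻¹ x'`, `y = s⁻¹ y'`
  rw [← Equiv.sum_comp (Units.mulLeft (r⁻¹ : (ZMod q)ˣ))]
  refine Finset.sum_congr rfl fun x _ => ?_
  rw [← Equiv.sum_comp (Units.mulLeft (s⁻¹ : (ZMod q)ˣ))]
  refine Finset.sum_congr rfl fun y _ => ?_
  simp only [Units.mulLeft_apply]
  have hux : IsUnit ((r⁻¹ : (ZMod q)ˣ) * x : ZMod q) ↔ IsUnit x :=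
    ⟨fun h => by simpa using (Units.isUnit r).mul h, fun h => (Units.isUnit _).mul h⟩
  have huy : IsUnit ((s⁻¹ : (ZMod q)ˣ) * y : ZMod q) ↔ IsUnit y :=
    ⟨fun h => by simpa using (Units.isUnit s).mul h, fun h => (Units.isUnit _).mul h⟩
  by_cases hx : IsUnit x
  · by_cases hy : IsUnit y
    · rw [if_pos ⟨hux.mpr hx, huy.mpr hy⟩, if_pos ⟨hx, hy⟩]
      congr 1
      have ix : x * x⁻¹ = 1 := ZMod.mul_inv_of_unit x hx
      have iy : y * y⁻¹ = 1 := ZMod.mul_inv_of_unit y hy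
      have e1 : (((r⁻¹ : (ZMod q)ˣ) : ZMod q) * x)⁻¹ = (r : ZMod q) * x⁻¹ := by
        apply ZMod.inv_eq_of_mul_eq_one
        rw [show ((r⁻¹ : (ZMod q)ˣ) : ZMod q) * x * ((r : ZMod q) * x⁻¹) =
          (((r⁻¹ : (ZMod q)ˣ) : ZMod q) * r) * (x * x⁻¹) by ring, Units.inv_mul, ix, one_mul]
      have e2 : (((s⁻¹ : (ZMod q)ˣ) : ZMod q) * y)⁻¹ = (s : ZMod q) * y⁻¹ := by
        apply ZMod.inv_eq_of_mul_eq_one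
        rw [show ((s⁻¹ : (ZMod q)ˣ) : ZMod q) * y * ((s : ZMod q) * y⁻¹) =
          (((s⁻¹ : (ZMod q)ˣ) : ZMod q) * s) * (y * y⁻¹) by ring, Units.inv_mul, iy, one_mul]
      rw [e1, e2]
      have hr : (r : ZMod q) * ((r⁻¹ : (ZMod q)ˣ) : ZMod q) = 1 := Units.mul_inv r
      have hs : (s : ZMod q) * ((s⁻¹ : (ZMod q)ˣ) : ZMod q) = 1 := Units.mul_inv s
      linear_combination x * hr + y * hs
    · rw [if_neg (fun h => hy (huy.mp h.2)), if_neg (fun h => hy h.2)]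
  · rw [if_neg (fun h => hx (hux.mp h.1)), if_neg (fun h => hx h.1)]

/-- **Heath-Brown's phase (3.11)**: `F(j, m) = m₁ + m₂ − m₃ − m₄ + j(k m₁m₂m₃m₄ + t₁m₃m₄ − t₂m₁m₂)`.
[cite: HeathBrown1986d3, (3.11)] -/
def F311 (k t₁ t₂ j m₁ m₂ m₃ m₄ : ZMod q) : ZMod q :=
  m₁ + m₂ - m₃ - m₄ + j * (k * m₁ * m₂ * m₃ * m₄ + t₁ * m₃ * m₄ - t₂ * m₁ * m₂)

omit [NeZero q] in
/-- Unfolding `F311`. [cite: HeathBrown1986d3, (3.11)] -/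
theorem F311_def (k t₁ t₂ j m₁ m₂ m₃ m₄ : ZMod q) : F311 k t₁ t₂ j m₁ m₂ m₃ m₄ =
    m₁ + m₂ - m₃ - m₄ + j * (k * m₁ * m₂ * m₃ * m₄ + t₁ * m₃ * m₄ - t₂ * m₁ * m₂) := rfl

/-- Orthogonality in the form `∑_j e_q(j w) = q [w = 0]`. [folklore] -/
theorem sum_stdAddChar_mul_right (w : ZMod q) :
    ∑ j : ZMod q, (ZMod.stdAddChar (j * w) : ℂ) = if w = 0 then (q : ℂ) else 0 := by
  have := sum_stdAddChar_mul q w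
  simpa [mul_comm] using this

omit [NeZero q] in
/-- Moving the outermost of five sums innermost. [folklore] -/
theorem sum_comm5 {α M : Type*} [AddCommMonoid M] (s : Finset α) (f : α → α → α → α → α → M) :
    ∑ j ∈ s, ∑ a ∈ s, ∑ b ∈ s, ∑ c ∈ s, ∑ d ∈ s, f j a b c d =
      ∑ a ∈ s, ∑ b ∈ s, ∑ c ∈ s, ∑ d ∈ s, ∑ j ∈ s, f j a b c d := by
  rw [Finset.sum_comm]
  refine Finset.sum_congr rfl fun a _ => ?_
  rw [Finset.sum_comm]
  refine Finset.sum_congr rfl fun b _ => ?_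
  rw [Finset.sum_comm]
  refine Finset.sum_congr rfl fun c _ => ?_
  rw [Finset.sum_comm]

/-- `∂F/∂j = k m₁m₂m₃m₄ + t₁m₃m₄ − t₂m₁m₂` (3.12). [cite: HeathBrown1986d3, (3.12)] -/
def D0 (k t₁ t₂ m₁ m₂ m₃ m₄ : ZMod q) : ZMod q := k * m₁ * m₂ * m₃ * m₄ + t₁ * m₃ * m₄ - t₂ * m₁ * m₂

/-- `∂F/∂m₁ = 1 + jkm₂m₃m₄ − jt₂m₂` (3.13). [cite: HeathBrown1986d3, (3.13)] -/
def D1 (k t₂ j m₂ m₃ m₄ : ZMod q) : ZMod q := 1 + j * k * m₂ * m₃ * m₄ - j * t₂ * m₂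

/-- `∂F/∂m₂ = 1 + jkm₁m₃m₄ − jt₂m₁` (3.14). [cite: HeathBrown1986d3, (3.14)] -/
def D2 (k t₂ j m₁ m₃ m₄ : ZMod q) : ZMod q := 1 + j * k * m₁ * m₃ * m₄ - j * t₂ * m₁

/-- `∂F/∂m₃ = −1 + jkm₁m₂m₄ + jt₁m₄` (3.15). [cite: HeathBrown1986d3, (3.15)] -/
def D3 (k t₁ j m₁ m₂ m₄ : ZMod q) : ZMod q := -1 + j * k * m₁ * m₂ * m₄ + j * t₁ * m₄

/-- `∂F/∂m₄ = −1 + jkm₁m₂m₃ + jt₁m₃` (3.16). [cite: HeathBrown1986d3, (3.16)] -/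
def D4 (k t₁ j m₁ m₂ m₃ : ZMod q) : ZMod q := -1 + j * k * m₁ * m₂ * m₃ + j * t₁ * m₃

omit [NeZero q] in
/-- Unfolding lemmas. [cite: HeathBrown1986d3, (3.12)–(3.16)] -/
theorem D0_def (k t₁ t₂ m₁ m₂ m₃ m₄ : ZMod q) :
    D0 k t₁ t₂ m₁ m₂ m₃ m₄ = k * m₁ * m₂ * m₃ * m₄ + t₁ * m₃ * m₄ - t₂ * m₁ * m₂ := rfl
omit [NeZero q] in
/-- Unfolding lemma. [cite: HeathBrown1986d3, (3.13)] -/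
theorem D1_def (k t₂ j m₂ m₃ m₄ : ZMod q) : D1 k t₂ j m₂ m₃ m₄ = 1 + j * k * m₂ * m₃ * m₄ - j * t₂ * m₂ := rfl
omit [NeZero q] in
/-- Unfolding lemma. [cite: HeathBrown1986d3, (3.14)] -/
theorem D2_def (k t₂ j m₁ m₃ m₄ : ZMod q) : D2 k t₂ j m₁ m₃ m₄ = 1 + j * k * m₁ * m₃ * m₄ - j * t₂ * m₁ := rfl
omit [NeZero q] in
/-- Unfolding lemma. [cite: HeathBrown1986d3, (3.15)] -/
theorem D3_def (k t₁ j m₁ m₂ m₄ : ZMod q) : D3 k t₁ j m₁ m₂ m₄ = -1 + j * k * m₁ * m₂ * m₄ + j * t₁ * m₄ := rfl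
omit [NeZero q] in
/-- Unfolding lemma. [cite: HeathBrown1986d3, (3.16)] -/
theorem D4_def (k t₁ j m₁ m₂ m₃ : ZMod q) : D4 k t₁ j m₁ m₂ m₃ = -1 + j * k * m₁ * m₂ * m₃ + j * t₁ * m₃ := rfl

omit [NeZero q] in
/-- Splitting five digit expansions at once: `∑_{u < ab (5 variables)} f(u) =
∑_{w < a (5)} ∑_{t < b (5)} f(w + a t)`. [folklore] -/
theorem sum_range_split5 {M : Type*} [AddCommMonoid M] (a b : ℕ) (f : ℕ → ℕ → ℕ → ℕ → ℕ → M) :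
    ∑ u₄ ∈ range (a * b), ∑ u₃ ∈ range (a * b), ∑ u₂ ∈ range (a * b), ∑ u₁ ∈ range (a * b),
      ∑ u₀ ∈ range (a * b), f u₄ u₃ u₂ u₁ u₀ =
    ∑ w₄ ∈ range a, ∑ w₃ ∈ range a, ∑ w₂ ∈ range a, ∑ w₁ ∈ range a, ∑ w₀ ∈ range a,
      ∑ t₄ ∈ range b, ∑ t₃ ∈ range b, ∑ t₂ ∈ range b, ∑ t₁ ∈ range b, ∑ t₀ ∈ range b,
        f (w₄ + a * t₄) (w₃ + a * t₃) (w₂ + a * t₂) (w₁ + a * t₁) (w₀ + a * t₀) := by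
  simp_rw [sum_range_mul_eq_sum_sum a b]
  -- reorder the interleaved sums `w₄ t₄ w₃ t₃ w₂ t₂ w₁ t₁ w₀ t₀`
  conv_lhs =>
    enter [2, w₄]
    rw [Finset.sum_comm]
  conv_lhs =>
    enter [2, w₄, 2, w₃, 2, t₄]
    rw [Finset.sum_comm]
  conv_lhs =>
    enter [2, w₄, 2, w₃]
    rw [Finset.sum_comm]
  conv_lhs =>
    enter [2, w₄, 2, w₃, 2, w₂, 2, t₄, 2, t₃]
    rw [Finset.sum_comm]
  conv_lhs =>
    enter [2, w₄, 2, w₃, 2, w₂, 2, t₄]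
    rw [Finset.sum_comm]
  conv_lhs =>
    enter [2, w₄, 2, w₃, 2, w₂]
    rw [Finset.sum_comm]
  conv_lhs =>
    enter [2, w₄, 2, w₃, 2, w₂, 2, w₁, 2, t₄, 2, t₃, 2, t₂]
    rw [Finset.sum_comm]
  conv_lhs =>
    enter [2, w₄, 2, w₃, 2, w₂, 2, w₁, 2, t₄, 2, t₃]
    rw [Finset.sum_comm]
  conv_lhs =>
    enter [2, w₄, 2, w₃, 2, w₂, 2, w₁, 2, t₄]
    rw [Finset.sum_comm]
  conv_lhs =>
    enter [2, w₄, 2, w₃, 2, w₂, 2, w₁]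
    rw [Finset.sum_comm]

section PrimePow

variable {p : ℕ} [hp : Fact p.Prime]

/-- `x + p^k y` is a unit iff `x` is (`k ≥ 1`). [folklore] -/
theorem isUnit_add_pow_mul_iff {k m : ℕ} (hk : k ≠ 0) (hm : m ≠ 0) (x y : ZMod (p ^ m)) :
    IsUnit (x + ((p ^ k : ℕ) : ZMod (p ^ m)) * y) ↔ IsUnit x := by
  rw [isUnit_iff_cast_ne_zero hm, isUnit_iff_cast_ne_zero hm, map_add, map_mul, map_natCast,
    Nat.cast_pow, ZMod.natCast_self, zero_pow hk, zero_mul, add_zero]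

omit hp in
/-- `p^k z ≡ 0 (mod p^l)` for `l ≤ k`. [folklore] -/
theorem castHom_pow_mul {k l m : ℕ} (hlk : l ≤ k) (h : p ^ l ∣ p ^ m) (z : ZMod (p ^ m)) :
    ZMod.castHom h (ZMod (p ^ l)) (((p ^ k : ℕ) : ZMod (p ^ m)) * z) = 0 := by
  rw [map_mul, map_natCast, (ZMod.natCast_eq_zero_iff _ _).mpr (pow_dvd_pow p hlk), zero_mul]

/-- **One-variable peeling step of the `p`-adic stationary phase** (`m = k + l ≤ 2k` is not even
needed: the expansion is assumed EXACT to first order): if `Φ(x + p^k y) = Φ(x) + p^k y D(x)` for all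
`x, y` and the weight `ω` is `p^k`-periodic, then
`∑_{x mod p^m} ω(x) e(Φ(x)/p^m) = ∑_{u < p^k} ω(u) · p^l[D(u) ≡ 0 (p^l)] · e(Φ(u)/p^m)`. [folklore] -/
theorem sum_peel {k l m : ℕ} (hklm : k + l = m) (ω : ZMod (p ^ m) → ℂ) (Φ D : ZMod (p ^ m) → ZMod (p ^ m))
    (hω : ∀ x y : ZMod (p ^ m), ω (x + ((p ^ k : ℕ) : ZMod (p ^ m)) * y) = ω x)
    (hΦ : ∀ x y : ZMod (p ^ m), Φ (x + ((p ^ k : ℕ) : ZMod (p ^ m)) * y) =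
      Φ x + ((p ^ k : ℕ) : ZMod (p ^ m)) * y * D x) :
    ∑ x : ZMod (p ^ m), ω x * (ZMod.stdAddChar (Φ x) : ℂ) =
      ∑ u ∈ range (p ^ k), (ω u *
        (if ZMod.castHom (pow_dvd_pow p (hklm ▸ Nat.le_add_left l k)) (ZMod (p ^ l)) (D u) = 0
          then ((p ^ l : ℕ) : ℂ) else 0)) * (ZMod.stdAddChar (Φ u) : ℂ) := by
  classical
  have hpm : range (p ^ m) = range (p ^ k * p ^ l) := by rw [← pow_add, hklm]
  rw [sum_zmod_eq_sum_range (fun x : ZMod (p ^ m) => ω x * (ZMod.stdAddChar (Φ x) : ℂ)), hpm,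
    sum_range_mul_eq_sum_sum]
  refine Finset.sum_congr rfl fun u _ => ?_
  have e : ∀ v : ℕ, ω (((u + p ^ k * v : ℕ) : ℕ) : ZMod (p ^ m)) *
      (ZMod.stdAddChar (Φ (((u + p ^ k * v : ℕ) : ℕ) : ZMod (p ^ m))) : ℂ) =
      ω u * (ZMod.stdAddChar (Φ u) : ℂ) *
        (ZMod.stdAddChar (((p ^ k : ℕ) : ZMod (p ^ m)) * ((v : ℕ) : ZMod (p ^ m)) * D u) : ℂ) := by
    intro v
    have hx : (((u + p ^ k * v : ℕ) : ℕ) : ZMod (p ^ m)) =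
        (u : ZMod (p ^ m)) + ((p ^ k : ℕ) : ZMod (p ^ m)) * ((v : ℕ) : ZMod (p ^ m)) := by
      push_cast; ring
    rw [hx, hω, hΦ, AddChar.map_add_eq_mul, mul_assoc, mul_assoc]
  rw [Finset.sum_congr rfl fun v _ => e v, ← Finset.mul_sum, sum_range_stdAddChar_pow_mul hklm (D u)]
  ring


set_option maxHeartbeats 800000 in
/-- **Opening `S` at a prime power** (p.38): for `f ≥ 2` (and any `t₁, t₂`),
`S(k, t₁, t₂, 1, 1; p^f) = ∑_{j} ∑*_{m₁,…,m₄} e_{p^f}(F(j, m))` with `F` as in (3.11): the terms `p ∣ j`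
may be added since `K₂(1, 1, jtᵢ; p^f) = 0` by (3.3), both `K₂` are opened, and the sum over `j`
detects `k + t₁m̄₁m̄₂ ≡ t₂m̄₃m̄₄`, i.e. `k m₁m₂m₃m₄ + t₁m₃m₄ − t₂m₁m₂ ≡ 0`.
[cite: HeathBrown1986d3, §3 p.38] -/
theorem SS_primePow_eq {f : ℕ} (hf : 2 ≤ f) (k t₁ t₂ : ZMod (p ^ f)) :
    SS (p ^ f) k t₁ t₂ 1 1 = ∑ j : ZMod (p ^ f), ∑ m₁ : ZMod (p ^ f), ∑ m₂ : ZMod (p ^ f),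
      ∑ m₃ : ZMod (p ^ f), ∑ m₄ : ZMod (p ^ f),
        if IsUnit m₁ ∧ IsUnit m₂ ∧ IsUnit m₃ ∧ IsUnit m₄ then
          (ZMod.stdAddChar (F311 k t₁ t₂ j m₁ m₂ m₃ m₄) : ℂ) else 0 := by
  classical
  set ψ : ZMod (p ^ f) → ℂ := fun x => (ZMod.stdAddChar x : ℂ) with hψ
  set L : ZMod (p ^ f) → ZMod (p ^ f) → ZMod (p ^ f) → ZMod (p ^ f) → ZMod (p ^ f) := fun m₁ m₂ m₃ m₄ => m₁ + m₂ - m₃ - m₄ with hL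
  set W : ZMod (p ^ f) → ZMod (p ^ f) → ZMod (p ^ f) → ZMod (p ^ f) → ZMod (p ^ f) := fun m₁ m₂ m₃ m₄ =>
    k + t₁ * (m₁⁻¹ * m₂⁻¹) - t₂ * (m₃⁻¹ * m₄⁻¹) with hW
  set G : ZMod (p ^ f) → ZMod (p ^ f) → ZMod (p ^ f) → ZMod (p ^ f) → ZMod (p ^ f) := fun m₁ m₂ m₃ m₄ =>
    k * m₁ * m₂ * m₃ * m₄ + t₁ * m₃ * m₄ - t₂ * m₁ * m₂ with hG
  set I : ZMod (p ^ f) → ℂ := fun w => if w = 0 then ((p ^ f : ℕ) : ℂ) else 0 with hI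
  -- the common value
  set C : ℂ := ∑ m₁ : ZMod (p ^ f), ∑ m₂ : ZMod (p ^ f), ∑ m₃ : ZMod (p ^ f), ∑ m₄ : ZMod (p ^ f),
    if IsUnit m₁ ∧ IsUnit m₂ ∧ IsUnit m₃ ∧ IsUnit m₄ then ψ (L m₁ m₂ m₃ m₄) * I (W m₁ m₂ m₃ m₄) else 0
    with hC
  -- Right-hand side = C
  have hR : (∑ j : ZMod (p ^ f), ∑ m₁ : ZMod (p ^ f), ∑ m₂ : ZMod (p ^ f), ∑ m₃ : ZMod (p ^ f), ∑ m₄ : ZMod (p ^ f),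
      if IsUnit m₁ ∧ IsUnit m₂ ∧ IsUnit m₃ ∧ IsUnit m₄ then
        ψ (F311 k t₁ t₂ j m₁ m₂ m₃ m₄) else 0) = C := by
    -- move `j` inside
    rw [sum_comm5, hC]
    refine Finset.sum_congr rfl fun m₁ _ => Finset.sum_congr rfl fun m₂ _ =>
      Finset.sum_congr rfl fun m₃ _ => Finset.sum_congr rfl fun m₄ _ => ?_
    by_cases hu : IsUnit m₁ ∧ IsUnit m₂ ∧ IsUnit m₃ ∧ IsUnit m₄
    · simp only [if_pos hu]
      have e : ∀ j : ZMod (p ^ f), ψ (F311 k t₁ t₂ j m₁ m₂ m₃ m₄) =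
          ψ (L m₁ m₂ m₃ m₄) * ψ (j * G m₁ m₂ m₃ m₄) := by
        intro j
        rw [hψ, ← AddChar.map_add_eq_mul, F311_def]
      rw [Finset.sum_congr rfl fun j _ => e j, ← Finset.mul_sum, sum_stdAddChar_mul_right]
      -- `G = 0 ↔ W = 0`
      obtain ⟨h1, h2, h3, h4⟩ := hu
      have i1 := ZMod.mul_inv_of_unit _ h1
      have i2 := ZMod.mul_inv_of_unit _ h2
      have i3 := ZMod.mul_inv_of_unit _ h3
      have i4 := ZMod.mul_inv_of_unit _ h4
      have hGW : G m₁ m₂ m₃ m₄ = W m₁ m₂ m₃ m₄ * (m₁ * m₂ * m₃ * m₄) := by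
        simp only [hG, hW]
        linear_combination (-(t₁ * m₃ * m₄) * (m₂ * m₂⁻¹ + 1)) * i1 * 0 +
          (-(t₁ * m₃ * m₄ * (m₁ * m₁⁻¹))) * i2 + (-(t₁ * m₃ * m₄)) * i1 +
          (t₂ * m₁ * m₂ * (m₃ * m₃⁻¹)) * i4 + (t₂ * m₁ * m₂) * i3
      have hiff : G m₁ m₂ m₃ m₄ = 0 ↔ W m₁ m₂ m₃ m₄ = 0 := by
        rw [hGW]
        exact ((h1.mul h2).mul h3 |>.mul h4).mul_left_eq_zero
      simp only [hI]
      by_cases h0 : W m₁ m₂ m₃ m₄ = 0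
      · rw [if_pos h0, if_pos (hiff.mpr h0)]
      · rw [if_neg h0, if_neg (fun h => h0 (hiff.mp h))]
    · simp only [if_neg hu, Finset.sum_const_zero]
  -- Left-hand side = C
  have hL' : SS (p ^ f) k t₁ t₂ 1 1 = C := by
    have hdeg : ∀ j : ZMod (p ^ f), ¬ IsUnit j → ∀ t : ZMod (p ^ f), K2 (p ^ f) 1 1 (j * t) = 0 := by
      intro j hj t
      refine K2_primePow_eq_zero_of_degenerate hf 1 1 (j * t) (Or.inl ⟨isUnit_one, ?_⟩)
      exact fun h => hj (isUnit_of_mul_isUnit_left h)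
    -- (a) drop the unit condition on `j`
    have ha : SS (p ^ f) k t₁ t₂ 1 1 = ∑ j : ZMod (p ^ f),
        ψ (k * j) * K2 (p ^ f) 1 1 (j * t₁) * K2 (p ^ f) (-1) (-1) (-(j * t₂)) := by
      unfold SS
      refine Finset.sum_congr rfl fun j _ => ?_
      by_cases hj : IsUnit j
      · rw [if_pos hj, conj_K2]
      · rw [if_neg hj, hdeg j hj t₁, mul_zero, zero_mul]
    -- (b) open both `K₂`
    have hb : ∀ j : ZMod (p ^ f), ψ (k * j) * K2 (p ^ f) 1 1 (j * t₁) * K2 (p ^ f) (-1) (-1) (-(j * t₂)) =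
        ∑ m₁ : ZMod (p ^ f), ∑ m₂ : ZMod (p ^ f), ∑ m₃ : ZMod (p ^ f), ∑ m₄ : ZMod (p ^ f),
          if IsUnit m₁ ∧ IsUnit m₂ ∧ IsUnit m₃ ∧ IsUnit m₄ then
            ψ (L m₁ m₂ m₃ m₄) * ψ (j * W m₁ m₂ m₃ m₄) else 0 := by
      intro j
      unfold K2
      rw [mul_assoc, Finset.sum_mul_sum, Finset.mul_sum]
      refine Finset.sum_congr rfl fun m₁ _ => ?_
      conv_rhs => rw [Finset.sum_comm]
      rw [Finset.mul_sum]
      refine Finset.sum_congr rfl fun m₃ _ => ?_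
      rw [Finset.sum_mul_sum, Finset.mul_sum]
      refine Finset.sum_congr rfl fun m₂ _ => ?_
      rw [Finset.mul_sum]
      refine Finset.sum_congr rfl fun m₄ _ => ?_
      by_cases h12 : IsUnit m₁ ∧ IsUnit m₂
      · by_cases h34 : IsUnit m₃ ∧ IsUnit m₄
        · rw [if_pos h12, if_pos h34, if_pos ⟨h12.1, h12.2, h34.1, h34.2⟩, hψ]
          simp only []
          rw [← AddChar.map_add_eq_mul, ← AddChar.map_add_eq_mul, ← AddChar.map_add_eq_mul]
          congr 1
          simp only [hL, hW]; ring
        · rw [if_pos h12, if_neg h34, mul_zero, mul_zero, if_neg (fun h => h34 ⟨h.2.2.1, h.2.2.2⟩)]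
      · rw [if_neg h12, zero_mul, mul_zero, if_neg (fun h => h12 ⟨h.1, h.2.1⟩)]
    rw [ha, Finset.sum_congr rfl fun j _ => hb j]
    -- (c) move `j` inside and sum it
    rw [sum_comm5, hC]
    refine Finset.sum_congr rfl fun m₁ _ => Finset.sum_congr rfl fun m₂ _ =>
      Finset.sum_congr rfl fun m₃ _ => Finset.sum_congr rfl fun m₄ _ => ?_
    by_cases hu : IsUnit m₁ ∧ IsUnit m₂ ∧ IsUnit m₃ ∧ IsUnit m₄
    · simp only [if_pos hu]
      rw [← Finset.mul_sum, sum_stdAddChar_mul_right]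
    · simp only [if_neg hu, Finset.sum_const_zero]
  rw [hL', ← hR]

set_option maxHeartbeats 1600000 in
/-- **Lemma 2 for the phase (3.11), first stage, any splitting `m = k + l`, `l ≤ k`, `k ≥ 1`** (five
one-variable peels; `F` is multilinear in `m` and linear in `j`, so each first-order expansion is exact):
with `I(w) = p^l [w ≡ 0 (mod p^l)]`,
`∑_{j} ∑*_{m} e_{p^m}(F(j, m)) = ∑_{u < p^k (5 variables), p ∤ u₁u₂u₃u₄} I(∂F/∂m₄) I(∂F/∂m₃) I(∂F/∂m₂) I(∂F/∂m₁) I(∂F/∂j) e_{p^m}(F(u))`.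
[cite: HeathBrown1986d3, Lemma 2] -/
theorem sum5_F311_eq {k l m : ℕ} (hklm : k + l = m) (hlk : l ≤ k) (hk : k ≠ 0) (kk t₁ t₂ : ZMod (p ^ m)) :
    (∑ j : ZMod (p ^ m), ∑ m₁ : ZMod (p ^ m), ∑ m₂ : ZMod (p ^ m),
      ∑ m₃ : ZMod (p ^ m), ∑ m₄ : ZMod (p ^ m),
        if IsUnit m₁ ∧ IsUnit m₂ ∧ IsUnit m₃ ∧ IsUnit m₄ then
          (ZMod.stdAddChar (F311 kk t₁ t₂ j m₁ m₂ m₃ m₄) : ℂ) else 0) =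
    ∑ u₄ ∈ range (p ^ k), ∑ u₃ ∈ range (p ^ k), ∑ u₂ ∈ range (p ^ k), ∑ u₁ ∈ range (p ^ k),
      ∑ u₀ ∈ range (p ^ k),
      ((((((if IsUnit ((u₁ : ℕ) : ZMod (p ^ m)) ∧ IsUnit ((u₂ : ℕ) : ZMod (p ^ m)) ∧
            IsUnit ((u₃ : ℕ) : ZMod (p ^ m)) ∧ IsUnit ((u₄ : ℕ) : ZMod (p ^ m)) then (1 : ℂ) else 0) *
        (if ZMod.castHom (pow_dvd_pow p (hklm ▸ Nat.le_add_left l k)) (ZMod (p ^ l))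
            (D4 kk t₁ (u₀ : ZMod (p ^ m)) u₁ u₂ u₃) = 0 then ((p ^ l : ℕ) : ℂ) else 0)) *
        (if ZMod.castHom (pow_dvd_pow p (hklm ▸ Nat.le_add_left l k)) (ZMod (p ^ l))
            (D3 kk t₁ (u₀ : ZMod (p ^ m)) u₁ u₂ u₄) = 0 then ((p ^ l : ℕ) : ℂ) else 0)) *
        (if ZMod.castHom (pow_dvd_pow p (hklm ▸ Nat.le_add_left l k)) (ZMod (p ^ l))
            (D2 kk t₂ (u₀ : ZMod (p ^ m)) u₁ u₃ u₄) = 0 then ((p ^ l : ℕ) : ℂ) else 0)) *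
        (if ZMod.castHom (pow_dvd_pow p (hklm ▸ Nat.le_add_left l k)) (ZMod (p ^ l))
            (D1 kk t₂ (u₀ : ZMod (p ^ m)) u₂ u₃ u₄) = 0 then ((p ^ l : ℕ) : ℂ) else 0)) *
        (if ZMod.castHom (pow_dvd_pow p (hklm ▸ Nat.le_add_left l k)) (ZMod (p ^ l))
            (D0 kk t₁ t₂ (u₁ : ZMod (p ^ m)) u₂ u₃ u₄) = 0 then ((p ^ l : ℕ) : ℂ) else 0)) *
        (ZMod.stdAddChar (F311 kk t₁ t₂ (u₀ : ZMod (p ^ m)) u₁ u₂ u₃ u₄) : ℂ) := by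
  classical
  have hm0 : m ≠ 0 := by omega
  have hdvd : p ^ l ∣ p ^ m := pow_dvd_pow p (hklm ▸ Nat.le_add_left l k)
  set P : ZMod (p ^ m) := ((p ^ k : ℕ) : ZMod (p ^ m)) with hP
  set π := ZMod.castHom hdvd (ZMod (p ^ l)) with hπ
  set I : ZMod (p ^ m) → ℂ := fun w => if π w = 0 then ((p ^ l : ℕ) : ℂ) else 0 with hI
  set ψ : ZMod (p ^ m) → ℂ := fun x => (ZMod.stdAddChar x : ℂ) with hψ
  set w0 : ZMod (p ^ m) → ZMod (p ^ m) → ZMod (p ^ m) → ZMod (p ^ m) → ℂ :=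
    fun m₁ m₂ m₃ m₄ => if IsUnit m₁ ∧ IsUnit m₂ ∧ IsUnit m₃ ∧ IsUnit m₄ then (1 : ℂ) else 0 with hw0
  -- invariances
  have hunit : ∀ x y : ZMod (p ^ m), IsUnit (x + P * y) ↔ IsUnit x :=
    fun x y => isUnit_add_pow_mul_iff hk hm0 x y
  have hIs : ∀ w z : ZMod (p ^ m), I (w + P * z) = I w := by
    intro w z; simp only [hI]; rw [map_add, hP, castHom_pow_mul hlk hdvd z, add_zero]
  have hw0_1 : ∀ x y b c d, w0 (x + P * y) b c d = w0 x b c d := by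
    intro x y b c d; simp only [hw0, hunit]
  have hw0_2 : ∀ a x y c d, w0 a (x + P * y) c d = w0 a x c d := by
    intro a x y c d; simp only [hw0, hunit]
  have hw0_3 : ∀ a b x y d, w0 a b (x + P * y) d = w0 a b x d := by
    intro a b x y d; simp only [hw0, hunit]
  have hw0_4 : ∀ a b c x y, w0 a b c (x + P * y) = w0 a b c x := by
    intro a b c x y; simp only [hw0, hunit]
  -- Step 0
  have h0 : (∑ j : ZMod (p ^ m), ∑ m₁ : ZMod (p ^ m), ∑ m₂ : ZMod (p ^ m),
      ∑ m₃ : ZMod (p ^ m), ∑ m₄ : ZMod (p ^ m),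
        if IsUnit m₁ ∧ IsUnit m₂ ∧ IsUnit m₃ ∧ IsUnit m₄ then
          (ZMod.stdAddChar (F311 kk t₁ t₂ j m₁ m₂ m₃ m₄) : ℂ) else 0) =
      ∑ j : ZMod (p ^ m), ∑ m₁ : ZMod (p ^ m), ∑ m₂ : ZMod (p ^ m),
      ∑ m₃ : ZMod (p ^ m), ∑ m₄ : ZMod (p ^ m),
        w0 m₁ m₂ m₃ m₄ * ψ (F311 kk t₁ t₂ j m₁ m₂ m₃ m₄) := by
    refine Finset.sum_congr rfl fun j _ => Finset.sum_congr rfl fun m₁ _ => Finset.sum_congr rfl fun m₂ _ =>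
      Finset.sum_congr rfl fun m₃ _ => Finset.sum_congr rfl fun m₄ _ => ?_
    simp only [hw0, hψ]
    split_ifs <;> simp
  -- Step 1: peel `m₄`
  have h1 : (∑ j : ZMod (p ^ m), ∑ m₁ : ZMod (p ^ m), ∑ m₂ : ZMod (p ^ m),
      ∑ m₃ : ZMod (p ^ m), ∑ m₄ : ZMod (p ^ m),
        w0 m₁ m₂ m₃ m₄ * ψ (F311 kk t₁ t₂ j m₁ m₂ m₃ m₄)) =
      ∑ j : ZMod (p ^ m), ∑ m₁ : ZMod (p ^ m), ∑ m₂ : ZMod (p ^ m),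
      ∑ m₃ : ZMod (p ^ m), ∑ u₄ ∈ range (p ^ k),
        (w0 m₁ m₂ m₃ u₄ * I (D4 kk t₁ j m₁ m₂ m₃)) * ψ (F311 kk t₁ t₂ j m₁ m₂ m₃ u₄) := by
    refine Finset.sum_congr rfl fun j _ => Finset.sum_congr rfl fun m₁ _ => Finset.sum_congr rfl fun m₂ _ =>
      Finset.sum_congr rfl fun m₃ _ => ?_
    refine sum_peel hklm (fun m₄ => w0 m₁ m₂ m₃ m₄) (fun m₄ => F311 kk t₁ t₂ j m₁ m₂ m₃ m₄)
      (fun _ => D4 kk t₁ j m₁ m₂ m₃) (fun x y => hw0_4 m₁ m₂ m₃ x y) (fun x y => ?_)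
    rw [F311_def, F311_def, D4_def]; ring
  -- Step 2: peel `m₃`
  have h2 : (∑ j : ZMod (p ^ m), ∑ m₁ : ZMod (p ^ m), ∑ m₂ : ZMod (p ^ m),
      ∑ m₃ : ZMod (p ^ m), ∑ u₄ ∈ range (p ^ k),
        (w0 m₁ m₂ m₃ u₄ * I (D4 kk t₁ j m₁ m₂ m₃)) * ψ (F311 kk t₁ t₂ j m₁ m₂ m₃ u₄)) =
      ∑ j : ZMod (p ^ m), ∑ m₁ : ZMod (p ^ m), ∑ m₂ : ZMod (p ^ m),
      ∑ u₄ ∈ range (p ^ k), ∑ u₃ ∈ range (p ^ k),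
        ((w0 m₁ m₂ u₃ u₄ * I (D4 kk t₁ j m₁ m₂ u₃)) * I (D3 kk t₁ j m₁ m₂ u₄)) *
          ψ (F311 kk t₁ t₂ j m₁ m₂ u₃ u₄) := by
    refine Finset.sum_congr rfl fun j _ => Finset.sum_congr rfl fun m₁ _ => Finset.sum_congr rfl fun m₂ _ => ?_
    rw [Finset.sum_comm]
    refine Finset.sum_congr rfl fun u₄ _ => ?_
    refine sum_peel hklm (fun m₃ => w0 m₁ m₂ m₃ u₄ * I (D4 kk t₁ j m₁ m₂ m₃))
      (fun m₃ => F311 kk t₁ t₂ j m₁ m₂ m₃ u₄) (fun _ => D3 kk t₁ j m₁ m₂ u₄) (fun x y => ?_) (fun x y => ?_)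
    · rw [hw0_3, show D4 kk t₁ j m₁ m₂ (x + P * y) = D4 kk t₁ j m₁ m₂ x + P * (y * (j * kk * m₁ * m₂ + j * t₁)) by
        rw [D4_def, D4_def]; ring, hIs]
    · rw [F311_def, F311_def, D3_def]; ring
  -- Step 3: peel `m₂`
  have h3 : (∑ j : ZMod (p ^ m), ∑ m₁ : ZMod (p ^ m), ∑ m₂ : ZMod (p ^ m),
      ∑ u₄ ∈ range (p ^ k), ∑ u₃ ∈ range (p ^ k),
        ((w0 m₁ m₂ u₃ u₄ * I (D4 kk t₁ j m₁ m₂ u₃)) * I (D3 kk t₁ j m₁ m₂ u₄)) *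
          ψ (F311 kk t₁ t₂ j m₁ m₂ u₃ u₄)) =
      ∑ j : ZMod (p ^ m), ∑ m₁ : ZMod (p ^ m),
      ∑ u₄ ∈ range (p ^ k), ∑ u₃ ∈ range (p ^ k), ∑ u₂ ∈ range (p ^ k),
        (((w0 m₁ u₂ u₃ u₄ * I (D4 kk t₁ j m₁ u₂ u₃)) * I (D3 kk t₁ j m₁ u₂ u₄)) * I (D2 kk t₂ j m₁ u₃ u₄)) *
          ψ (F311 kk t₁ t₂ j m₁ u₂ u₃ u₄) := by
    refine Finset.sum_congr rfl fun j _ => Finset.sum_congr rfl fun m₁ _ => ?_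
    rw [Finset.sum_comm]
    refine Finset.sum_congr rfl fun u₄ _ => ?_
    rw [Finset.sum_comm]
    refine Finset.sum_congr rfl fun u₃ _ => ?_
    refine sum_peel hklm (fun m₂ => (w0 m₁ m₂ u₃ u₄ * I (D4 kk t₁ j m₁ m₂ u₃)) * I (D3 kk t₁ j m₁ m₂ u₄))
      (fun m₂ => F311 kk t₁ t₂ j m₁ m₂ u₃ u₄) (fun _ => D2 kk t₂ j m₁ u₃ u₄) (fun x y => ?_) (fun x y => ?_)
    · rw [hw0_2, show D4 kk t₁ j m₁ (x + P * y) u₃ = D4 kk t₁ j m₁ x u₃ + P * (y * (j * kk * m₁ * u₃)) by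
        rw [D4_def, D4_def]; ring, hIs,
        show D3 kk t₁ j m₁ (x + P * y) u₄ = D3 kk t₁ j m₁ x u₄ + P * (y * (j * kk * m₁ * u₄)) by
        rw [D3_def, D3_def]; ring, hIs]
    · rw [F311_def, F311_def, D2_def]; ring
  -- Step 4: peel `m₁`
  have h4 : (∑ j : ZMod (p ^ m), ∑ m₁ : ZMod (p ^ m),
      ∑ u₄ ∈ range (p ^ k), ∑ u₃ ∈ range (p ^ k), ∑ u₂ ∈ range (p ^ k),
        (((w0 m₁ u₂ u₃ u₄ * I (D4 kk t₁ j m₁ u₂ u₃)) * I (D3 kk t₁ j m₁ u₂ u₄)) * I (D2 kk t₂ j m₁ u₃ u₄)) *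
          ψ (F311 kk t₁ t₂ j m₁ u₂ u₃ u₄)) =
      ∑ j : ZMod (p ^ m),
      ∑ u₄ ∈ range (p ^ k), ∑ u₃ ∈ range (p ^ k), ∑ u₂ ∈ range (p ^ k), ∑ u₁ ∈ range (p ^ k),
        ((((w0 u₁ u₂ u₃ u₄ * I (D4 kk t₁ j u₁ u₂ u₃)) * I (D3 kk t₁ j u₁ u₂ u₄)) * I (D2 kk t₂ j u₁ u₃ u₄)) *
            I (D1 kk t₂ j u₂ u₃ u₄)) * ψ (F311 kk t₁ t₂ j u₁ u₂ u₃ u₄) := by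
    refine Finset.sum_congr rfl fun j _ => ?_
    rw [Finset.sum_comm]
    refine Finset.sum_congr rfl fun u₄ _ => ?_
    rw [Finset.sum_comm]
    refine Finset.sum_congr rfl fun u₃ _ => ?_
    rw [Finset.sum_comm]
    refine Finset.sum_congr rfl fun u₂ _ => ?_
    refine sum_peel hklm
      (fun m₁ => ((w0 m₁ u₂ u₃ u₄ * I (D4 kk t₁ j m₁ u₂ u₃)) * I (D3 kk t₁ j m₁ u₂ u₄)) * I (D2 kk t₂ j m₁ u₃ u₄))
      (fun m₁ => F311 kk t₁ t₂ j m₁ u₂ u₃ u₄) (fun _ => D1 kk t₂ j u₂ u₃ u₄) (fun x y => ?_) (fun x y => ?_)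
    · rw [hw0_1, show D4 kk t₁ j (x + P * y) u₂ u₃ = D4 kk t₁ j x u₂ u₃ + P * (y * (j * kk * u₂ * u₃)) by
        rw [D4_def, D4_def]; ring, hIs,
        show D3 kk t₁ j (x + P * y) u₂ u₄ = D3 kk t₁ j x u₂ u₄ + P * (y * (j * kk * u₂ * u₄)) by
        rw [D3_def, D3_def]; ring, hIs,
        show D2 kk t₂ j (x + P * y) u₃ u₄ = D2 kk t₂ j x u₃ u₄ + P * (y * (j * kk * u₃ * u₄ - j * t₂)) by
        rw [D2_def, D2_def]; ring, hIs]
    · rw [F311_def, F311_def, D1_def]; ring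
  -- Step 5: peel `j`
  have h5 : (∑ j : ZMod (p ^ m),
      ∑ u₄ ∈ range (p ^ k), ∑ u₃ ∈ range (p ^ k), ∑ u₂ ∈ range (p ^ k), ∑ u₁ ∈ range (p ^ k),
        ((((w0 u₁ u₂ u₃ u₄ * I (D4 kk t₁ j u₁ u₂ u₃)) * I (D3 kk t₁ j u₁ u₂ u₄)) * I (D2 kk t₂ j u₁ u₃ u₄)) *
            I (D1 kk t₂ j u₂ u₃ u₄)) * ψ (F311 kk t₁ t₂ j u₁ u₂ u₃ u₄)) =
      ∑ u₄ ∈ range (p ^ k), ∑ u₃ ∈ range (p ^ k), ∑ u₂ ∈ range (p ^ k), ∑ u₁ ∈ range (p ^ k),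
      ∑ u₀ ∈ range (p ^ k),
        (((((w0 u₁ u₂ u₃ u₄ * I (D4 kk t₁ u₀ u₁ u₂ u₃)) * I (D3 kk t₁ u₀ u₁ u₂ u₄)) * I (D2 kk t₂ u₀ u₁ u₃ u₄)) *
            I (D1 kk t₂ u₀ u₂ u₃ u₄)) * I (D0 kk t₁ t₂ u₁ u₂ u₃ u₄)) * ψ (F311 kk t₁ t₂ u₀ u₁ u₂ u₃ u₄) := by
    rw [Finset.sum_comm]
    refine Finset.sum_congr rfl fun u₄ _ => ?_
    rw [Finset.sum_comm]
    refine Finset.sum_congr rfl fun u₃ _ => ?_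
    rw [Finset.sum_comm]
    refine Finset.sum_congr rfl fun u₂ _ => ?_
    rw [Finset.sum_comm]
    refine Finset.sum_congr rfl fun u₁ _ => ?_
    refine sum_peel hklm
      (fun j => (((w0 u₁ u₂ u₃ u₄ * I (D4 kk t₁ j u₁ u₂ u₃)) * I (D3 kk t₁ j u₁ u₂ u₄)) * I (D2 kk t₂ j u₁ u₃ u₄)) *
        I (D1 kk t₂ j u₂ u₃ u₄))
      (fun j => F311 kk t₁ t₂ j u₁ u₂ u₃ u₄) (fun _ => D0 kk t₁ t₂ u₁ u₂ u₃ u₄) (fun x y => ?_) (fun x y => ?_)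
    · rw [show D4 kk t₁ (x + P * y) u₁ u₂ u₃ = D4 kk t₁ x u₁ u₂ u₃ + P * (y * (kk * u₁ * u₂ * u₃ + t₁ * u₃)) by
        rw [D4_def, D4_def]; ring, hIs,
        show D3 kk t₁ (x + P * y) u₁ u₂ u₄ = D3 kk t₁ x u₁ u₂ u₄ + P * (y * (kk * u₁ * u₂ * u₄ + t₁ * u₄)) by
        rw [D3_def, D3_def]; ring, hIs,
        show D2 kk t₂ (x + P * y) u₁ u₃ u₄ = D2 kk t₂ x u₁ u₃ u₄ + P * (y * (kk * u₁ * u₃ * u₄ - t₂ * u₁)) by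
        rw [D2_def, D2_def]; ring, hIs,
        show D1 kk t₂ (x + P * y) u₂ u₃ u₄ = D1 kk t₂ x u₂ u₃ u₄ + P * (y * (kk * u₂ * u₃ * u₄ - t₂ * u₂)) by
        rw [D1_def, D1_def]; ring, hIs]
    · rw [F311_def, F311_def, D0_def]; ring
  rw [h0, h1, h2, h3, h4, h5]

/-- **Lemma 2 for the phase (3.11), even exponent `f = 2g`**: the case `k = l = g` of `sum5_F311_eq`.
[cite: HeathBrown1986d3, Lemma 2] -/
theorem sum5_F311_even_eq {g : ℕ} (hg : 1 ≤ g) (k t₁ t₂ : ZMod (p ^ (g + g))) :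
    (∑ j : ZMod (p ^ (g + g)), ∑ m₁ : ZMod (p ^ (g + g)), ∑ m₂ : ZMod (p ^ (g + g)),
      ∑ m₃ : ZMod (p ^ (g + g)), ∑ m₄ : ZMod (p ^ (g + g)),
        if IsUnit m₁ ∧ IsUnit m₂ ∧ IsUnit m₃ ∧ IsUnit m₄ then
          (ZMod.stdAddChar (F311 k t₁ t₂ j m₁ m₂ m₃ m₄) : ℂ) else 0) =
    ∑ u₄ ∈ range (p ^ g), ∑ u₃ ∈ range (p ^ g), ∑ u₂ ∈ range (p ^ g), ∑ u₁ ∈ range (p ^ g),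
      ∑ u₀ ∈ range (p ^ g),
      ((((((if IsUnit ((u₁ : ℕ) : ZMod (p ^ (g + g))) ∧ IsUnit ((u₂ : ℕ) : ZMod (p ^ (g + g))) ∧
            IsUnit ((u₃ : ℕ) : ZMod (p ^ (g + g))) ∧ IsUnit ((u₄ : ℕ) : ZMod (p ^ (g + g))) then (1 : ℂ) else 0) *
        (if ZMod.castHom (pow_dvd_pow p (Nat.le_add_left g g)) (ZMod (p ^ g))
            (D4 k t₁ (u₀ : ZMod (p ^ (g + g))) u₁ u₂ u₃) = 0 then ((p ^ g : ℕ) : ℂ) else 0)) *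
        (if ZMod.castHom (pow_dvd_pow p (Nat.le_add_left g g)) (ZMod (p ^ g))
            (D3 k t₁ (u₀ : ZMod (p ^ (g + g))) u₁ u₂ u₄) = 0 then ((p ^ g : ℕ) : ℂ) else 0)) *
        (if ZMod.castHom (pow_dvd_pow p (Nat.le_add_left g g)) (ZMod (p ^ g))
            (D2 k t₂ (u₀ : ZMod (p ^ (g + g))) u₁ u₃ u₄) = 0 then ((p ^ g : ℕ) : ℂ) else 0)) *
        (if ZMod.castHom (pow_dvd_pow p (Nat.le_add_left g g)) (ZMod (p ^ g))
            (D1 k t₂ (u₀ : ZMod (p ^ (g + g))) u₂ u₃ u₄) = 0 then ((p ^ g : ℕ) : ℂ) else 0)) *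
        (if ZMod.castHom (pow_dvd_pow p (Nat.le_add_left g g)) (ZMod (p ^ g))
            (D0 k t₁ t₂ (u₁ : ZMod (p ^ (g + g))) u₂ u₃ u₄) = 0 then ((p ^ g : ℕ) : ℂ) else 0)) *
        (ZMod.stdAddChar (F311 k t₁ t₂ (u₀ : ZMod (p ^ (g + g))) u₁ u₂ u₃ u₄) : ℂ) :=
  sum5_F311_eq (k := g) (l := g) (m := g + g) rfl le_rfl (by omega) k t₁ t₂

/-- Norm of an indicator-weighted constant. [folklore] -/
theorem norm_ite_natCast (c : Prop) [Decidable c] (n : ℕ) :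
    ‖(if c then ((n : ℕ) : ℂ) else 0)‖ = if c then (n : ℝ) else 0 := by
  split_ifs <;> simp

set_option maxHeartbeats 800000 in
/-- **Lemma 2 ⇒ the even-exponent bound for `S`**: for `g ≥ 1`,
`|S(k, t₁, t₂, 1, 1; p^{2g})| ≤ p^{5g} · #B`, where `#B` counts the `(j, m) (mod p^g)`, `p ∤ mᵢ`, at
which all five partial derivatives (3.12)–(3.16) of `F` vanish modulo `p^g`.
[cite: HeathBrown1986d3, Lemma 2 (f = 2g)] -/
theorem norm_SS_even_le {g : ℕ} (hg : 1 ≤ g) (k t₁ t₂ : ZMod (p ^ (g + g))) :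
    ‖SS (p ^ (g + g)) k t₁ t₂ 1 1‖ ≤ ((p : ℝ) ^ g) ^ 5 *
      ∑ u₄ ∈ range (p ^ g), ∑ u₃ ∈ range (p ^ g), ∑ u₂ ∈ range (p ^ g), ∑ u₁ ∈ range (p ^ g),
        ∑ u₀ ∈ range (p ^ g),
        (if (IsUnit ((u₁ : ℕ) : ZMod (p ^ (g + g))) ∧ IsUnit ((u₂ : ℕ) : ZMod (p ^ (g + g))) ∧
              IsUnit ((u₃ : ℕ) : ZMod (p ^ (g + g))) ∧ IsUnit ((u₄ : ℕ) : ZMod (p ^ (g + g)))) ∧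
            ZMod.castHom (pow_dvd_pow p (Nat.le_add_left g g)) (ZMod (p ^ g))
              (D4 k t₁ (u₀ : ZMod (p ^ (g + g))) u₁ u₂ u₃) = 0 ∧
            ZMod.castHom (pow_dvd_pow p (Nat.le_add_left g g)) (ZMod (p ^ g))
              (D3 k t₁ (u₀ : ZMod (p ^ (g + g))) u₁ u₂ u₄) = 0 ∧
            ZMod.castHom (pow_dvd_pow p (Nat.le_add_left g g)) (ZMod (p ^ g))
              (D2 k t₂ (u₀ : ZMod (p ^ (g + g))) u₁ u₃ u₄) = 0 ∧
            ZMod.castHom (pow_dvd_pow p (Nat.le_add_left g g)) (ZMod (p ^ g))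
              (D1 k t₂ (u₀ : ZMod (p ^ (g + g))) u₂ u₃ u₄) = 0 ∧
            ZMod.castHom (pow_dvd_pow p (Nat.le_add_left g g)) (ZMod (p ^ g))
              (D0 k t₁ t₂ (u₁ : ZMod (p ^ (g + g))) u₂ u₃ u₄) = 0
          then (1 : ℝ) else 0) := by
  classical
  have hf : 2 ≤ g + g := by omega
  rw [SS_primePow_eq hf, sum5_F311_even_eq hg, Finset.mul_sum]
  refine (norm_sum_le _ _).trans (Finset.sum_le_sum fun u₄ _ => ?_)
  rw [Finset.mul_sum]
  refine (norm_sum_le _ _).trans (Finset.sum_le_sum fun u₃ _ => ?_)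
  rw [Finset.mul_sum]
  refine (norm_sum_le _ _).trans (Finset.sum_le_sum fun u₂ _ => ?_)
  rw [Finset.mul_sum]
  refine (norm_sum_le _ _).trans (Finset.sum_le_sum fun u₁ _ => ?_)
  rw [Finset.mul_sum]
  refine (norm_sum_le _ _).trans (Finset.sum_le_sum fun u₀ _ => ?_)
  refine le_of_eq ?_
  rw [norm_mul, norm_mul, norm_mul, norm_mul, norm_mul, norm_mul, norm_stdAddChar, mul_one,
    norm_ite_natCast, norm_ite_natCast, norm_ite_natCast, norm_ite_natCast, norm_ite_natCast]
  have hw : ‖(if IsUnit ((u₁ : ℕ) : ZMod (p ^ (g + g))) ∧ IsUnit ((u₂ : ℕ) : ZMod (p ^ (g + g))) ∧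
      IsUnit ((u₃ : ℕ) : ZMod (p ^ (g + g))) ∧ IsUnit ((u₄ : ℕ) : ZMod (p ^ (g + g))) then (1 : ℂ) else 0)‖ =
      if IsUnit ((u₁ : ℕ) : ZMod (p ^ (g + g))) ∧ IsUnit ((u₂ : ℕ) : ZMod (p ^ (g + g))) ∧
        IsUnit ((u₃ : ℕ) : ZMod (p ^ (g + g))) ∧ IsUnit ((u₄ : ℕ) : ZMod (p ^ (g + g))) then (1 : ℝ) else 0 := by
    split_ifs <;> simp
  rw [hw]
  by_cases hc : (IsUnit ((u₁ : ℕ) : ZMod (p ^ (g + g))) ∧ IsUnit ((u₂ : ℕ) : ZMod (p ^ (g + g))) ∧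
      IsUnit ((u₃ : ℕ) : ZMod (p ^ (g + g))) ∧ IsUnit ((u₄ : ℕ) : ZMod (p ^ (g + g)))) ∧
    ZMod.castHom (pow_dvd_pow p (Nat.le_add_left g g)) (ZMod (p ^ g))
      (D4 k t₁ (u₀ : ZMod (p ^ (g + g))) u₁ u₂ u₃) = 0 ∧
    ZMod.castHom (pow_dvd_pow p (Nat.le_add_left g g)) (ZMod (p ^ g))
      (D3 k t₁ (u₀ : ZMod (p ^ (g + g))) u₁ u₂ u₄) = 0 ∧
    ZMod.castHom (pow_dvd_pow p (Nat.le_add_left g g)) (ZMod (p ^ g))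
      (D2 k t₂ (u₀ : ZMod (p ^ (g + g))) u₁ u₃ u₄) = 0 ∧
    ZMod.castHom (pow_dvd_pow p (Nat.le_add_left g g)) (ZMod (p ^ g))
      (D1 k t₂ (u₀ : ZMod (p ^ (g + g))) u₂ u₃ u₄) = 0 ∧
    ZMod.castHom (pow_dvd_pow p (Nat.le_add_left g g)) (ZMod (p ^ g))
      (D0 k t₁ t₂ (u₁ : ZMod (p ^ (g + g))) u₂ u₃ u₄) = 0
  · obtain ⟨hU, h4, h3, h2, h1, h0'⟩ := hc
    rw [if_pos hU, if_pos h4, if_pos h3, if_pos h2, if_pos h1, if_pos h0', if_pos ⟨hU, h4, h3, h2, h1, h0'⟩]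
    push_cast; ring
  · rw [if_neg hc, mul_zero]
    simp only [not_and_or] at hc
    rcases hc with h | h | h | h | h | h
    · rw [if_neg (by tauto)]; ring
    all_goals rw [if_neg h]; ring

/-! ### Lemma 3: the structure and the count of the critical set `B` -/

/-- **The critical equations (3.12)–(3.16) solved** (HB pp. 39–40): if `m₁, …, m₄` are units and all
five derivatives vanish, then `m₂ = m₁`, `m₄ = m₃`, `τ = m₃m̄₁` satisfies `τ³ = t̄₁t₂`,
`k m₁² = t₁(τ − 1)`, and `j` is determined: `j (t₂m₁ − k m₁m₃²) = 1`.
[cite: HeathBrown1986d3, §3 (3.12)–(3.17)] -/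
theorem critical_structure {K T₁ T₂ j m₁ m₂ m₃ m₄ : ZMod q} (hT₁ : IsUnit T₁)
    (h1 : IsUnit m₁) (h4 : IsUnit m₄)
    (E4 : D4 K T₁ j m₁ m₂ m₃ = 0) (E3 : D3 K T₁ j m₁ m₂ m₄ = 0) (E2 : D2 K T₂ j m₁ m₃ m₄ = 0)
    (E1 : D1 K T₂ j m₂ m₃ m₄ = 0) (E0 : D0 K T₁ T₂ m₁ m₂ m₃ m₄ = 0) :
    m₂ = m₁ ∧ m₄ = m₃ ∧ (m₃ * m₁⁻¹) ^ 3 = T₁⁻¹ * T₂ ∧ K * m₁ ^ 2 = T₁ * (m₃ * m₁⁻¹ - 1) ∧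
      j * (T₂ * m₁ - K * m₁ * m₃ ^ 2) = 1 := by
  rw [D4_def] at E4; rw [D3_def] at E3; rw [D2_def] at E2; rw [D1_def] at E1; rw [D0_def] at E0
  have i1 := ZMod.mul_inv_of_unit _ h1
  have iT := ZMod.mul_inv_of_unit _ hT₁
  -- `m₂ = m₁`: `(m₂ − m₁) · j(K m₃m₄ − T₂) = 0` and `j(K m₃m₄ − T₂) m₂ = −1`
  have hu12 : IsUnit (j * (K * m₃ * m₄ - T₂)) := by
    have e : (j * (K * m₃ * m₄ - T₂)) * (-m₂) = 1 := by linear_combination (-1 : ZMod q) * E1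
    exact IsUnit.of_mul_eq_one _ e
  have h21 : m₂ = m₁ := by
    have e : (m₂ - m₁) * (j * (K * m₃ * m₄ - T₂)) = 0 := by linear_combination E1 - E2
    rw [hu12.mul_left_eq_zero, sub_eq_zero] at e
    exact e
  subst h21
  -- `m₄ = m₃`
  have hu34 : IsUnit (j * (K * m₂ * m₂ + T₁)) := by
    have e : (j * (K * m₂ * m₂ + T₁)) * m₄ = 1 := by linear_combination E3
    exact IsUnit.of_mul_eq_one _ e
  have h43 : m₄ = m₃ := by
    have e : (m₄ - m₃) * (j * (K * m₂ * m₂ + T₁)) = 0 := by linear_combination E3 - E4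
    rw [hu34.mul_left_eq_zero, sub_eq_zero] at e
    exact e
  subst h43
  -- `j` is a unit with inverse `T₂ m₁ − K m₁ m₃²`
  have hj : j * (T₂ * m₂ - K * m₂ * m₄ ^ 2) = 1 := by linear_combination (-1 : ZMod q) * E1
  refine ⟨rfl, rfl, ?_, ?_, hj⟩
  · -- eliminate `K`: `T₂ m₁³ = T₁ m₃³`
    have a : K * m₂ * m₄ * (m₂ + m₄) = T₂ * m₂ - T₁ * m₄ := by
      -- add (3.13) and (3.15) and divide by `j`
      have e : j * (K * m₂ * m₄ * (m₂ + m₄) - (T₂ * m₂ - T₁ * m₄)) = 0 := by linear_combination E1 + E3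
      have hju : IsUnit j := IsUnit.of_mul_eq_one _ hj
      rw [hju.mul_right_eq_zero, sub_eq_zero] at e
      exact e
    have b : K * m₂ ^ 2 * m₄ ^ 2 = T₂ * m₂ ^ 2 - T₁ * m₄ ^ 2 := by linear_combination E0
    have c : T₂ * m₂ ^ 3 = T₁ * m₄ ^ 3 := by linear_combination (m₂ * m₄) * a - (m₂ + m₄) * b
    -- divide by `T₁ m₁³`
    linear_combination (-(T₁⁻¹ * m₂⁻¹ ^ 3)) * c + (-(m₄ ^ 3 * m₂⁻¹ ^ 3)) * iT +
      (T₁⁻¹ * T₂ * ((m₂ * m₂⁻¹) ^ 2 + m₂ * m₂⁻¹ + 1)) * i1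
  · -- `K m₁² = T₁ (τ − 1)` from (3.17) and `T₂ m₁³ = T₁ m₃³`
    have a : K * m₂ * m₄ * (m₂ + m₄) = T₂ * m₂ - T₁ * m₄ := by
      have e : j * (K * m₂ * m₄ * (m₂ + m₄) - (T₂ * m₂ - T₁ * m₄)) = 0 := by linear_combination E1 + E3
      have hju : IsUnit j := IsUnit.of_mul_eq_one _ hj
      rw [hju.mul_right_eq_zero, sub_eq_zero] at e
      exact e
    have b : K * m₂ ^ 2 * m₄ ^ 2 = T₂ * m₂ ^ 2 - T₁ * m₄ ^ 2 := by linear_combination E0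
    have c : T₂ * m₂ ^ 3 = T₁ * m₄ ^ 3 := by linear_combination (m₂ * m₄) * a - (m₂ + m₄) * b
    have d : K * m₂ * m₄ ^ 3 = T₂ * m₂ * (m₄ - m₂) := by linear_combination m₄ * a - b
    have e0 : m₄ ^ 3 * (K * m₂ ^ 3 - T₁ * (m₄ - m₂)) = 0 := by
      linear_combination m₂ ^ 2 * d + (m₄ - m₂) * c
    have e1 : K * m₂ ^ 3 = T₁ * (m₄ - m₂) := by
      rw [(h4.pow 3).mul_right_eq_zero, sub_eq_zero] at e0
      exact e0
    linear_combination m₂⁻¹ * e1 + (-(K * m₂ ^ 2 + T₁)) * i1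

/-- **Square roots among units**: `#{w unit mod p^l : w² = c} ≤ 4` (for odd `p` even `≤ 2`).
[folklore] -/
theorem card_filter_isUnit_and_sq_eq_le (l : ℕ) (c : ZMod (p ^ l)) :
    (Finset.univ.filter fun w : ZMod (p ^ l) => IsUnit w ∧ w ^ 2 = c).card ≤ 4 := by
  classical
  by_cases hex : ∃ w₀ : ZMod (p ^ l), IsUnit w₀ ∧ w₀ ^ 2 = c
  swap
  · rw [Finset.filter_false_of_mem, Finset.card_empty]
    · exact Nat.zero_le _
    · exact fun w _ hw => hex ⟨w, hw⟩
  obtain ⟨w₀, hw₀, hc₀⟩ := hex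
  by_cases hp2 : p = 2
  · subst hp2
    rcases Nat.eq_zero_or_pos l with rfl | hl
    · calc _ ≤ Fintype.card (ZMod (2 ^ 0)) := Finset.card_le_univ _
        _ = 1 := by simp
        _ ≤ 4 := by norm_num
    calc _ ≤ ({w₀, -w₀, w₀ + ((2 ^ (l - 1) : ℕ) : ZMod (2 ^ l)),
              -w₀ + ((2 ^ (l - 1) : ℕ) : ZMod (2 ^ l))} : Finset (ZMod (2 ^ l))).card := by
          refine Finset.card_le_card fun w hw => ?_
          rw [Finset.mem_filter] at hw
          simp only [Finset.mem_insert, Finset.mem_singleton]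
          rcases mem_of_sq_eq_sq_two hl.ne' hw₀ (hw.2.2.trans hc₀.symm) with h | h | h | h <;>
            simp only [h, true_or, or_true]
      _ ≤ 4 := Finset.card_le_four
  · calc _ ≤ ({w₀, -w₀} : Finset (ZMod (p ^ l))).card := by
          refine Finset.card_le_card fun w hw => ?_
          rw [Finset.mem_filter] at hw
          simp only [Finset.mem_insert, Finset.mem_singleton]
          rcases eq_or_eq_neg_of_sq_eq_sq_of_odd hp2 hw₀ (hw.2.2.trans hc₀.symm) with h | h <;>
            simp only [h, true_or, or_true]
      _ ≤ 2 := Finset.card_le_two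
      _ ≤ 4 := by norm_num

/-- **Counting `k x² ≡ d (mod p^g)`**: among units `x`, at most `4 (k, p^g)` solutions
(`(k, p^g) = p^e`: reduce to `k' x² ≡ d' (mod p^{g−e})`, at most `4` solutions, each with `p^e` lifts).
[cite: HeathBrown1986d3, §3 p.40] -/
theorem card_filter_isUnit_and_mul_sq_eq_le {g : ℕ} (K d : ZMod (p ^ g)) :
    (Finset.univ.filter fun x : ZMod (p ^ g) => IsUnit x ∧ K * x ^ 2 = d).card ≤
      4 * Nat.gcd K.val (p ^ g) := by
  classical
  have hpp := hp.out
  set G := Nat.gcd K.val (p ^ g) with hGdef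
  obtain ⟨e, he, hG⟩ : ∃ e ≤ g, G = p ^ e := (Nat.dvd_prime_pow hpp).mp (Nat.gcd_dvd_right _ _)
  rcases Nat.eq_or_lt_of_le he with rfl | hlt
  · -- `(k, p^g) = p^g`
    calc _ ≤ Fintype.card (ZMod (p ^ e)) := Finset.card_le_univ _
      _ = p ^ e := ZMod.card _
      _ ≤ 4 * G := by rw [hG]; omega
  -- `e < g`: `K.val = p^e k'`, `p ∤ k'`
  have hKe : p ^ e ∣ K.val := hG ▸ Nat.gcd_dvd_left _ _
  obtain ⟨k', hk'⟩ := hKe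
  have hk'p : ¬ p ∣ k' := by
    intro h
    have h1 : p ^ (e + 1) ∣ K.val := by
      rw [hk', pow_succ]; exact Nat.mul_dvd_mul_left _ h
    have h2 : p ^ (e + 1) ∣ G := Nat.dvd_gcd h1 (pow_dvd_pow p (by omega))
    rw [hG, Nat.pow_dvd_pow_iff_le_right hpp.one_lt] at h2
    omega
  set l := g - e with hl
  have hl0 : l ≠ 0 := by omega
  have hle : l ≤ g := by omega
  -- the reduced condition
  set Q : ZMod (p ^ l) → Prop := fun w => IsUnit w ∧ ((k' : ℕ) : ZMod (p ^ l)) * w ^ 2 =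
    ((d.val / p ^ e : ℕ) : ZMod (p ^ l)) with hQ
  have hQcard : (Finset.univ.filter Q).card ≤ 4 := by
    by_cases hex : ∃ w₀ : ZMod (p ^ l), Q w₀
    swap
    · rw [Finset.filter_false_of_mem, Finset.card_empty]
      · exact Nat.zero_le _
      · exact fun w _ hw => hex ⟨w, hw⟩
    obtain ⟨w₀, hw₀, hc₀⟩ := hex
    have hk'u : IsUnit ((k' : ℕ) : ZMod (p ^ l)) := isUnit_natCast_of_not_dvd hk'p
    refine (Finset.card_le_card fun w hw => ?_).trans (card_filter_isUnit_and_sq_eq_le l (w₀ ^ 2))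
    rw [Finset.mem_filter] at hw ⊢
    refine ⟨Finset.mem_univ _, hw.2.1, ?_⟩
    exact hk'u.mul_left_cancel (hw.2.2.trans hc₀.symm)
  -- inject the solution set into `{x̃ < p^g : Q(x̃ mod p^l)}` via `val`
  have hinj : (Finset.univ.filter fun x : ZMod (p ^ g) => IsUnit x ∧ K * x ^ 2 = d).card ≤
      ((range (p ^ g)).filter fun u : ℕ => Q (u : ZMod (p ^ l))).card := by
    refine Finset.card_le_card_of_injOn (fun x => x.val) (fun x hx => ?_)
      (fun a _ b _ hab => ZMod.val_injective _ hab)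
    rw [Finset.mem_coe, Finset.mem_filter] at hx
    obtain ⟨_, hxu, hxe⟩ := hx
    rw [Finset.mem_coe, Finset.mem_filter, Finset.mem_range]
    refine ⟨ZMod.val_lt x, ?_, ?_⟩
    · -- unit
      have hg0 : g ≠ 0 := by omega
      rw [isUnit_natCast_iff_not_dvd hl0]
      rw [← ZMod.natCast_zmod_val x, isUnit_natCast_iff_not_dvd hg0] at hxu
      exact hxu
    · -- the congruence
      have hcong : K.val * x.val ^ 2 ≡ d.val [MOD p ^ g] := by
        rw [← ZMod.natCast_eq_natCast_iff, Nat.cast_mul, Nat.cast_pow, ZMod.natCast_zmod_val,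
          ZMod.natCast_zmod_val, ZMod.natCast_zmod_val]
        exact hxe
      rw [hk'] at hcong
      -- `p^e ∣ d.val`
      have hde : p ^ e ∣ d.val := by
        have h1 : p ^ e ∣ p ^ e * k' * x.val ^ 2 := ⟨k' * x.val ^ 2, by ring⟩
        exact (Nat.ModEq.dvd_iff hcong (pow_dvd_pow p he)).mp h1
      obtain ⟨d', hd'⟩ := hde
      have hdiv : d.val / p ^ e = d' := by
        rw [hd', Nat.mul_div_cancel_left _ (pow_pos hpp.pos e)]
      rw [hdiv]
      -- divide the congruence by `p^e`
      have hcong' : k' * x.val ^ 2 ≡ d' [MOD p ^ l] := by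
        have h2 : p ^ e * (k' * x.val ^ 2) ≡ p ^ e * d' [MOD p ^ e * p ^ l] := by
          rw [← pow_add, show e + l = g by omega, ← hd']
          simpa [mul_assoc] using hcong
        exact Nat.ModEq.mul_left_cancel' (pow_ne_zero e hpp.ne_zero) h2
      have := (ZMod.natCast_eq_natCast_iff _ _ _).mpr hcong'
      push_cast at this
      exact this
  refine hinj.trans ?_
  rw [card_filter_range_pow_eq hle Q, show g - l = e by omega, hG, mul_comm]
  exact Nat.mul_le_mul_right _ hQcard

/-- **`#B ≤ 12 (k, p^g)`** (HB p. 40): the critical `(m₄, m₃, m₂, m₁, j) (mod p^g)` inject, via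
`(τ, m₁) = (m₃m̄₁, m₁)`, into `{τ³ = t̄₁t₂} × {k m₁² = t₁(τ − 1)}`, of size `≤ 3 · 4(k, p^g)`.
[cite: HeathBrown1986d3, Lemma 3] -/
theorem card_critical_le {g : ℕ} (K T₁ T₂ : ZMod (p ^ g)) (hT₁ : IsUnit T₁) :
    ((Finset.univ : Finset (ZMod (p ^ g) × ZMod (p ^ g) × ZMod (p ^ g) × ZMod (p ^ g) × ZMod (p ^ g))).filter
      (fun x => (IsUnit x.2.2.2.1 ∧ IsUnit x.2.2.1 ∧ IsUnit x.2.1 ∧ IsUnit x.1) ∧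
        D4 K T₁ x.2.2.2.2 x.2.2.2.1 x.2.2.1 x.2.1 = 0 ∧ D3 K T₁ x.2.2.2.2 x.2.2.2.1 x.2.2.1 x.1 = 0 ∧
        D2 K T₂ x.2.2.2.2 x.2.2.2.1 x.2.1 x.1 = 0 ∧ D1 K T₂ x.2.2.2.2 x.2.2.1 x.2.1 x.1 = 0 ∧
        D0 K T₁ T₂ x.2.2.2.1 x.2.2.1 x.2.1 x.1 = 0)).card ≤ 12 * Nat.gcd K.val (p ^ g) := by
  classical
  -- notation: x = (m₄, m₃, m₂, m₁, j)
  set B := (Finset.univ : Finset (ZMod (p ^ g) × ZMod (p ^ g) × ZMod (p ^ g) × ZMod (p ^ g) × ZMod (p ^ g))).filter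
      (fun x => (IsUnit x.2.2.2.1 ∧ IsUnit x.2.2.1 ∧ IsUnit x.2.1 ∧ IsUnit x.1) ∧
        D4 K T₁ x.2.2.2.2 x.2.2.2.1 x.2.2.1 x.2.1 = 0 ∧ D3 K T₁ x.2.2.2.2 x.2.2.2.1 x.2.2.1 x.1 = 0 ∧
        D2 K T₂ x.2.2.2.2 x.2.2.2.1 x.2.1 x.1 = 0 ∧ D1 K T₂ x.2.2.2.2 x.2.2.1 x.2.1 x.1 = 0 ∧
        D0 K T₁ T₂ x.2.2.2.1 x.2.2.1 x.2.1 x.1 = 0) with hB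
  set Tset := (Finset.univ : Finset (ZMod (p ^ g))).filter (fun τ => IsUnit τ ∧ τ ^ 3 = T₁⁻¹ * T₂) with hTset
  set P : ZMod (p ^ g) → ZMod (p ^ g) → Prop := fun τ m => IsUnit m ∧ K * m ^ 2 = T₁ * (τ - 1) with hP
  set Cset := (Tset ×ˢ (Finset.univ : Finset (ZMod (p ^ g)))).filter (fun y => P y.1 y.2) with hCset
  -- structure of the elements of `B`
  have hstr : ∀ x ∈ B, x.2.2.1 = x.2.2.2.1 ∧ x.1 = x.2.1 ∧
      (x.2.1 * (x.2.2.2.1)⁻¹) ^ 3 = T₁⁻¹ * T₂ ∧ K * x.2.2.2.1 ^ 2 = T₁ * (x.2.1 * (x.2.2.2.1)⁻¹ - 1) ∧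
      x.2.2.2.2 * (T₂ * x.2.2.2.1 - K * x.2.2.2.1 * x.2.1 ^ 2) = 1 := by
    intro x hx
    rw [hB, Finset.mem_filter] at hx
    obtain ⟨_, ⟨h1, _, _, h4⟩, E4, E3, E2, E1, E0⟩ := hx
    exact critical_structure hT₁ h1 h4 E4 E3 E2 E1 E0
  -- (i)+(ii): inject `B` into `Cset`
  have hBC : B.card ≤ Cset.card := by
    refine Finset.card_le_card_of_injOn (fun x => (x.2.1 * (x.2.2.2.1)⁻¹, x.2.2.2.1)) (fun x hx => ?_) ?_
    · have hs := hstr x hx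
      rw [hB, Finset.mem_coe, Finset.mem_filter] at hx
      obtain ⟨_, ⟨h1, _, h3, _⟩, -⟩ := hx
      rw [Finset.mem_coe, hCset, Finset.mem_filter, Finset.mem_product, hTset, Finset.mem_filter]
      refine ⟨⟨⟨Finset.mem_univ _, ?_, hs.2.2.1⟩, Finset.mem_univ _⟩, h1, hs.2.2.2.1⟩
      exact h3.mul (IsUnit.of_mul_eq_one _ (by rw [mul_comm]; exact ZMod.mul_inv_of_unit _ h1))
    · intro a ha b hb hab
      simp only [Prod.mk.injEq] at hab
      obtain ⟨hτ, hm₁⟩ := hab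
      have hsa := hstr a ha
      have hsb := hstr b hb
      rw [hB, Finset.mem_coe, Finset.mem_filter] at ha
      obtain ⟨_, ⟨ha1, _⟩, -⟩ := ha
      -- `m₃` agree
      have hm₃ : a.2.1 = b.2.1 := by
        have i1 := ZMod.mul_inv_of_unit _ ha1
        have e : a.2.1 * (a.2.2.2.1)⁻¹ * a.2.2.2.1 = b.2.1 * (b.2.2.2.1)⁻¹ * a.2.2.2.1 := by rw [hτ]
        rw [← hm₁] at e
        calc a.2.1 = a.2.1 * (a.2.2.2.1 * (a.2.2.2.1)⁻¹) := by rw [i1, mul_one]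
          _ = a.2.1 * (a.2.2.2.1)⁻¹ * a.2.2.2.1 := by ring
          _ = b.2.1 * (a.2.2.2.1)⁻¹ * a.2.2.2.1 := e
          _ = b.2.1 * (a.2.2.2.1 * (a.2.2.2.1)⁻¹) := by ring
          _ = b.2.1 := by rw [i1, mul_one]
      -- `j` agree
      have hj : a.2.2.2.2 = b.2.2.2.2 := by
        have ea := hsa.2.2.2.2
        have eb := hsb.2.2.2.2
        rw [← hm₁, ← hm₃] at eb
        calc a.2.2.2.2 = a.2.2.2.2 * (b.2.2.2.2 * (T₂ * a.2.2.2.1 - K * a.2.2.2.1 * a.2.1 ^ 2)) := by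
              rw [eb, mul_one]
          _ = b.2.2.2.2 * (a.2.2.2.2 * (T₂ * a.2.2.2.1 - K * a.2.2.2.1 * a.2.1 ^ 2)) := by ring
          _ = b.2.2.2.2 := by rw [ea, mul_one]
      -- assemble
      have e2 : a.2.2.1 = b.2.2.1 := by rw [hsa.1, hsb.1, hm₁]
      have e4 : a.1 = b.1 := by rw [hsa.2.1, hsb.2.1, hm₃]
      exact Prod.ext e4 (Prod.ext hm₃ (Prod.ext e2 (Prod.ext hm₁ hj)))
  -- (iii): count `Cset` fibrewise
  have hC : Cset.card ≤ 3 * (4 * Nat.gcd K.val (p ^ g)) := by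
    rw [hCset, Finset.card_filter, Finset.sum_product]
    calc ∑ τ ∈ Tset, ∑ m : ZMod (p ^ g), (if P (τ, m).1 (τ, m).2 then 1 else 0)
        = ∑ τ ∈ Tset, ((Finset.univ : Finset (ZMod (p ^ g))).filter (P τ)).card := by
          refine Finset.sum_congr rfl fun τ _ => ?_
          rw [Finset.card_filter]
      _ ≤ ∑ _τ ∈ Tset, 4 * Nat.gcd K.val (p ^ g) := by
          refine Finset.sum_le_sum fun τ _ => ?_
          exact card_filter_isUnit_and_mul_sq_eq_le K (T₁ * (τ - 1))
      _ = Tset.card * (4 * Nat.gcd K.val (p ^ g)) := by rw [Finset.sum_const, smul_eq_mul]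
      _ ≤ 3 * (4 * Nat.gcd K.val (p ^ g)) :=
          Nat.mul_le_mul_right _ (card_filter_isUnit_and_pow_three_eq_le g (T₁⁻¹ * T₂))
  calc B.card ≤ Cset.card := hBC
    _ ≤ 3 * (4 * Nat.gcd K.val (p ^ g)) := hC
    _ = 12 * Nat.gcd K.val (p ^ g) := by ring

set_option maxHeartbeats 800000 in
/-- The count `#B` of `norm_SS_even_le` (over representatives, conditions read through
`ℤ/p^{2g} → ℤ/p^g`) is the cardinality of the critical set modulo `p^g`. [folklore] -/
theorem sum_range5_indicator_eq_card {g : ℕ} (hg : 1 ≤ g) (k t₁ t₂ : ZMod (p ^ (g + g))) :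
    (∑ u₄ ∈ range (p ^ g), ∑ u₃ ∈ range (p ^ g), ∑ u₂ ∈ range (p ^ g), ∑ u₁ ∈ range (p ^ g),
        ∑ u₀ ∈ range (p ^ g),
        (if (IsUnit ((u₁ : ℕ) : ZMod (p ^ (g + g))) ∧ IsUnit ((u₂ : ℕ) : ZMod (p ^ (g + g))) ∧
              IsUnit ((u₃ : ℕ) : ZMod (p ^ (g + g))) ∧ IsUnit ((u₄ : ℕ) : ZMod (p ^ (g + g)))) ∧
            ZMod.castHom (pow_dvd_pow p (Nat.le_add_left g g)) (ZMod (p ^ g))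
              (D4 k t₁ (u₀ : ZMod (p ^ (g + g))) u₁ u₂ u₃) = 0 ∧
            ZMod.castHom (pow_dvd_pow p (Nat.le_add_left g g)) (ZMod (p ^ g))
              (D3 k t₁ (u₀ : ZMod (p ^ (g + g))) u₁ u₂ u₄) = 0 ∧
            ZMod.castHom (pow_dvd_pow p (Nat.le_add_left g g)) (ZMod (p ^ g))
              (D2 k t₂ (u₀ : ZMod (p ^ (g + g))) u₁ u₃ u₄) = 0 ∧
            ZMod.castHom (pow_dvd_pow p (Nat.le_add_left g g)) (ZMod (p ^ g))
              (D1 k t₂ (u₀ : ZMod (p ^ (g + g))) u₂ u₃ u₄) = 0 ∧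
            ZMod.castHom (pow_dvd_pow p (Nat.le_add_left g g)) (ZMod (p ^ g))
              (D0 k t₁ t₂ (u₁ : ZMod (p ^ (g + g))) u₂ u₃ u₄) = 0
          then (1 : ℝ) else 0)) =
    (((Finset.univ : Finset (ZMod (p ^ g) × ZMod (p ^ g) × ZMod (p ^ g) × ZMod (p ^ g) × ZMod (p ^ g))).filter
      (fun x => (IsUnit x.2.2.2.1 ∧ IsUnit x.2.2.1 ∧ IsUnit x.2.1 ∧ IsUnit x.1) ∧
        D4 (ZMod.castHom (pow_dvd_pow p (Nat.le_add_left g g)) (ZMod (p ^ g)) k)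
          (ZMod.castHom (pow_dvd_pow p (Nat.le_add_left g g)) (ZMod (p ^ g)) t₁) x.2.2.2.2 x.2.2.2.1 x.2.2.1 x.2.1 = 0 ∧
        D3 (ZMod.castHom (pow_dvd_pow p (Nat.le_add_left g g)) (ZMod (p ^ g)) k)
          (ZMod.castHom (pow_dvd_pow p (Nat.le_add_left g g)) (ZMod (p ^ g)) t₁) x.2.2.2.2 x.2.2.2.1 x.2.2.1 x.1 = 0 ∧
        D2 (ZMod.castHom (pow_dvd_pow p (Nat.le_add_left g g)) (ZMod (p ^ g)) k)
          (ZMod.castHom (pow_dvd_pow p (Nat.le_add_left g g)) (ZMod (p ^ g)) t₂) x.2.2.2.2 x.2.2.2.1 x.2.1 x.1 = 0 ∧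
        D1 (ZMod.castHom (pow_dvd_pow p (Nat.le_add_left g g)) (ZMod (p ^ g)) k)
          (ZMod.castHom (pow_dvd_pow p (Nat.le_add_left g g)) (ZMod (p ^ g)) t₂) x.2.2.2.2 x.2.2.1 x.2.1 x.1 = 0 ∧
        D0 (ZMod.castHom (pow_dvd_pow p (Nat.le_add_left g g)) (ZMod (p ^ g)) k)
          (ZMod.castHom (pow_dvd_pow p (Nat.le_add_left g g)) (ZMod (p ^ g)) t₁)
          (ZMod.castHom (pow_dvd_pow p (Nat.le_add_left g g)) (ZMod (p ^ g)) t₂) x.2.2.2.1 x.2.2.1 x.2.1 x.1 = 0)).card : ℝ) := by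
  classical
  have hg0 : g ≠ 0 := by omega
  have hm0 : g + g ≠ 0 := by omega
  have hdvd : p ^ g ∣ p ^ (g + g) := pow_dvd_pow p (Nat.le_add_left g g)
  set π := ZMod.castHom hdvd (ZMod (p ^ g)) with hπ
  set K := π k
  set T₁ := π t₁
  set T₂ := π t₂
  set C : ZMod (p ^ g) → ZMod (p ^ g) → ZMod (p ^ g) → ZMod (p ^ g) → ZMod (p ^ g) → Prop :=
    fun m₄ m₃ m₂ m₁ j => (IsUnit m₁ ∧ IsUnit m₂ ∧ IsUnit m₃ ∧ IsUnit m₄) ∧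
      D4 K T₁ j m₁ m₂ m₃ = 0 ∧ D3 K T₁ j m₁ m₂ m₄ = 0 ∧ D2 K T₂ j m₁ m₃ m₄ = 0 ∧
      D1 K T₂ j m₂ m₃ m₄ = 0 ∧ D0 K T₁ T₂ m₁ m₂ m₃ m₄ = 0 with hC
  -- unit conditions and derivatives read mod `p^g`
  have hunit : ∀ u : ℕ, IsUnit ((u : ℕ) : ZMod (p ^ (g + g))) ↔ IsUnit ((u : ℕ) : ZMod (p ^ g)) := by
    intro u; rw [isUnit_natCast_iff_not_dvd hm0, isUnit_natCast_iff_not_dvd hg0]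
  have hterm : ∀ u₄ u₃ u₂ u₁ u₀ : ℕ,
      (if (IsUnit ((u₁ : ℕ) : ZMod (p ^ (g + g))) ∧ IsUnit ((u₂ : ℕ) : ZMod (p ^ (g + g))) ∧
            IsUnit ((u₃ : ℕ) : ZMod (p ^ (g + g))) ∧ IsUnit ((u₄ : ℕ) : ZMod (p ^ (g + g)))) ∧
          π (D4 k t₁ (u₀ : ZMod (p ^ (g + g))) u₁ u₂ u₃) = 0 ∧
          π (D3 k t₁ (u₀ : ZMod (p ^ (g + g))) u₁ u₂ u₄) = 0 ∧
          π (D2 k t₂ (u₀ : ZMod (p ^ (g + g))) u₁ u₃ u₄) = 0 ∧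
          π (D1 k t₂ (u₀ : ZMod (p ^ (g + g))) u₂ u₃ u₄) = 0 ∧
          π (D0 k t₁ t₂ (u₁ : ZMod (p ^ (g + g))) u₂ u₃ u₄) = 0
        then (1 : ℝ) else 0) =
      if C (u₄ : ZMod (p ^ g)) (u₃ : ZMod (p ^ g)) (u₂ : ZMod (p ^ g)) (u₁ : ZMod (p ^ g)) (u₀ : ZMod (p ^ g))
        then (1 : ℝ) else 0 := by
    intro u₄ u₃ u₂ u₁ u₀
    have e4 : π (D4 k t₁ (u₀ : ZMod (p ^ (g + g))) u₁ u₂ u₃) = D4 K T₁ (u₀ : ZMod (p ^ g)) u₁ u₂ u₃ := by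
      simp only [D4_def, map_add, map_mul, map_neg, map_one, map_natCast]; rfl
    have e3 : π (D3 k t₁ (u₀ : ZMod (p ^ (g + g))) u₁ u₂ u₄) = D3 K T₁ (u₀ : ZMod (p ^ g)) u₁ u₂ u₄ := by
      simp only [D3_def, map_add, map_mul, map_neg, map_one, map_natCast]; rfl
    have e2 : π (D2 k t₂ (u₀ : ZMod (p ^ (g + g))) u₁ u₃ u₄) = D2 K T₂ (u₀ : ZMod (p ^ g)) u₁ u₃ u₄ := by
      simp only [D2_def, map_add, map_sub, map_mul, map_one, map_natCast]; rfl
    have e1 : π (D1 k t₂ (u₀ : ZMod (p ^ (g + g))) u₂ u₃ u₄) = D1 K T₂ (u₀ : ZMod (p ^ g)) u₂ u₃ u₄ := by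
      simp only [D1_def, map_add, map_sub, map_mul, map_one, map_natCast]; rfl
    have e0 : π (D0 k t₁ t₂ (u₁ : ZMod (p ^ (g + g))) u₂ u₃ u₄) = D0 K T₁ T₂ (u₁ : ZMod (p ^ g)) u₂ u₃ u₄ := by
      simp only [D0_def, map_add, map_sub, map_mul, map_natCast]; rfl
    simp only [hunit, e4, e3, e2, e1, e0, hC]
  simp_rw [hterm]
  -- range sums → sums over `ZMod (p^g)`, then a cardinality
  rw [Finset.card_filter]
  push_cast
  rw [Fintype.sum_prod_type, sum_zmod_eq_sum_range]
  refine Finset.sum_congr rfl fun u₄ _ => ?_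
  rw [Fintype.sum_prod_type, sum_zmod_eq_sum_range]
  refine Finset.sum_congr rfl fun u₃ _ => ?_
  rw [Fintype.sum_prod_type, sum_zmod_eq_sum_range]
  refine Finset.sum_congr rfl fun u₂ _ => ?_
  rw [Fintype.sum_prod_type, sum_zmod_eq_sum_range]
  refine Finset.sum_congr rfl fun u₁ _ => ?_
  rw [sum_zmod_eq_sum_range]

set_option maxHeartbeats 800000 in
/-- The count `#B` of `norm_SS_odd_stage1` (modulus `p^{2g+1}`) is the cardinality of the critical set
modulo `p^g`. [folklore] -/
theorem sum_range5_indicator_eq_card_odd {g : ℕ} (hg : 1 ≤ g) (k t₁ t₂ : ZMod (p ^ (2 * g + 1))) :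
    (∑ u₄ ∈ range (p ^ g), ∑ u₃ ∈ range (p ^ g), ∑ u₂ ∈ range (p ^ g), ∑ u₁ ∈ range (p ^ g),
        ∑ u₀ ∈ range (p ^ g),
        (if (IsUnit ((u₁ : ℕ) : ZMod (p ^ (2 * g + 1))) ∧ IsUnit ((u₂ : ℕ) : ZMod (p ^ (2 * g + 1))) ∧
              IsUnit ((u₃ : ℕ) : ZMod (p ^ (2 * g + 1))) ∧ IsUnit ((u₄ : ℕ) : ZMod (p ^ (2 * g + 1)))) ∧
            ZMod.castHom (pow_dvd_pow p (by omega : g ≤ 2 * g + 1)) (ZMod (p ^ g))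
              (D4 k t₁ (u₀ : ZMod (p ^ (2 * g + 1))) u₁ u₂ u₃) = 0 ∧
            ZMod.castHom (pow_dvd_pow p (by omega : g ≤ 2 * g + 1)) (ZMod (p ^ g))
              (D3 k t₁ (u₀ : ZMod (p ^ (2 * g + 1))) u₁ u₂ u₄) = 0 ∧
            ZMod.castHom (pow_dvd_pow p (by omega : g ≤ 2 * g + 1)) (ZMod (p ^ g))
              (D2 k t₂ (u₀ : ZMod (p ^ (2 * g + 1))) u₁ u₃ u₄) = 0 ∧
            ZMod.castHom (pow_dvd_pow p (by omega : g ≤ 2 * g + 1)) (ZMod (p ^ g))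
              (D1 k t₂ (u₀ : ZMod (p ^ (2 * g + 1))) u₂ u₃ u₄) = 0 ∧
            ZMod.castHom (pow_dvd_pow p (by omega : g ≤ 2 * g + 1)) (ZMod (p ^ g))
              (D0 k t₁ t₂ (u₁ : ZMod (p ^ (2 * g + 1))) u₂ u₃ u₄) = 0
          then (1 : ℝ) else 0)) =
    (((Finset.univ : Finset (ZMod (p ^ g) × ZMod (p ^ g) × ZMod (p ^ g) × ZMod (p ^ g) × ZMod (p ^ g))).filter
      (fun x => (IsUnit x.2.2.2.1 ∧ IsUnit x.2.2.1 ∧ IsUnit x.2.1 ∧ IsUnit x.1) ∧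
        D4 (ZMod.castHom (pow_dvd_pow p (by omega : g ≤ 2 * g + 1)) (ZMod (p ^ g)) k)
          (ZMod.castHom (pow_dvd_pow p (by omega : g ≤ 2 * g + 1)) (ZMod (p ^ g)) t₁) x.2.2.2.2 x.2.2.2.1 x.2.2.1 x.2.1 = 0 ∧
        D3 (ZMod.castHom (pow_dvd_pow p (by omega : g ≤ 2 * g + 1)) (ZMod (p ^ g)) k)
          (ZMod.castHom (pow_dvd_pow p (by omega : g ≤ 2 * g + 1)) (ZMod (p ^ g)) t₁) x.2.2.2.2 x.2.2.2.1 x.2.2.1 x.1 = 0 ∧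
        D2 (ZMod.castHom (pow_dvd_pow p (by omega : g ≤ 2 * g + 1)) (ZMod (p ^ g)) k)
          (ZMod.castHom (pow_dvd_pow p (by omega : g ≤ 2 * g + 1)) (ZMod (p ^ g)) t₂) x.2.2.2.2 x.2.2.2.1 x.2.1 x.1 = 0 ∧
        D1 (ZMod.castHom (pow_dvd_pow p (by omega : g ≤ 2 * g + 1)) (ZMod (p ^ g)) k)
          (ZMod.castHom (pow_dvd_pow p (by omega : g ≤ 2 * g + 1)) (ZMod (p ^ g)) t₂) x.2.2.2.2 x.2.2.1 x.2.1 x.1 = 0 ∧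
        D0 (ZMod.castHom (pow_dvd_pow p (by omega : g ≤ 2 * g + 1)) (ZMod (p ^ g)) k)
          (ZMod.castHom (pow_dvd_pow p (by omega : g ≤ 2 * g + 1)) (ZMod (p ^ g)) t₁)
          (ZMod.castHom (pow_dvd_pow p (by omega : g ≤ 2 * g + 1)) (ZMod (p ^ g)) t₂) x.2.2.2.1 x.2.2.1 x.2.1 x.1 = 0)).card : ℝ) := by
  classical
  have hg0 : g ≠ 0 := by omega
  have hm0 : 2 * g + 1 ≠ 0 := by omega
  have hdvd : p ^ g ∣ p ^ (2 * g + 1) := pow_dvd_pow p (by omega : g ≤ 2 * g + 1)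
  set π := ZMod.castHom hdvd (ZMod (p ^ g)) with hπ
  set K := π k
  set T₁ := π t₁
  set T₂ := π t₂
  set C : ZMod (p ^ g) → ZMod (p ^ g) → ZMod (p ^ g) → ZMod (p ^ g) → ZMod (p ^ g) → Prop :=
    fun m₄ m₃ m₂ m₁ j => (IsUnit m₁ ∧ IsUnit m₂ ∧ IsUnit m₃ ∧ IsUnit m₄) ∧
      D4 K T₁ j m₁ m₂ m₃ = 0 ∧ D3 K T₁ j m₁ m₂ m₄ = 0 ∧ D2 K T₂ j m₁ m₃ m₄ = 0 ∧
      D1 K T₂ j m₂ m₃ m₄ = 0 ∧ D0 K T₁ T₂ m₁ m₂ m₃ m₄ = 0 with hC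
  -- unit conditions and derivatives read mod `p^g`
  have hunit : ∀ u : ℕ, IsUnit ((u : ℕ) : ZMod (p ^ (2 * g + 1))) ↔ IsUnit ((u : ℕ) : ZMod (p ^ g)) := by
    intro u; rw [isUnit_natCast_iff_not_dvd hm0, isUnit_natCast_iff_not_dvd hg0]
  have hterm : ∀ u₄ u₃ u₂ u₁ u₀ : ℕ,
      (if (IsUnit ((u₁ : ℕ) : ZMod (p ^ (2 * g + 1))) ∧ IsUnit ((u₂ : ℕ) : ZMod (p ^ (2 * g + 1))) ∧
            IsUnit ((u₃ : ℕ) : ZMod (p ^ (2 * g + 1))) ∧ IsUnit ((u₄ : ℕ) : ZMod (p ^ (2 * g + 1)))) ∧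
          π (D4 k t₁ (u₀ : ZMod (p ^ (2 * g + 1))) u₁ u₂ u₃) = 0 ∧
          π (D3 k t₁ (u₀ : ZMod (p ^ (2 * g + 1))) u₁ u₂ u₄) = 0 ∧
          π (D2 k t₂ (u₀ : ZMod (p ^ (2 * g + 1))) u₁ u₃ u₄) = 0 ∧
          π (D1 k t₂ (u₀ : ZMod (p ^ (2 * g + 1))) u₂ u₃ u₄) = 0 ∧
          π (D0 k t₁ t₂ (u₁ : ZMod (p ^ (2 * g + 1))) u₂ u₃ u₄) = 0
        then (1 : ℝ) else 0) =
      if C (u₄ : ZMod (p ^ g)) (u₃ : ZMod (p ^ g)) (u₂ : ZMod (p ^ g)) (u₁ : ZMod (p ^ g)) (u₀ : ZMod (p ^ g))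
        then (1 : ℝ) else 0 := by
    intro u₄ u₃ u₂ u₁ u₀
    have e4 : π (D4 k t₁ (u₀ : ZMod (p ^ (2 * g + 1))) u₁ u₂ u₃) = D4 K T₁ (u₀ : ZMod (p ^ g)) u₁ u₂ u₃ := by
      simp only [D4_def, map_add, map_mul, map_neg, map_one, map_natCast]; rfl
    have e3 : π (D3 k t₁ (u₀ : ZMod (p ^ (2 * g + 1))) u₁ u₂ u₄) = D3 K T₁ (u₀ : ZMod (p ^ g)) u₁ u₂ u₄ := by
      simp only [D3_def, map_add, map_mul, map_neg, map_one, map_natCast]; rfl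
    have e2 : π (D2 k t₂ (u₀ : ZMod (p ^ (2 * g + 1))) u₁ u₃ u₄) = D2 K T₂ (u₀ : ZMod (p ^ g)) u₁ u₃ u₄ := by
      simp only [D2_def, map_add, map_sub, map_mul, map_one, map_natCast]; rfl
    have e1 : π (D1 k t₂ (u₀ : ZMod (p ^ (2 * g + 1))) u₂ u₃ u₄) = D1 K T₂ (u₀ : ZMod (p ^ g)) u₂ u₃ u₄ := by
      simp only [D1_def, map_add, map_sub, map_mul, map_one, map_natCast]; rfl
    have e0 : π (D0 k t₁ t₂ (u₁ : ZMod (p ^ (2 * g + 1))) u₂ u₃ u₄) = D0 K T₁ T₂ (u₁ : ZMod (p ^ g)) u₂ u₃ u₄ := by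
      simp only [D0_def, map_add, map_sub, map_mul, map_natCast]; rfl
    simp only [hunit, e4, e3, e2, e1, e0, hC]
  simp_rw [hterm]
  -- range sums → sums over `ZMod (p^g)`, then a cardinality
  rw [Finset.card_filter]
  push_cast
  rw [Fintype.sum_prod_type, sum_zmod_eq_sum_range]
  refine Finset.sum_congr rfl fun u₄ _ => ?_
  rw [Fintype.sum_prod_type, sum_zmod_eq_sum_range]
  refine Finset.sum_congr rfl fun u₃ _ => ?_
  rw [Fintype.sum_prod_type, sum_zmod_eq_sum_range]
  refine Finset.sum_congr rfl fun u₂ _ => ?_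
  rw [Fintype.sum_prod_type, sum_zmod_eq_sum_range]
  refine Finset.sum_congr rfl fun u₁ _ => ?_
  rw [sum_zmod_eq_sum_range]

/-- **Heath-Brown's Lemma 3, even exponent**: for `g ≥ 1` and `p ∤ t₁`,
`|S(k, t₁, t₂, 1, 1; p^{2g})| ≤ 12 p^{5g} (k, p^g)` (here `(k, p^g)` is computed from the reduction of
`k` modulo `p^g`). [cite: HeathBrown1986d3, Lemma 3 (f even)] -/
theorem norm_SS_even_le_gcd {g : ℕ} (hg : 1 ≤ g) (k t₁ t₂ : ZMod (p ^ (g + g))) (ht₁ : IsUnit t₁) :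
    ‖SS (p ^ (g + g)) k t₁ t₂ 1 1‖ ≤ 12 * ((p : ℝ) ^ g) ^ 5 *
      Nat.gcd (ZMod.castHom (pow_dvd_pow p (Nat.le_add_left g g)) (ZMod (p ^ g)) k).val (p ^ g) := by
  refine (norm_SS_even_le hg k t₁ t₂).trans ?_
  rw [sum_range5_indicator_eq_card hg]
  have hc := card_critical_le (ZMod.castHom (pow_dvd_pow p (Nat.le_add_left g g)) (ZMod (p ^ g)) k)
    (ZMod.castHom (pow_dvd_pow p (Nat.le_add_left g g)) (ZMod (p ^ g)) t₁)
    (ZMod.castHom (pow_dvd_pow p (Nat.le_add_left g g)) (ZMod (p ^ g)) t₂) (ht₁.map _)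
  have hc' : (((Finset.univ : Finset (ZMod (p ^ g) × ZMod (p ^ g) × ZMod (p ^ g) × ZMod (p ^ g) × ZMod (p ^ g))).filter
      (fun x => (IsUnit x.2.2.2.1 ∧ IsUnit x.2.2.1 ∧ IsUnit x.2.1 ∧ IsUnit x.1) ∧
        D4 (ZMod.castHom (pow_dvd_pow p (Nat.le_add_left g g)) (ZMod (p ^ g)) k)
          (ZMod.castHom (pow_dvd_pow p (Nat.le_add_left g g)) (ZMod (p ^ g)) t₁) x.2.2.2.2 x.2.2.2.1 x.2.2.1 x.2.1 = 0 ∧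
        D3 (ZMod.castHom (pow_dvd_pow p (Nat.le_add_left g g)) (ZMod (p ^ g)) k)
          (ZMod.castHom (pow_dvd_pow p (Nat.le_add_left g g)) (ZMod (p ^ g)) t₁) x.2.2.2.2 x.2.2.2.1 x.2.2.1 x.1 = 0 ∧
        D2 (ZMod.castHom (pow_dvd_pow p (Nat.le_add_left g g)) (ZMod (p ^ g)) k)
          (ZMod.castHom (pow_dvd_pow p (Nat.le_add_left g g)) (ZMod (p ^ g)) t₂) x.2.2.2.2 x.2.2.2.1 x.2.1 x.1 = 0 ∧
        D1 (ZMod.castHom (pow_dvd_pow p (Nat.le_add_left g g)) (ZMod (p ^ g)) k)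
          (ZMod.castHom (pow_dvd_pow p (Nat.le_add_left g g)) (ZMod (p ^ g)) t₂) x.2.2.2.2 x.2.2.1 x.2.1 x.1 = 0 ∧
        D0 (ZMod.castHom (pow_dvd_pow p (Nat.le_add_left g g)) (ZMod (p ^ g)) k)
          (ZMod.castHom (pow_dvd_pow p (Nat.le_add_left g g)) (ZMod (p ^ g)) t₁)
          (ZMod.castHom (pow_dvd_pow p (Nat.le_add_left g g)) (ZMod (p ^ g)) t₂) x.2.2.2.1 x.2.2.1 x.2.1 x.1 = 0)).card : ℝ) ≤
      12 * (Nat.gcd (ZMod.castHom (pow_dvd_pow p (Nat.le_add_left g g)) (ZMod (p ^ g)) k).val (p ^ g) : ℝ) := by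
    exact_mod_cast hc
  have h0 : (0 : ℝ) ≤ ((p : ℝ) ^ g) ^ 5 := by positivity
  nlinarith

/-! ### Lemma 3, odd exponent `f = 2g + 1`: first stage -/

omit [NeZero q] hp in
/-- Reading `D4` through a ring homomorphism. [folklore] -/
theorem map_D4 {R : Type*} [CommRing R] (φ : ZMod q →+* R) (k t₁ j m₁ m₂ m₃ : ZMod q) :
    φ (D4 k t₁ j m₁ m₂ m₃) = -1 + φ j * φ k * φ m₁ * φ m₂ * φ m₃ + φ j * φ t₁ * φ m₃ := by
  simp only [D4_def, map_add, map_mul, map_neg, map_one]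

omit [NeZero q] hp in
/-- Reading `D3` through a ring homomorphism. [folklore] -/
theorem map_D3 {R : Type*} [CommRing R] (φ : ZMod q →+* R) (k t₁ j m₁ m₂ m₄ : ZMod q) :
    φ (D3 k t₁ j m₁ m₂ m₄) = -1 + φ j * φ k * φ m₁ * φ m₂ * φ m₄ + φ j * φ t₁ * φ m₄ := by
  simp only [D3_def, map_add, map_mul, map_neg, map_one]

omit [NeZero q] hp in
/-- Reading `D2` through a ring homomorphism. [folklore] -/
theorem map_D2 {R : Type*} [CommRing R] (φ : ZMod q →+* R) (k t₂ j m₁ m₃ m₄ : ZMod q) :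
    φ (D2 k t₂ j m₁ m₃ m₄) = 1 + φ j * φ k * φ m₁ * φ m₃ * φ m₄ - φ j * φ t₂ * φ m₁ := by
  simp only [D2_def, map_add, map_sub, map_mul, map_one]

omit [NeZero q] hp in
/-- Reading `D1` through a ring homomorphism. [folklore] -/
theorem map_D1 {R : Type*} [CommRing R] (φ : ZMod q →+* R) (k t₂ j m₂ m₃ m₄ : ZMod q) :
    φ (D1 k t₂ j m₂ m₃ m₄) = 1 + φ j * φ k * φ m₂ * φ m₃ * φ m₄ - φ j * φ t₂ * φ m₂ := by
  simp only [D1_def, map_add, map_sub, map_mul, map_one]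

omit [NeZero q] hp in
/-- Reading `D0` through a ring homomorphism. [folklore] -/
theorem map_D0 {R : Type*} [CommRing R] (φ : ZMod q →+* R) (k t₁ t₂ m₁ m₂ m₃ m₄ : ZMod q) :
    φ (D0 k t₁ t₂ m₁ m₂ m₃ m₄) =
      φ k * φ m₁ * φ m₂ * φ m₃ * φ m₄ + φ t₁ * φ m₃ * φ m₄ - φ t₂ * φ m₁ * φ m₂ := by
  simp only [D0_def, map_add, map_sub, map_mul]

omit hp in
/-- The reduction mod `p^g` does not see the digit `p^g t`. [folklore] -/
theorem castHom_natCast_add_pow_mul {g m : ℕ} (h : p ^ g ∣ p ^ m) (w t : ℕ) :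
    ZMod.castHom h (ZMod (p ^ g)) (((w + p ^ g * t : ℕ) : ZMod (p ^ m))) =
      ZMod.castHom h (ZMod (p ^ g)) ((w : ℕ) : ZMod (p ^ m)) := by
  rw [map_natCast, map_natCast, Nat.cast_add, Nat.cast_mul, ZMod.natCast_self, zero_mul, add_zero]

set_option maxHeartbeats 1600000 in
/-- **Lemma 3, odd exponent, first stage**: for `g ≥ 1`,
`|S(k, t₁, t₂, 1, 1; p^{2g+1})| ≤ p^{5g} ∑_{w ∈ B} |∑_{t (mod p)^5} e_{p^{2g+1}}(F(w + p^g t))|`, the sum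
over the critical representatives `w (mod p^g)` (five peels with `k = g + 1`, `l = g`, then the digit
split `u = w + p^g t`; the weight is `p^g`-periodic). [cite: HeathBrown1986d3, Lemma 2 (f = 2g+1)] -/
theorem norm_SS_odd_stage1 {g : ℕ} (hg : 1 ≤ g) (kk t₁ t₂ : ZMod (p ^ (2 * g + 1))) :
    ‖SS (p ^ (2 * g + 1)) kk t₁ t₂ 1 1‖ ≤ ((p : ℝ) ^ g) ^ 5 *
      ∑ w₄ ∈ range (p ^ g), ∑ w₃ ∈ range (p ^ g), ∑ w₂ ∈ range (p ^ g), ∑ w₁ ∈ range (p ^ g),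
        ∑ w₀ ∈ range (p ^ g),
        (if (IsUnit ((w₁ : ℕ) : ZMod (p ^ (2 * g + 1))) ∧ IsUnit ((w₂ : ℕ) : ZMod (p ^ (2 * g + 1))) ∧
              IsUnit ((w₃ : ℕ) : ZMod (p ^ (2 * g + 1))) ∧ IsUnit ((w₄ : ℕ) : ZMod (p ^ (2 * g + 1)))) ∧
            ZMod.castHom (pow_dvd_pow p (by omega : g ≤ 2 * g + 1)) (ZMod (p ^ g))
              (D4 kk t₁ (w₀ : ZMod (p ^ (2 * g + 1))) w₁ w₂ w₃) = 0 ∧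
            ZMod.castHom (pow_dvd_pow p (by omega : g ≤ 2 * g + 1)) (ZMod (p ^ g))
              (D3 kk t₁ (w₀ : ZMod (p ^ (2 * g + 1))) w₁ w₂ w₄) = 0 ∧
            ZMod.castHom (pow_dvd_pow p (by omega : g ≤ 2 * g + 1)) (ZMod (p ^ g))
              (D2 kk t₂ (w₀ : ZMod (p ^ (2 * g + 1))) w₁ w₃ w₄) = 0 ∧
            ZMod.castHom (pow_dvd_pow p (by omega : g ≤ 2 * g + 1)) (ZMod (p ^ g))
              (D1 kk t₂ (w₀ : ZMod (p ^ (2 * g + 1))) w₂ w₃ w₄) = 0 ∧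
            ZMod.castHom (pow_dvd_pow p (by omega : g ≤ 2 * g + 1)) (ZMod (p ^ g))
              (D0 kk t₁ t₂ (w₁ : ZMod (p ^ (2 * g + 1))) w₂ w₃ w₄) = 0
          then ‖∑ s₄ ∈ range p, ∑ s₃ ∈ range p, ∑ s₂ ∈ range p, ∑ s₁ ∈ range p, ∑ s₀ ∈ range p,
            (ZMod.stdAddChar (F311 kk t₁ t₂ ((w₀ + p ^ g * s₀ : ℕ) : ZMod (p ^ (2 * g + 1)))
              ((w₁ + p ^ g * s₁ : ℕ) : ZMod (p ^ (2 * g + 1))) ((w₂ + p ^ g * s₂ : ℕ) : ZMod (p ^ (2 * g + 1)))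
              ((w₃ + p ^ g * s₃ : ℕ) : ZMod (p ^ (2 * g + 1))) ((w₄ + p ^ g * s₄ : ℕ) : ZMod (p ^ (2 * g + 1)))) : ℂ)‖
          else 0) := by
  classical
  have hm2 : 2 ≤ 2 * g + 1 := by omega
  have hdvd : p ^ g ∣ p ^ (2 * g + 1) := pow_dvd_pow p (by omega : g ≤ 2 * g + 1)
  have hg0 : g ≠ 0 := by omega
  set π := ZMod.castHom hdvd (ZMod (p ^ g)) with hπ
  rw [SS_primePow_eq hm2, sum5_F311_eq (k := g + 1) (l := g) (m := 2 * g + 1) (by omega) (by omega)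
    (by omega) kk t₁ t₂, show range (p ^ (g + 1)) = range (p ^ g * p) by rw [pow_succ], sum_range_split5,
    Finset.mul_sum]
  have hπ' : ∀ h : p ^ g ∣ p ^ (2 * g + 1), ZMod.castHom h (ZMod (p ^ g)) = π := fun h => rfl
  simp only [hπ']
  refine (norm_sum_le _ _).trans (Finset.sum_le_sum fun w₄ _ => ?_)
  rw [Finset.mul_sum]
  refine (norm_sum_le _ _).trans (Finset.sum_le_sum fun w₃ _ => ?_)
  rw [Finset.mul_sum]
  refine (norm_sum_le _ _).trans (Finset.sum_le_sum fun w₂ _ => ?_)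
  rw [Finset.mul_sum]
  refine (norm_sum_le _ _).trans (Finset.sum_le_sum fun w₁ _ => ?_)
  rw [Finset.mul_sum]
  refine (norm_sum_le _ _).trans (Finset.sum_le_sum fun w₀ _ => ?_)
  -- invariance of the weight under `w ↦ w + p^g s`
  have hU : ∀ w t : ℕ, IsUnit (((w + p ^ g * t : ℕ)) : ZMod (p ^ (2 * g + 1))) ↔
      IsUnit ((w : ℕ) : ZMod (p ^ (2 * g + 1))) := fun w t => isUnit_natCast_add_pow_mul_iff (Or.inr hg0) w t
  have hc := fun w t => castHom_natCast_add_pow_mul (p := p) hdvd w t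
  have hI4 : ∀ s₀ s₁ s₂ s₃ : ℕ, π (D4 kk t₁ ((w₀ + p ^ g * s₀ : ℕ) : ZMod (p ^ (2 * g + 1)))
      ((w₁ + p ^ g * s₁ : ℕ) : ZMod (p ^ (2 * g + 1))) ((w₂ + p ^ g * s₂ : ℕ) : ZMod (p ^ (2 * g + 1)))
      ((w₃ + p ^ g * s₃ : ℕ) : ZMod (p ^ (2 * g + 1)))) = π (D4 kk t₁ (w₀ : ZMod (p ^ (2 * g + 1))) w₁ w₂ w₃) := by
    intro s₀ s₁ s₂ s₃; rw [map_D4, map_D4, hc, hc, hc, hc]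
  have hI3 : ∀ s₀ s₁ s₂ s₄ : ℕ, π (D3 kk t₁ ((w₀ + p ^ g * s₀ : ℕ) : ZMod (p ^ (2 * g + 1)))
      ((w₁ + p ^ g * s₁ : ℕ) : ZMod (p ^ (2 * g + 1))) ((w₂ + p ^ g * s₂ : ℕ) : ZMod (p ^ (2 * g + 1)))
      ((w₄ + p ^ g * s₄ : ℕ) : ZMod (p ^ (2 * g + 1)))) = π (D3 kk t₁ (w₀ : ZMod (p ^ (2 * g + 1))) w₁ w₂ w₄) := by
    intro s₀ s₁ s₂ s₄; rw [map_D3, map_D3, hc, hc, hc, hc]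
  have hI2 : ∀ s₀ s₁ s₃ s₄ : ℕ, π (D2 kk t₂ ((w₀ + p ^ g * s₀ : ℕ) : ZMod (p ^ (2 * g + 1)))
      ((w₁ + p ^ g * s₁ : ℕ) : ZMod (p ^ (2 * g + 1))) ((w₃ + p ^ g * s₃ : ℕ) : ZMod (p ^ (2 * g + 1)))
      ((w₄ + p ^ g * s₄ : ℕ) : ZMod (p ^ (2 * g + 1)))) = π (D2 kk t₂ (w₀ : ZMod (p ^ (2 * g + 1))) w₁ w₃ w₄) := by
    intro s₀ s₁ s₃ s₄; rw [map_D2, map_D2, hc, hc, hc, hc]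
  have hI1 : ∀ s₀ s₂ s₃ s₄ : ℕ, π (D1 kk t₂ ((w₀ + p ^ g * s₀ : ℕ) : ZMod (p ^ (2 * g + 1)))
      ((w₂ + p ^ g * s₂ : ℕ) : ZMod (p ^ (2 * g + 1))) ((w₃ + p ^ g * s₃ : ℕ) : ZMod (p ^ (2 * g + 1)))
      ((w₄ + p ^ g * s₄ : ℕ) : ZMod (p ^ (2 * g + 1)))) = π (D1 kk t₂ (w₀ : ZMod (p ^ (2 * g + 1))) w₂ w₃ w₄) := by
    intro s₀ s₂ s₃ s₄; rw [map_D1, map_D1, hc, hc, hc, hc]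
  have hI0 : ∀ s₁ s₂ s₃ s₄ : ℕ, π (D0 kk t₁ t₂ ((w₁ + p ^ g * s₁ : ℕ) : ZMod (p ^ (2 * g + 1)))
      ((w₂ + p ^ g * s₂ : ℕ) : ZMod (p ^ (2 * g + 1))) ((w₃ + p ^ g * s₃ : ℕ) : ZMod (p ^ (2 * g + 1)))
      ((w₄ + p ^ g * s₄ : ℕ) : ZMod (p ^ (2 * g + 1)))) = π (D0 kk t₁ t₂ (w₁ : ZMod (p ^ (2 * g + 1))) w₂ w₃ w₄) := by
    intro s₁ s₂ s₃ s₄; rw [map_D0, map_D0, hc, hc, hc, hc]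
  simp_rw [hU, hI4, hI3, hI2, hI1, hI0, ← Finset.mul_sum]
  rw [norm_mul, norm_mul, norm_mul, norm_mul, norm_mul, norm_mul,
    norm_ite_natCast, norm_ite_natCast, norm_ite_natCast, norm_ite_natCast, norm_ite_natCast]
  have hw : ‖(if IsUnit ((w₁ : ℕ) : ZMod (p ^ (2 * g + 1))) ∧ IsUnit ((w₂ : ℕ) : ZMod (p ^ (2 * g + 1))) ∧
      IsUnit ((w₃ : ℕ) : ZMod (p ^ (2 * g + 1))) ∧ IsUnit ((w₄ : ℕ) : ZMod (p ^ (2 * g + 1))) then (1 : ℂ) else 0)‖ =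
      if IsUnit ((w₁ : ℕ) : ZMod (p ^ (2 * g + 1))) ∧ IsUnit ((w₂ : ℕ) : ZMod (p ^ (2 * g + 1))) ∧
        IsUnit ((w₃ : ℕ) : ZMod (p ^ (2 * g + 1))) ∧ IsUnit ((w₄ : ℕ) : ZMod (p ^ (2 * g + 1))) then (1 : ℝ) else 0 := by
    split_ifs <;> simp
  rw [hw]
  by_cases hcond : (IsUnit ((w₁ : ℕ) : ZMod (p ^ (2 * g + 1))) ∧ IsUnit ((w₂ : ℕ) : ZMod (p ^ (2 * g + 1))) ∧
      IsUnit ((w₃ : ℕ) : ZMod (p ^ (2 * g + 1))) ∧ IsUnit ((w₄ : ℕ) : ZMod (p ^ (2 * g + 1)))) ∧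
    π (D4 kk t₁ (w₀ : ZMod (p ^ (2 * g + 1))) w₁ w₂ w₃) = 0 ∧
    π (D3 kk t₁ (w₀ : ZMod (p ^ (2 * g + 1))) w₁ w₂ w₄) = 0 ∧
    π (D2 kk t₂ (w₀ : ZMod (p ^ (2 * g + 1))) w₁ w₃ w₄) = 0 ∧
    π (D1 kk t₂ (w₀ : ZMod (p ^ (2 * g + 1))) w₂ w₃ w₄) = 0 ∧
    π (D0 kk t₁ t₂ (w₁ : ZMod (p ^ (2 * g + 1))) w₂ w₃ w₄) = 0
  · obtain ⟨hUn, h4, h3, h2, h1, h0'⟩ := hcond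
    rw [if_pos hUn, if_pos h4, if_pos h3, if_pos h2, if_pos h1, if_pos h0', if_pos ⟨hUn, h4, h3, h2, h1, h0'⟩]
    push_cast
    refine le_of_eq ?_
    ring
  · rw [if_neg hcond, mul_zero]
    simp only [not_and_or] at hcond
    refine le_of_eq ?_
    rcases hcond with h | h | h | h | h | h
    · rw [if_neg (by tauto)]; ring
    all_goals rw [if_neg h]; ring

/-! ### Lemma 3, odd exponent: the second-order expansion of `F` -/

/-- The quadratic part `Q_w(s) = ∑_{i<j} (∂²F/∂xᵢ∂xⱼ)(w) sᵢ sⱼ` of the Taylor expansion of `F` (3.11)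
(`F` is multilinear in `m` and linear in `j`, so the Hessian has zero diagonal). [cite: HeathBrown1986d3, §3 p.39] -/
def Q311 (kk t₁ t₂ j m₁ m₂ m₃ m₄ s₀ s₁ s₂ s₃ s₄ : ZMod q) : ZMod q :=
  j * kk * m₁ * m₂ * s₃ * s₄ + j * kk * m₁ * m₃ * s₂ * s₄ + j * kk * m₁ * m₄ * s₂ * s₃ +
  j * kk * m₂ * m₃ * s₁ * s₄ + j * kk * m₂ * m₄ * s₁ * s₃ + j * kk * m₃ * m₄ * s₁ * s₂ -
  j * s₁ * s₂ * t₂ + j * s₃ * s₄ * t₁ + kk * m₁ * m₂ * m₃ * s₀ * s₄ + kk * m₁ * m₂ * m₄ * s₀ * s₃ +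
  kk * m₁ * m₃ * m₄ * s₀ * s₂ + kk * m₂ * m₃ * m₄ * s₀ * s₁ - m₁ * s₀ * s₂ * t₂ - m₂ * s₀ * s₁ * t₂ +
  m₃ * s₀ * s₄ * t₁ + m₄ * s₀ * s₃ * t₁

/-- The third-and-higher-order remainder `R` with `F(w + Ps) = F(w) + P(s·∇F) + P²Q + P³R`. [folklore] -/
def R311 (kk t₁ t₂ P j m₁ m₂ m₃ m₄ s₀ s₁ s₂ s₃ s₄ : ZMod q) : ZMod q :=
  P * j * kk * s₁ * s₂ * s₃ * s₄ + P * kk * m₁ * s₀ * s₂ * s₃ * s₄ + P * kk * m₂ * s₀ * s₁ * s₃ * s₄ +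
  P * kk * m₃ * s₀ * s₁ * s₂ * s₄ + P * kk * m₄ * s₀ * s₁ * s₂ * s₃ + P ^ 2 * kk * s₀ * s₁ * s₂ * s₃ * s₄ +
  j * kk * m₁ * s₂ * s₃ * s₄ + j * kk * m₂ * s₁ * s₃ * s₄ + j * kk * m₃ * s₁ * s₂ * s₄ + j * kk * m₄ * s₁ * s₂ * s₃ +
  kk * m₁ * m₂ * s₀ * s₃ * s₄ + kk * m₁ * m₃ * s₀ * s₂ * s₄ + kk * m₁ * m₄ * s₀ * s₂ * s₃ +
  kk * m₂ * m₃ * s₀ * s₁ * s₄ + kk * m₂ * m₄ * s₀ * s₁ * s₃ + kk * m₃ * m₄ * s₀ * s₁ * s₂ - s₀ * s₁ * s₂ * t₂ + s₀ * s₃ * s₄ * t₁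

omit [NeZero q] in
/-- **The exact second-order Taylor expansion of `F`** (3.11):
`F(w + Ps) = F(w) + P (s·∇F(w)) + P² Q_w(s) + P³ R`. [cite: HeathBrown1986d3, §3 p.39] -/
theorem F311_taylor2 (kk t₁ t₂ P j m₁ m₂ m₃ m₄ s₀ s₁ s₂ s₃ s₄ : ZMod q) :
    F311 kk t₁ t₂ (j + P * s₀) (m₁ + P * s₁) (m₂ + P * s₂) (m₃ + P * s₃) (m₄ + P * s₄) =
      F311 kk t₁ t₂ j m₁ m₂ m₃ m₄ +
        P * (s₀ * D0 kk t₁ t₂ m₁ m₂ m₃ m₄ + s₁ * D1 kk t₂ j m₂ m₃ m₄ + s₂ * D2 kk t₂ j m₁ m₃ m₄ +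
          s₃ * D3 kk t₁ j m₁ m₂ m₄ + s₄ * D4 kk t₁ j m₁ m₂ m₃) +
        P ^ 2 * Q311 kk t₁ t₂ j m₁ m₂ m₃ m₄ s₀ s₁ s₂ s₃ s₄ +
        P ^ 3 * R311 kk t₁ t₂ P j m₁ m₂ m₃ m₄ s₀ s₁ s₂ s₃ s₄ := by
  simp only [F311_def, D0_def, D1_def, D2_def, D3_def, D4_def, Q311, R311]
  ring

end PrimePow

/-! ### Weyl differencing for the inner five-variable sum -/

/-- The inhomogeneous quadratic phase `Φ(x) = c·x + Q_w(x)` on `(ℤ/q)^5`. [folklore] -/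
def PhiQ (kk t₁ t₂ j m₁ m₂ m₃ m₄ c₀ c₁ c₂ c₃ c₄ : ZMod q)
    (v : ZMod q × ZMod q × ZMod q × ZMod q × ZMod q) : ZMod q :=
  c₀ * v.1 + c₁ * v.2.1 + c₂ * v.2.2.1 + c₃ * v.2.2.2.1 + c₄ * v.2.2.2.2 +
    Q311 kk t₁ t₂ j m₁ m₂ m₃ m₄ v.1 v.2.1 v.2.2.1 v.2.2.2.1 v.2.2.2.2

/-- Row `0` of the Hessian matrix `M` applied to `h`. [folklore] -/
def M0 (kk t₁ t₂ m₁ m₂ m₃ m₄ : ZMod q) (h : ZMod q × ZMod q × ZMod q × ZMod q × ZMod q) : ZMod q :=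
  (kk * m₂ * m₃ * m₄ - m₂ * t₂) * h.2.1 + (kk * m₁ * m₃ * m₄ - m₁ * t₂) * h.2.2.1 +
    (kk * m₁ * m₂ * m₄ + m₄ * t₁) * h.2.2.2.1 + (kk * m₁ * m₂ * m₃ + m₃ * t₁) * h.2.2.2.2
/-- Row `1` of `M h`. [folklore] -/
def M1 (kk t₂ j m₂ m₃ m₄ : ZMod q) (h : ZMod q × ZMod q × ZMod q × ZMod q × ZMod q) : ZMod q :=
  (kk * m₂ * m₃ * m₄ - m₂ * t₂) * h.1 + (j * kk * m₃ * m₄ - j * t₂) * h.2.2.1 +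
    (j * kk * m₂ * m₄) * h.2.2.2.1 + (j * kk * m₂ * m₃) * h.2.2.2.2
/-- Row `2` of `M h`. [folklore] -/
def M2 (kk t₂ j m₁ m₃ m₄ : ZMod q) (h : ZMod q × ZMod q × ZMod q × ZMod q × ZMod q) : ZMod q :=
  (kk * m₁ * m₃ * m₄ - m₁ * t₂) * h.1 + (j * kk * m₃ * m₄ - j * t₂) * h.2.1 +
    (j * kk * m₁ * m₄) * h.2.2.2.1 + (j * kk * m₁ * m₃) * h.2.2.2.2
/-- Row `3` of `M h`. [folklore] -/
def M3 (kk t₁ j m₁ m₂ m₄ : ZMod q) (h : ZMod q × ZMod q × ZMod q × ZMod q × ZMod q) : ZMod q :=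
  (kk * m₁ * m₂ * m₄ + m₄ * t₁) * h.1 + (j * kk * m₂ * m₄) * h.2.1 + (j * kk * m₁ * m₄) * h.2.2.1 +
    (j * kk * m₁ * m₂ + j * t₁) * h.2.2.2.2
/-- Row `4` of `M h`. [folklore] -/
def M4 (kk t₁ j m₁ m₂ m₃ : ZMod q) (h : ZMod q × ZMod q × ZMod q × ZMod q × ZMod q) : ZMod q :=
  (kk * m₁ * m₂ * m₃ + m₃ * t₁) * h.1 + (j * kk * m₂ * m₃) * h.2.1 + (j * kk * m₁ * m₃) * h.2.2.1 +
    (j * kk * m₁ * m₂ + j * t₁) * h.2.2.2.1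

omit [NeZero q] in
/-- **The differencing identity** `Φ(v + h) − Φ(v) = Φ(h) + v·(M h)`. [folklore] -/
theorem PhiQ_add_sub (kk t₁ t₂ j m₁ m₂ m₃ m₄ c₀ c₁ c₂ c₃ c₄ : ZMod q)
    (v h : ZMod q × ZMod q × ZMod q × ZMod q × ZMod q) :
    PhiQ kk t₁ t₂ j m₁ m₂ m₃ m₄ c₀ c₁ c₂ c₃ c₄ (v + h) - PhiQ kk t₁ t₂ j m₁ m₂ m₃ m₄ c₀ c₁ c₂ c₃ c₄ v =
      PhiQ kk t₁ t₂ j m₁ m₂ m₃ m₄ c₀ c₁ c₂ c₃ c₄ h +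
        (v.1 * M0 kk t₁ t₂ m₁ m₂ m₃ m₄ h + v.2.1 * M1 kk t₂ j m₂ m₃ m₄ h +
          v.2.2.1 * M2 kk t₂ j m₁ m₃ m₄ h + v.2.2.2.1 * M3 kk t₁ j m₁ m₂ m₄ h +
          v.2.2.2.2 * M4 kk t₁ j m₁ m₂ m₃ h) := by
  simp only [PhiQ, Q311, M0, M1, M2, M3, M4, Prod.fst_add, Prod.snd_add]
  ring

/-- The complete sum of a linear phase in five variables. [folklore] -/
theorem sum_stdAddChar_linear5 (a₀ a₁ a₂ a₃ a₄ : ZMod q) :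
    ∑ v : ZMod q × ZMod q × ZMod q × ZMod q × ZMod q,
      (ZMod.stdAddChar (v.1 * a₀ + v.2.1 * a₁ + v.2.2.1 * a₂ + v.2.2.2.1 * a₃ + v.2.2.2.2 * a₄) : ℂ) =
      (if a₀ = 0 then (q : ℂ) else 0) * (if a₁ = 0 then (q : ℂ) else 0) * (if a₂ = 0 then (q : ℂ) else 0) *
        (if a₃ = 0 then (q : ℂ) else 0) * (if a₄ = 0 then (q : ℂ) else 0) := by
  rw [Fintype.sum_prod_type]
  simp only []
  have e : ∀ (x : ZMod q) (r : ZMod q × ZMod q × ZMod q × ZMod q),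
      (ZMod.stdAddChar (x * a₀ + r.1 * a₁ + r.2.1 * a₂ + r.2.2.1 * a₃ + r.2.2.2 * a₄) : ℂ) =
      (ZMod.stdAddChar (x * a₀) : ℂ) * ZMod.stdAddChar (r.1 * a₁ + r.2.1 * a₂ + r.2.2.1 * a₃ + r.2.2.2 * a₄) := by
    intro x r; rw [← AddChar.map_add_eq_mul]; congr 1; ring
  simp_rw [e, ← Finset.mul_sum, ← Finset.sum_mul, sum_stdAddChar_mul_right]
  rw [Fintype.sum_prod_type]
  have e1 : ∀ (x : ZMod q) (r : ZMod q × ZMod q × ZMod q),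
      (ZMod.stdAddChar (x * a₁ + r.1 * a₂ + r.2.1 * a₃ + r.2.2 * a₄) : ℂ) =
      (ZMod.stdAddChar (x * a₁) : ℂ) * ZMod.stdAddChar (r.1 * a₂ + r.2.1 * a₃ + r.2.2 * a₄) := by
    intro x r; rw [← AddChar.map_add_eq_mul]; congr 1; ring
  simp_rw [e1, ← Finset.mul_sum, ← Finset.sum_mul, sum_stdAddChar_mul_right]
  rw [Fintype.sum_prod_type]
  have e2 : ∀ (x : ZMod q) (r : ZMod q × ZMod q),
      (ZMod.stdAddChar (x * a₂ + r.1 * a₃ + r.2 * a₄) : ℂ) =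
      (ZMod.stdAddChar (x * a₂) : ℂ) * ZMod.stdAddChar (r.1 * a₃ + r.2 * a₄) := by
    intro x r; rw [← AddChar.map_add_eq_mul]; congr 1; ring
  simp_rw [e2, ← Finset.mul_sum, ← Finset.sum_mul, sum_stdAddChar_mul_right]
  rw [Fintype.sum_prod_type]
  have e3 : ∀ (x y : ZMod q), (ZMod.stdAddChar (x * a₃ + y * a₄) : ℂ) =
      (ZMod.stdAddChar (x * a₃) : ℂ) * ZMod.stdAddChar (y * a₄) := by
    intro x y; rw [← AddChar.map_add_eq_mul]
  simp_rw [e3, ← Finset.mul_sum, ← Finset.sum_mul, sum_stdAddChar_mul_right]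
  ring

set_option maxHeartbeats 800000 in
/-- **Weyl differencing**: `|∑_{v ∈ (ℤ/q)^5} e_q(Φ(v))|² ≤ q⁵ · #{h : M h = 0}` for the quadratic
phase `Φ = c·x + Q_w(x)` with Hessian matrix `M` (zero diagonal). [folklore] -/
theorem norm_sq_sum_PhiQ_le (kk t₁ t₂ j m₁ m₂ m₃ m₄ c₀ c₁ c₂ c₃ c₄ : ZMod q) :
    ‖∑ v : ZMod q × ZMod q × ZMod q × ZMod q × ZMod q,
        (ZMod.stdAddChar (PhiQ kk t₁ t₂ j m₁ m₂ m₃ m₄ c₀ c₁ c₂ c₃ c₄ v) : ℂ)‖ ^ 2 ≤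
      (q : ℝ) ^ 5 * ((Finset.univ : Finset (ZMod q × ZMod q × ZMod q × ZMod q × ZMod q)).filter
        (fun h => M0 kk t₁ t₂ m₁ m₂ m₃ m₄ h = 0 ∧ M1 kk t₂ j m₂ m₃ m₄ h = 0 ∧
          M2 kk t₂ j m₁ m₃ m₄ h = 0 ∧ M3 kk t₁ j m₁ m₂ m₄ h = 0 ∧ M4 kk t₁ j m₁ m₂ m₃ h = 0)).card := by
  classical
  set Φ := PhiQ kk t₁ t₂ j m₁ m₂ m₃ m₄ c₀ c₁ c₂ c₃ c₄ with hΦ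
  set ψ : ZMod q → ℂ := fun x => (ZMod.stdAddChar x : ℂ) with hψ
  set G : ℂ := ∑ v : ZMod q × ZMod q × ZMod q × ZMod q × ZMod q, ψ (Φ v) with hG
  set B : (ZMod q × ZMod q × ZMod q × ZMod q × ZMod q) → (ZMod q × ZMod q × ZMod q × ZMod q × ZMod q) → ZMod q :=
    fun v h => v.1 * M0 kk t₁ t₂ m₁ m₂ m₃ m₄ h + v.2.1 * M1 kk t₂ j m₂ m₃ m₄ h +
      v.2.2.1 * M2 kk t₂ j m₁ m₃ m₄ h + v.2.2.2.1 * M3 kk t₁ j m₁ m₂ m₄ h +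
      v.2.2.2.2 * M4 kk t₁ j m₁ m₂ m₃ h with hB
  -- `conj G · G = ∑_h ψ(Φ h) ∑_v ψ(B(v, h))`
  have h1 : starRingEnd ℂ G * G = ∑ h : ZMod q × ZMod q × ZMod q × ZMod q × ZMod q,
      ψ (Φ h) * ∑ v : ZMod q × ZMod q × ZMod q × ZMod q × ZMod q, ψ (B v h) := by
    rw [hG, map_sum, Finset.sum_mul_sum]
    rw [← Fintype.sum_prod_type' (fun v u => starRingEnd ℂ (ψ (Φ v)) * ψ (Φ u))]
    -- reindex `(v, u) = (v, v + h)`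
    rw [← Equiv.sum_comp (Equiv.prodShear (Equiv.refl _)
      (fun v : ZMod q × ZMod q × ZMod q × ZMod q × ZMod q => Equiv.addLeft v)), Fintype.sum_prod_type_right]
    refine Finset.sum_congr rfl fun h _ => ?_
    rw [Finset.mul_sum]
    refine Finset.sum_congr rfl fun v _ => ?_
    simp only [Equiv.prodShear_apply, Equiv.refl_apply, Equiv.coe_addLeft, hψ]
    rw [conj_stdAddChar, ← AddChar.map_add_eq_mul, ← AddChar.map_add_eq_mul]
    congr 1
    have := PhiQ_add_sub kk t₁ t₂ j m₁ m₂ m₃ m₄ c₀ c₁ c₂ c₃ c₄ v h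
    rw [← hΦ] at this
    simp only [hB]
    linear_combination this
  -- the inner sum
  have h2 : ∀ h : ZMod q × ZMod q × ZMod q × ZMod q × ZMod q,
      ‖∑ v : ZMod q × ZMod q × ZMod q × ZMod q × ZMod q, ψ (B v h)‖ =
      if M0 kk t₁ t₂ m₁ m₂ m₃ m₄ h = 0 ∧ M1 kk t₂ j m₂ m₃ m₄ h = 0 ∧
          M2 kk t₂ j m₁ m₃ m₄ h = 0 ∧ M3 kk t₁ j m₁ m₂ m₄ h = 0 ∧ M4 kk t₁ j m₁ m₂ m₃ h = 0
        then (q : ℝ) ^ 5 else 0 := by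
    intro h
    simp only [hB, hψ]
    rw [sum_stdAddChar_linear5]
    split_ifs <;> (simp_all; try ring)
  -- assemble
  have h3 : ‖G‖ ^ 2 = ‖starRingEnd ℂ G * G‖ := by
    rw [norm_mul, Complex.norm_conj, sq]
  rw [h3, h1]
  refine (norm_sum_le _ _).trans (le_of_eq ?_)
  calc ∑ h : ZMod q × ZMod q × ZMod q × ZMod q × ZMod q,
        ‖ψ (Φ h) * ∑ v : ZMod q × ZMod q × ZMod q × ZMod q × ZMod q, ψ (B v h)‖
      = ∑ h : ZMod q × ZMod q × ZMod q × ZMod q × ZMod q,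
        (if M0 kk t₁ t₂ m₁ m₂ m₃ m₄ h = 0 ∧ M1 kk t₂ j m₂ m₃ m₄ h = 0 ∧
          M2 kk t₂ j m₁ m₃ m₄ h = 0 ∧ M3 kk t₁ j m₁ m₂ m₄ h = 0 ∧ M4 kk t₁ j m₁ m₂ m₃ h = 0
        then (q : ℝ) ^ 5 else 0) := by
          refine Finset.sum_congr rfl fun h _ => ?_
          rw [norm_mul, hψ, norm_stdAddChar, one_mul, ← hψ, h2]
    _ = (q : ℝ) ^ 5 * _ := by
          rw [← Finset.sum_filter, Finset.sum_const, nsmul_eq_mul, mul_comm]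



/-! ### The kernel of the Hessian at a critical point (HB p. 40) -/

section Kernel

variable {p : ℕ} [hp : Fact p.Prime]

/-- **The Hessian kernel at a critical point has at most `p` elements** (rank `≥ 4`; HB p. 40): over
`𝔽_p`, `p` odd, with `m₂ = m₁`, `m₄ = m₃`, `k m₁³ = t₁(m₃ − m₁)`, `t₂ m₁³ = t₁ m₃³` and
`j, t₁, m₁, m₃ ≠ 0`, every `h` with `M h = 0` is determined by its coordinate `h₁`.
[cite: HeathBrown1986d3, Lemma 3 (p.40)] -/
theorem kernel_determined (hp2 : p ≠ 2) {K T₁ T₂ j m₁ m₃ : ZMod p} (hj : j ≠ 0) (hT₁ : T₁ ≠ 0)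
    (hm₁ : m₁ ≠ 0) (hm₃ : m₃ ≠ 0) (R1 : K * m₁ ^ 3 = T₁ * (m₃ - m₁)) (R2 : T₂ * m₁ ^ 3 = T₁ * m₃ ^ 3)
    {h : ZMod p × ZMod p × ZMod p × ZMod p × ZMod p}
    (E0 : M0 K T₁ T₂ m₁ m₁ m₃ m₃ h = 0) (E1 : M1 K T₂ j m₁ m₃ m₃ h = 0) (E2 : M2 K T₂ j m₁ m₃ m₃ h = 0)
    (E3 : M3 K T₁ j m₁ m₁ m₃ h = 0) (E4 : M4 K T₁ j m₁ m₁ m₃ h = 0) :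
    h.2.2.1 = h.2.1 ∧ h.2.2.2.1 = h.2.1 ∧ h.2.2.2.2 = h.2.1 ∧
      h.1 * (K * m₁ * m₃ ^ 2 - m₁ * T₂) = -((j * K * m₃ * m₃ - j * T₂) + 2 * (j * K * m₁ * m₃)) * h.2.1 := by
  simp only [M0, M1, M2, M3, M4] at E0 E1 E2 E3 E4
  -- the entries at the critical point
  have e01 : (K * m₁ * m₃ * m₃ - m₁ * T₂) * m₁ ^ 2 = -(T₁ * m₁ * m₃ ^ 2) := by
    linear_combination m₃ ^ 2 * R1 - R2
  have e03 : (K * m₁ * m₁ * m₃ + m₃ * T₁) * m₁ = T₁ * m₃ ^ 2 := by linear_combination m₃ * R1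
  have e12 : (j * K * m₃ * m₃ - j * T₂) * m₁ ^ 3 = -(j * T₁ * m₁ * m₃ ^ 2) := by
    linear_combination j * m₃ ^ 2 * R1 - j * R2
  have e34 : (j * K * m₁ * m₁ + j * T₁) * m₁ = j * T₁ * m₃ := by linear_combination j * R1
  have h2 : (2 : ZMod p) ≠ 0 := by
    intro h2
    have := (ZMod.natCast_eq_zero_iff 2 p).mp (by exact_mod_cast h2)
    exact hp2 ((Nat.prime_dvd_prime_iff_eq hp.out Nat.prime_two).mp this)
  -- `h₁ = h₂` from `E1 − E2`
  have hne12 : j * K * m₃ * m₃ - j * T₂ ≠ 0 := by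
    intro h0
    have : (j * K * m₃ * m₃ - j * T₂) * m₁ ^ 3 = 0 := by rw [h0, zero_mul]
    rw [e12, neg_eq_zero] at this
    exact (mul_ne_zero (mul_ne_zero (mul_ne_zero hj hT₁) hm₁) (pow_ne_zero 2 hm₃)) this
  have h12 : h.2.2.1 = h.2.1 := by
    have e : (j * K * m₃ * m₃ - j * T₂) * (h.2.2.1 - h.2.1) = 0 := by linear_combination E1 - E2
    rcases mul_eq_zero.mp e with h0 | h0
    · exact (hne12 h0).elim
    · exact sub_eq_zero.mp h0
  -- `h₃ = h₄` from `E3 − E4`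
  have hne34 : j * K * m₁ * m₁ + j * T₁ ≠ 0 := by
    intro h0
    have : (j * K * m₁ * m₁ + j * T₁) * m₁ = 0 := by rw [h0, zero_mul]
    rw [e34] at this
    exact (mul_ne_zero (mul_ne_zero hj hT₁) hm₃) this
  have h34 : h.2.2.2.2 = h.2.2.2.1 := by
    have e : (j * K * m₁ * m₁ + j * T₁) * (h.2.2.2.2 - h.2.2.2.1) = 0 := by linear_combination E3 - E4
    rcases mul_eq_zero.mp e with h0 | h0
    · exact (hne34 h0).elim
    · exact sub_eq_zero.mp h0
  -- `h₃ = h₁` from `E0` (note `H01 = −H03`)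
  have h31 : h.2.2.2.1 = h.2.1 := by
    -- `m₁² E0`: `2 (H01 m₁²) h₁ + 2 (H03 m₁²) h₃ = 0`, `H01 m₁² = −T₁m₁m₃²`, `H03 m₁² = T₁ m₁ m₃²`
    have e : T₁ * m₁ * m₃ ^ 2 * (2 * (h.2.2.2.1 - h.2.1)) = 0 := by
      rw [h12, h34] at E0
      linear_combination m₁ ^ 2 * E0 - (2 * h.2.1) * e01 - (2 * h.2.2.2.1 * m₁) * e03
    rcases mul_eq_zero.mp e with h0 | h0
    · exact ((mul_ne_zero (mul_ne_zero hT₁ hm₁) (pow_ne_zero 2 hm₃)) h0).elim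
    · rcases mul_eq_zero.mp h0 with h00 | h00
      · exact (h2 h00).elim
      · exact sub_eq_zero.mp h00
  refine ⟨h12, h31, h34.trans h31, ?_⟩
  rw [h12, h34, h31] at E1
  linear_combination E1


/-- **`#ker M ≤ p` at a critical point** (`p` odd): the kernel injects into `𝔽_p` via `h ↦ h₁`.
[cite: HeathBrown1986d3, Lemma 3 (p.40)] -/
theorem card_kernel_le (hp2 : p ≠ 2) {K T₁ T₂ j m₁ m₃ : ZMod p} (hj : j ≠ 0) (hT₁ : T₁ ≠ 0)
    (hm₁ : m₁ ≠ 0) (hm₃ : m₃ ≠ 0) (R1 : K * m₁ ^ 3 = T₁ * (m₃ - m₁)) (R2 : T₂ * m₁ ^ 3 = T₁ * m₃ ^ 3) :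
    ((Finset.univ : Finset (ZMod p × ZMod p × ZMod p × ZMod p × ZMod p)).filter
      (fun h => M0 K T₁ T₂ m₁ m₁ m₃ m₃ h = 0 ∧ M1 K T₂ j m₁ m₃ m₃ h = 0 ∧ M2 K T₂ j m₁ m₃ m₃ h = 0 ∧
        M3 K T₁ j m₁ m₁ m₃ h = 0 ∧ M4 K T₁ j m₁ m₁ m₃ h = 0)).card ≤ p := by
  classical
  have e01 : (K * m₁ * m₃ ^ 2 - m₁ * T₂) * m₁ ^ 2 = -(T₁ * m₁ * m₃ ^ 2) := by
    linear_combination m₃ ^ 2 * R1 - R2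
  have hne01 : K * m₁ * m₃ ^ 2 - m₁ * T₂ ≠ 0 := by
    intro h0
    have : (K * m₁ * m₃ ^ 2 - m₁ * T₂) * m₁ ^ 2 = 0 := by rw [h0, zero_mul]
    rw [e01, neg_eq_zero] at this
    exact (mul_ne_zero (mul_ne_zero hT₁ hm₁) (pow_ne_zero 2 hm₃)) this
  calc _ ≤ (Finset.univ : Finset (ZMod p)).card := by
        refine Finset.card_le_card_of_injOn (fun h => h.2.1) (fun h _ => Finset.mem_coe.mpr (Finset.mem_univ _)) ?_
        intro a ha b hb hab
        rw [Finset.mem_coe, Finset.mem_filter] at ha hb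
        obtain ⟨_, A0, A1, A2, A3, A4⟩ := ha
        obtain ⟨_, B0, B1, B2, B3, B4⟩ := hb
        have ka := kernel_determined hp2 hj hT₁ hm₁ hm₃ R1 R2 A0 A1 A2 A3 A4
        have kb := kernel_determined hp2 hj hT₁ hm₁ hm₃ R1 R2 B0 B1 B2 B3 B4
        simp only at hab
        have h0 : a.1 = b.1 := by
          have e : (a.1 - b.1) * (K * m₁ * m₃ ^ 2 - m₁ * T₂) = 0 := by
            linear_combination ka.2.2.2 - kb.2.2.2 + (-((j * K * m₃ * m₃ - j * T₂) + 2 * (j * K * m₁ * m₃))) * hab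
          rcases mul_eq_zero.mp e with h | h
          · exact sub_eq_zero.mp h
          · exact (hne01 h).elim
        refine Prod.ext h0 (Prod.ext hab (Prod.ext ?_ (Prod.ext ?_ ?_)))
        · rw [ka.1, kb.1, hab]
        · rw [ka.2.1, kb.2.1, hab]
        · rw [ka.2.2.1, kb.2.2.1, hab]
    _ = p := by rw [Finset.card_univ, ZMod.card]

/-- **Rank `5` generically** (HB p. 40: `r = 5` unless `p ∣ 3(τ − 1)`): if moreover `3(m₃ − m₁) ≠ 0`
in `𝔽_p`, the kernel is trivial. [cite: HeathBrown1986d3, Lemma 3 (p.40)] -/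
theorem kernel_trivial (hp2 : p ≠ 2) {K T₁ T₂ j m₁ m₃ : ZMod p} (hj : j ≠ 0) (hT₁ : T₁ ≠ 0)
    (hm₁ : m₁ ≠ 0) (hm₃ : m₃ ≠ 0) (R1 : K * m₁ ^ 3 = T₁ * (m₃ - m₁)) (R2 : T₂ * m₁ ^ 3 = T₁ * m₃ ^ 3)
    (h3 : (3 : ZMod p) * (m₃ - m₁) ≠ 0)
    {h : ZMod p × ZMod p × ZMod p × ZMod p × ZMod p}
    (E0 : M0 K T₁ T₂ m₁ m₁ m₃ m₃ h = 0) (E1 : M1 K T₂ j m₁ m₃ m₃ h = 0) (E2 : M2 K T₂ j m₁ m₃ m₃ h = 0)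
    (E3 : M3 K T₁ j m₁ m₁ m₃ h = 0) (E4 : M4 K T₁ j m₁ m₁ m₃ h = 0) : h = 0 := by
  obtain ⟨h21, h31, h41, h0⟩ := kernel_determined hp2 hj hT₁ hm₁ hm₃ R1 R2 E0 E1 E2 E3 E4
  simp only [M1, M3] at E1 E3
  have e01 : (K * m₁ * m₃ * m₃ - m₁ * T₂) * m₁ ^ 2 = -(T₁ * m₁ * m₃ ^ 2) := by
    linear_combination m₃ ^ 2 * R1 - R2
  have e03 : (K * m₁ * m₁ * m₃ + m₃ * T₁) * m₁ = T₁ * m₃ ^ 2 := by linear_combination m₃ * R1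
  have e12 : (j * K * m₃ * m₃ - j * T₂) * m₁ ^ 3 = -(j * T₁ * m₁ * m₃ ^ 2) := by
    linear_combination j * m₃ ^ 2 * R1 - j * R2
  have e34 : (j * K * m₁ * m₁ + j * T₁) * m₁ = j * T₁ * m₃ := by linear_combination j * R1
  -- `m₁³ (E1 + E3)` (after the substitutions): `(H01 + H03) m₁³ h₀ + (H12 + 4 H13 + H34) m₁³ h₁ = 0`,
  -- `H01 = −H03`, `(H12 + 4H13 + H34) m₁³ = 3 j T₁ m₁ m₃ (m₃ − m₁)`.
  simp only [h21, h31, h41] at E1 E3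
  have key : 3 * j * T₁ * m₁ * m₃ * (m₃ - m₁) * h.2.1 = 0 := by
    linear_combination m₁ ^ 3 * E1 + m₁ ^ 3 * E3 - (h.1 * m₁) * e01 - (h.1 * m₁ ^ 2) * e03 -
      h.2.1 * e12 - (4 * j * m₁ * m₃ * h.2.1) * R1 - (h.2.1 * m₁ ^ 2) * e34
  have hh1 : h.2.1 = 0 := by
    have hne : 3 * j * T₁ * m₁ * m₃ * (m₃ - m₁) ≠ 0 := by
      have : 3 * j * T₁ * m₁ * m₃ * (m₃ - m₁) = (j * T₁ * m₁ * m₃) * (3 * (m₃ - m₁)) := by ring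
      rw [this]
      exact mul_ne_zero (mul_ne_zero (mul_ne_zero (mul_ne_zero hj hT₁) hm₁) hm₃) h3
    rcases mul_eq_zero.mp key with h0' | h0'
    · exact (hne h0').elim
    · exact h0'
  have hne01 : K * m₁ * m₃ ^ 2 - m₁ * T₂ ≠ 0 := by
    intro h0'
    have : (K * m₁ * m₃ * m₃ - m₁ * T₂) * m₁ ^ 2 = 0 := by
      rw [show K * m₁ * m₃ * m₃ = K * m₁ * m₃ ^ 2 by ring, h0', zero_mul]
    rw [e01, neg_eq_zero] at this
    exact (mul_ne_zero (mul_ne_zero hT₁ hm₁) (pow_ne_zero 2 hm₃)) this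
  have hh0 : h.1 = 0 := by
    rw [hh1, mul_zero] at h0
    rcases mul_eq_zero.mp h0 with h0' | h0'
    · exact h0'
    · exact (hne01 h0').elim
  refine Prod.ext hh0 (Prod.ext hh1 (Prod.ext ?_ (Prod.ext ?_ ?_)))
  · rw [h21, hh1]; rfl
  · rw [h31, hh1]; rfl
  · rw [h41, hh1]; rfl

/-- **`#ker M = 1` in the generic case** `3(m₃ − m₁) ≠ 0`. [cite: HeathBrown1986d3, Lemma 3 (p.40)] -/
theorem card_kernel_le_one (hp2 : p ≠ 2) {K T₁ T₂ j m₁ m₃ : ZMod p} (hj : j ≠ 0) (hT₁ : T₁ ≠ 0)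
    (hm₁ : m₁ ≠ 0) (hm₃ : m₃ ≠ 0) (R1 : K * m₁ ^ 3 = T₁ * (m₃ - m₁)) (R2 : T₂ * m₁ ^ 3 = T₁ * m₃ ^ 3)
    (h3 : (3 : ZMod p) * (m₃ - m₁) ≠ 0) :
    ((Finset.univ : Finset (ZMod p × ZMod p × ZMod p × ZMod p × ZMod p)).filter
      (fun h => M0 K T₁ T₂ m₁ m₁ m₃ m₃ h = 0 ∧ M1 K T₂ j m₁ m₃ m₃ h = 0 ∧ M2 K T₂ j m₁ m₃ m₃ h = 0 ∧
        M3 K T₁ j m₁ m₁ m₃ h = 0 ∧ M4 K T₁ j m₁ m₁ m₃ h = 0)).card ≤ 1 := by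
  classical
  refine Finset.card_le_one.mpr fun a ha b hb => ?_
  rw [Finset.mem_filter] at ha hb
  rw [kernel_trivial hp2 hj hT₁ hm₁ hm₃ R1 R2 h3 ha.2.1 ha.2.2.1 ha.2.2.2.1 ha.2.2.2.2.1 ha.2.2.2.2.2,
    kernel_trivial hp2 hj hT₁ hm₁ hm₃ R1 R2 h3 hb.2.1 hb.2.2.1 hb.2.2.2.1 hb.2.2.2.2.1 hb.2.2.2.2.2]

end Kernel

/-! ### Lemma 3, odd exponent: the inner sum is a quadratic Weyl sum modulo `p` -/

section OddInner

variable {p : ℕ} [hp : Fact p.Prime]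

/-- `e(p^{2g} z / p^{2g+1}) = e((z mod p)/p)`, landing in `ZMod p`. [folklore] -/
theorem stdAddChar_pow_sq_mul_prime (g : ℕ) (h : p ∣ p ^ (2 * g + 1)) (z : ZMod (p ^ (2 * g + 1))) :
    (ZMod.stdAddChar ((((p ^ g : ℕ) : ZMod (p ^ (2 * g + 1))) ^ 2 * z)) : ℂ) =
      ZMod.stdAddChar (ZMod.castHom h (ZMod p) z) := by
  have hz : z = ((z.val : ℕ) : ZMod (p ^ (2 * g + 1))) := (ZMod.natCast_zmod_val z).symm
  rw [hz, map_natCast, show ((p ^ g : ℕ) : ZMod (p ^ (2 * g + 1))) ^ 2 *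
      ((z.val : ℕ) : ZMod (p ^ (2 * g + 1))) = ((p ^ (2 * g) * z.val : ℕ) : ZMod (p ^ (2 * g + 1)))
      by push_cast; ring,
    Literature.NumberTheory.LFunctions.stdAddChar_natCast, Literature.NumberTheory.LFunctions.stdAddChar_natCast]
  congr 1
  have hp0 : (p : ℂ) ≠ 0 := Nat.cast_ne_zero.mpr hp.out.ne_zero
  push_cast
  field_simp
  ring

omit [NeZero q] hp in
/-- Reading `Q311` through a ring homomorphism. [folklore] -/
theorem map_Q311 {q' : ℕ} (φ : ZMod q →+* ZMod q') (kk t₁ t₂ j m₁ m₂ m₃ m₄ s₀ s₁ s₂ s₃ s₄ : ZMod q) :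
    φ (Q311 kk t₁ t₂ j m₁ m₂ m₃ m₄ s₀ s₁ s₂ s₃ s₄) =
      Q311 (φ kk) (φ t₁) (φ t₂) (φ j) (φ m₁) (φ m₂) (φ m₃) (φ m₄) (φ s₀) (φ s₁) (φ s₂) (φ s₃) (φ s₄) := by
  simp only [Q311, map_add, map_sub, map_mul]

set_option maxHeartbeats 3200000 in
/-- **The inner sum at a critical point is a quadratic Weyl sum modulo `p`** (`g ≥ 1`, `p ∤ t₁`): by the
exact Taylor expansion, `P³ = 0` and `∇F(W) = P c`,
`∑_{s (mod p)^5} e(F(W + Ps)/p^{2g+1}) = e(F(W)/p^{2g+1}) ∑_{v ∈ 𝔽_p^5} e((c·v + Q_W(v))/p)`, whence by Weyl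
differencing `|…|² ≤ p⁵ #ker M`, together with the reduced critical relations needed to count the kernel.
[cite: HeathBrown1986d3, Lemma 3 (f odd)] -/
theorem norm_sq_inner5_le_card {g : ℕ} (hg : 1 ≤ g) (kk t₁ t₂ : ZMod (p ^ (2 * g + 1)))
    (ht₁ : IsUnit t₁) (W₀ W₁ W₂ W₃ W₄ : ZMod (p ^ (2 * g + 1)))
    (h1 : IsUnit W₁) (h3 : IsUnit W₃) (h4 : IsUnit W₄)
    (E4 : ZMod.castHom (pow_dvd_pow p (by omega : g ≤ 2 * g + 1)) (ZMod (p ^ g)) (D4 kk t₁ W₀ W₁ W₂ W₃) = 0)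
    (E3 : ZMod.castHom (pow_dvd_pow p (by omega : g ≤ 2 * g + 1)) (ZMod (p ^ g)) (D3 kk t₁ W₀ W₁ W₂ W₄) = 0)
    (E2 : ZMod.castHom (pow_dvd_pow p (by omega : g ≤ 2 * g + 1)) (ZMod (p ^ g)) (D2 kk t₂ W₀ W₁ W₃ W₄) = 0)
    (E1 : ZMod.castHom (pow_dvd_pow p (by omega : g ≤ 2 * g + 1)) (ZMod (p ^ g)) (D1 kk t₂ W₀ W₂ W₃ W₄) = 0)
    (E0 : ZMod.castHom (pow_dvd_pow p (by omega : g ≤ 2 * g + 1)) (ZMod (p ^ g)) (D0 kk t₁ t₂ W₁ W₂ W₃ W₄) = 0) :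
    ‖∑ s₄ ∈ range p, ∑ s₃ ∈ range p, ∑ s₂ ∈ range p, ∑ s₁ ∈ range p, ∑ s₀ ∈ range p,
        (ZMod.stdAddChar (F311 kk t₁ t₂
          (W₀ + ((p ^ g : ℕ) : ZMod (p ^ (2 * g + 1))) * ((s₀ : ℕ) : ZMod (p ^ (2 * g + 1))))
          (W₁ + ((p ^ g : ℕ) : ZMod (p ^ (2 * g + 1))) * ((s₁ : ℕ) : ZMod (p ^ (2 * g + 1))))
          (W₂ + ((p ^ g : ℕ) : ZMod (p ^ (2 * g + 1))) * ((s₂ : ℕ) : ZMod (p ^ (2 * g + 1))))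
          (W₃ + ((p ^ g : ℕ) : ZMod (p ^ (2 * g + 1))) * ((s₃ : ℕ) : ZMod (p ^ (2 * g + 1))))
          (W₄ + ((p ^ g : ℕ) : ZMod (p ^ (2 * g + 1))) * ((s₄ : ℕ) : ZMod (p ^ (2 * g + 1))))) : ℂ)‖ ^ 2 ≤
      (p : ℝ) ^ 5 * ((Finset.univ : Finset (ZMod p × ZMod p × ZMod p × ZMod p × ZMod p)).filter
      (fun h => M0 (ZMod.castHom (dvd_pow_self p (by omega : 2 * g + 1 ≠ 0)) (ZMod p) kk)
          (ZMod.castHom (dvd_pow_self p (by omega : 2 * g + 1 ≠ 0)) (ZMod p) t₁)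
          (ZMod.castHom (dvd_pow_self p (by omega : 2 * g + 1 ≠ 0)) (ZMod p) t₂)
          (ZMod.castHom (dvd_pow_self p (by omega : 2 * g + 1 ≠ 0)) (ZMod p) W₁)
          (ZMod.castHom (dvd_pow_self p (by omega : 2 * g + 1 ≠ 0)) (ZMod p) W₁)
          (ZMod.castHom (dvd_pow_self p (by omega : 2 * g + 1 ≠ 0)) (ZMod p) W₃)
          (ZMod.castHom (dvd_pow_self p (by omega : 2 * g + 1 ≠ 0)) (ZMod p) W₃) h = 0 ∧
        M1 (ZMod.castHom (dvd_pow_self p (by omega : 2 * g + 1 ≠ 0)) (ZMod p) kk)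
          (ZMod.castHom (dvd_pow_self p (by omega : 2 * g + 1 ≠ 0)) (ZMod p) t₂)
          (ZMod.castHom (dvd_pow_self p (by omega : 2 * g + 1 ≠ 0)) (ZMod p) W₀)
          (ZMod.castHom (dvd_pow_self p (by omega : 2 * g + 1 ≠ 0)) (ZMod p) W₁)
          (ZMod.castHom (dvd_pow_self p (by omega : 2 * g + 1 ≠ 0)) (ZMod p) W₃)
          (ZMod.castHom (dvd_pow_self p (by omega : 2 * g + 1 ≠ 0)) (ZMod p) W₃) h = 0 ∧
        M2 (ZMod.castHom (dvd_pow_self p (by omega : 2 * g + 1 ≠ 0)) (ZMod p) kk)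
          (ZMod.castHom (dvd_pow_self p (by omega : 2 * g + 1 ≠ 0)) (ZMod p) t₂)
          (ZMod.castHom (dvd_pow_self p (by omega : 2 * g + 1 ≠ 0)) (ZMod p) W₀)
          (ZMod.castHom (dvd_pow_self p (by omega : 2 * g + 1 ≠ 0)) (ZMod p) W₁)
          (ZMod.castHom (dvd_pow_self p (by omega : 2 * g + 1 ≠ 0)) (ZMod p) W₃)
          (ZMod.castHom (dvd_pow_self p (by omega : 2 * g + 1 ≠ 0)) (ZMod p) W₃) h = 0 ∧
        M3 (ZMod.castHom (dvd_pow_self p (by omega : 2 * g + 1 ≠ 0)) (ZMod p) kk)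
          (ZMod.castHom (dvd_pow_self p (by omega : 2 * g + 1 ≠ 0)) (ZMod p) t₁)
          (ZMod.castHom (dvd_pow_self p (by omega : 2 * g + 1 ≠ 0)) (ZMod p) W₀)
          (ZMod.castHom (dvd_pow_self p (by omega : 2 * g + 1 ≠ 0)) (ZMod p) W₁)
          (ZMod.castHom (dvd_pow_self p (by omega : 2 * g + 1 ≠ 0)) (ZMod p) W₁)
          (ZMod.castHom (dvd_pow_self p (by omega : 2 * g + 1 ≠ 0)) (ZMod p) W₃) h = 0 ∧
        M4 (ZMod.castHom (dvd_pow_self p (by omega : 2 * g + 1 ≠ 0)) (ZMod p) kk)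
          (ZMod.castHom (dvd_pow_self p (by omega : 2 * g + 1 ≠ 0)) (ZMod p) t₁)
          (ZMod.castHom (dvd_pow_self p (by omega : 2 * g + 1 ≠ 0)) (ZMod p) W₀)
          (ZMod.castHom (dvd_pow_self p (by omega : 2 * g + 1 ≠ 0)) (ZMod p) W₁)
          (ZMod.castHom (dvd_pow_self p (by omega : 2 * g + 1 ≠ 0)) (ZMod p) W₁)
          (ZMod.castHom (dvd_pow_self p (by omega : 2 * g + 1 ≠ 0)) (ZMod p) W₃) h = 0)).card ∧
    (ZMod.castHom (dvd_pow_self p (by omega : 2 * g + 1 ≠ 0)) (ZMod p) kk *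
        ZMod.castHom (dvd_pow_self p (by omega : 2 * g + 1 ≠ 0)) (ZMod p) W₁ ^ 3 =
      ZMod.castHom (dvd_pow_self p (by omega : 2 * g + 1 ≠ 0)) (ZMod p) t₁ *
        (ZMod.castHom (dvd_pow_self p (by omega : 2 * g + 1 ≠ 0)) (ZMod p) W₃ -
          ZMod.castHom (dvd_pow_self p (by omega : 2 * g + 1 ≠ 0)) (ZMod p) W₁)) ∧
    (ZMod.castHom (dvd_pow_self p (by omega : 2 * g + 1 ≠ 0)) (ZMod p) t₂ *
        ZMod.castHom (dvd_pow_self p (by omega : 2 * g + 1 ≠ 0)) (ZMod p) W₁ ^ 3 =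
      ZMod.castHom (dvd_pow_self p (by omega : 2 * g + 1 ≠ 0)) (ZMod p) t₁ *
        ZMod.castHom (dvd_pow_self p (by omega : 2 * g + 1 ≠ 0)) (ZMod p) W₃ ^ 3) ∧
    ZMod.castHom (dvd_pow_self p (by omega : 2 * g + 1 ≠ 0)) (ZMod p) W₀ ≠ 0 := by
  classical
  have hdvdg : p ^ g ∣ p ^ (2 * g + 1) := pow_dvd_pow p (by omega : g ≤ 2 * g + 1)
  have hdvd1 : p ∣ p ^ (2 * g + 1) := dvd_pow_self p (by omega)
  have hdvdpg : p ∣ p ^ g := dvd_pow_self p (by omega)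
  set π := ZMod.castHom hdvdg (ZMod (p ^ g)) with hπ
  set ρ := ZMod.castHom hdvd1 (ZMod p) with hρ
  set σ := ZMod.castHom hdvdpg (ZMod p) with hσ
  set P : ZMod (p ^ (2 * g + 1)) := ((p ^ g : ℕ) : ZMod (p ^ (2 * g + 1))) with hPdef
  have hσπ : ∀ x : ZMod (p ^ (2 * g + 1)), σ (π x) = ρ x := fun x =>
    RingHom.congr_fun (Subsingleton.elim (σ.comp π) ρ) x
  have E4' : π (D4 kk t₁ W₀ W₁ W₂ W₃) = 0 := E4
  have E3' : π (D3 kk t₁ W₀ W₁ W₂ W₄) = 0 := E3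
  have E2' : π (D2 kk t₂ W₀ W₁ W₃ W₄) = 0 := E2
  have E1' : π (D1 kk t₂ W₀ W₂ W₃ W₄) = 0 := E1
  have E0' : π (D0 kk t₁ t₂ W₁ W₂ W₃ W₄) = 0 := E0
  obtain ⟨c₄, hc₄⟩ := exists_eq_pow_mul_of_castHom_eq_zero hdvdg E4'
  obtain ⟨c₃, hc₃⟩ := exists_eq_pow_mul_of_castHom_eq_zero hdvdg E3'
  obtain ⟨c₂, hc₂⟩ := exists_eq_pow_mul_of_castHom_eq_zero hdvdg E2'
  obtain ⟨c₁, hc₁⟩ := exists_eq_pow_mul_of_castHom_eq_zero hdvdg E1'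
  obtain ⟨c₀, hc₀⟩ := exists_eq_pow_mul_of_castHom_eq_zero hdvdg E0'
  have hP3 : P ^ 3 = 0 := by
    rw [hPdef, ← Nat.cast_pow, ZMod.natCast_eq_zero_iff, ← pow_mul]
    exact pow_dvd_pow p (by omega)
  -- the phase
  have hphase : ∀ s₀ s₁ s₂ s₃ s₄ : ℕ,
      (ZMod.stdAddChar (F311 kk t₁ t₂ (W₀ + P * ((s₀ : ℕ) : ZMod (p ^ (2 * g + 1))))
        (W₁ + P * ((s₁ : ℕ) : ZMod (p ^ (2 * g + 1)))) (W₂ + P * ((s₂ : ℕ) : ZMod (p ^ (2 * g + 1))))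
        (W₃ + P * ((s₃ : ℕ) : ZMod (p ^ (2 * g + 1)))) (W₄ + P * ((s₄ : ℕ) : ZMod (p ^ (2 * g + 1))))) : ℂ) =
      ZMod.stdAddChar (F311 kk t₁ t₂ W₀ W₁ W₂ W₃ W₄) *
        ZMod.stdAddChar (PhiQ (ρ kk) (ρ t₁) (ρ t₂) (ρ W₀) (ρ W₁) (ρ W₂) (ρ W₃) (ρ W₄)
          (ρ c₀) (ρ c₁) (ρ c₂) (ρ c₃) (ρ c₄)
          (((s₀ : ℕ) : ZMod p), (((s₁ : ℕ) : ZMod p), (((s₂ : ℕ) : ZMod p), (((s₃ : ℕ) : ZMod p), ((s₄ : ℕ) : ZMod p)))))) := by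
    intro s₀ s₁ s₂ s₃ s₄
    set z : ZMod (p ^ (2 * g + 1)) := ((s₀ : ℕ) : ZMod (p ^ (2 * g + 1))) * c₀ +
      ((s₁ : ℕ) : ZMod (p ^ (2 * g + 1))) * c₁ + ((s₂ : ℕ) : ZMod (p ^ (2 * g + 1))) * c₂ +
      ((s₃ : ℕ) : ZMod (p ^ (2 * g + 1))) * c₃ + ((s₄ : ℕ) : ZMod (p ^ (2 * g + 1))) * c₄ +
      Q311 kk t₁ t₂ W₀ W₁ W₂ W₃ W₄ ((s₀ : ℕ) : ZMod _) ((s₁ : ℕ) : ZMod _) ((s₂ : ℕ) : ZMod _)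
        ((s₃ : ℕ) : ZMod _) ((s₄ : ℕ) : ZMod _) with hz
    have e : F311 kk t₁ t₂ (W₀ + P * ((s₀ : ℕ) : ZMod (p ^ (2 * g + 1))))
        (W₁ + P * ((s₁ : ℕ) : ZMod (p ^ (2 * g + 1)))) (W₂ + P * ((s₂ : ℕ) : ZMod (p ^ (2 * g + 1))))
        (W₃ + P * ((s₃ : ℕ) : ZMod (p ^ (2 * g + 1)))) (W₄ + P * ((s₄ : ℕ) : ZMod (p ^ (2 * g + 1)))) =
        F311 kk t₁ t₂ W₀ W₁ W₂ W₃ W₄ + P ^ 2 * z := by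
      rw [F311_taylor2, hz, hc₀, hc₁, hc₂, hc₃, hc₄]
      linear_combination (R311 kk t₁ t₂ P W₀ W₁ W₂ W₃ W₄ ((s₀ : ℕ) : ZMod _) ((s₁ : ℕ) : ZMod _)
        ((s₂ : ℕ) : ZMod _) ((s₃ : ℕ) : ZMod _) ((s₄ : ℕ) : ZMod _)) * hP3
    rw [e, AddChar.map_add_eq_mul, hPdef, stdAddChar_pow_sq_mul_prime g hdvd1 z]
    congr 2
    rw [hz]
    simp only [PhiQ, map_add, map_mul, map_natCast, map_Q311]
    ring
  simp_rw [hphase, ← Finset.mul_sum]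
  rw [norm_mul, norm_stdAddChar, one_mul]
  -- reduced critical relations
  have hT₁g : IsUnit (π t₁) := ht₁.map π
  have cs := critical_structure (q := p ^ g) (K := π kk) (T₂ := π t₂) (j := π W₀) hT₁g (h1.map π) (h4.map π)
    (by rw [D4_def, ← map_D4]; exact E4') (by rw [D3_def, ← map_D3]; exact E3')
    (by rw [D2_def, ← map_D2]; exact E2') (by rw [D1_def, ← map_D1]; exact E1')
    (by rw [D0_def, ← map_D0]; exact E0')
  obtain ⟨c21, c43, cτ, cK, cj⟩ := cs
  have i1 := ZMod.mul_inv_of_unit _ (h1.map π)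
  have iT := ZMod.mul_inv_of_unit _ hT₁g
  have R1g : π kk * π W₁ ^ 3 = π t₁ * (π W₃ - π W₁) := by
    linear_combination π W₁ * cK + (π t₁ * π W₃) * i1
  have R2g : π t₂ * π W₁ ^ 3 = π t₁ * π W₃ ^ 3 := by
    linear_combination (-(π t₁ * π W₁ ^ 3)) * cτ + (-(π t₂ * π W₁ ^ 3)) * iT +
      (π t₁ * π W₃ ^ 3 * ((π W₁ * (π W₁)⁻¹) ^ 2 + π W₁ * (π W₁)⁻¹ + 1)) * i1
  have R1 : ρ kk * ρ W₁ ^ 3 = ρ t₁ * (ρ W₃ - ρ W₁) := by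
    have := congrArg σ R1g
    simpa only [map_mul, map_pow, map_sub, hσπ] using this
  have R2 : ρ t₂ * ρ W₁ ^ 3 = ρ t₁ * ρ W₃ ^ 3 := by
    have := congrArg σ R2g
    simpa only [map_mul, map_pow, hσπ] using this
  have hW2 : ρ W₂ = ρ W₁ := by rw [← hσπ, ← hσπ, c21]
  have hW4 : ρ W₄ = ρ W₃ := by rw [← hσπ, ← hσπ, c43]
  have hj0 : ρ W₀ ≠ 0 := by
    have hu : IsUnit (π W₀) := IsUnit.of_mul_eq_one _ cj
    have := hu.map σ
    rw [hσπ] at this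
    exact this.ne_zero
  have hT0 : ρ t₁ ≠ 0 := (ht₁.map ρ).ne_zero
  have hm1 : ρ W₁ ≠ 0 := (h1.map ρ).ne_zero
  have hm3 : ρ W₃ ≠ 0 := (h3.map ρ).ne_zero
  rw [hW2, hW4]
  -- range sums → the Weyl sum over `𝔽_p^5`
  have hsum : (∑ s₄ ∈ range p, ∑ s₃ ∈ range p, ∑ s₂ ∈ range p, ∑ s₁ ∈ range p, ∑ s₀ ∈ range p,
      (ZMod.stdAddChar (PhiQ (ρ kk) (ρ t₁) (ρ t₂) (ρ W₀) (ρ W₁) (ρ W₁) (ρ W₃) (ρ W₃)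
        (ρ c₀) (ρ c₁) (ρ c₂) (ρ c₃) (ρ c₄)
        (((s₀ : ℕ) : ZMod p), (((s₁ : ℕ) : ZMod p), (((s₂ : ℕ) : ZMod p), (((s₃ : ℕ) : ZMod p), ((s₄ : ℕ) : ZMod p)))))) : ℂ)) =
      ∑ v : ZMod p × ZMod p × ZMod p × ZMod p × ZMod p,
        (ZMod.stdAddChar (PhiQ (ρ kk) (ρ t₁) (ρ t₂) (ρ W₀) (ρ W₁) (ρ W₁) (ρ W₃) (ρ W₃)
          (ρ c₀) (ρ c₁) (ρ c₂) (ρ c₃) (ρ c₄) v) : ℂ) := by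
    symm
    rw [Fintype.sum_prod_type_right, Fintype.sum_prod_type_right, Fintype.sum_prod_type_right,
      Fintype.sum_prod_type_right, sum_zmod_eq_sum_range]
    refine Finset.sum_congr rfl fun s₄ _ => ?_
    rw [sum_zmod_eq_sum_range]
    refine Finset.sum_congr rfl fun s₃ _ => ?_
    rw [sum_zmod_eq_sum_range]
    refine Finset.sum_congr rfl fun s₂ _ => ?_
    rw [sum_zmod_eq_sum_range]
    refine Finset.sum_congr rfl fun s₁ _ => ?_
    rw [sum_zmod_eq_sum_range]
  rw [hsum]
  have hW := norm_sq_sum_PhiQ_le (q := p) (ρ kk) (ρ t₁) (ρ t₂) (ρ W₀) (ρ W₁) (ρ W₁) (ρ W₃) (ρ W₃)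
    (ρ c₀) (ρ c₁) (ρ c₂) (ρ c₃) (ρ c₄)
  exact ⟨hW, R1, R2, hj0⟩

/-- **The inner sum at a critical point has modulus `≤ p³`** (`p` odd; rank `≥ 4`: `#ker M ≤ p`).
[cite: HeathBrown1986d3, Lemma 3 (f odd)] -/
theorem norm_inner5_le (hp2 : p ≠ 2) {g : ℕ} (hg : 1 ≤ g) (kk t₁ t₂ : ZMod (p ^ (2 * g + 1)))
    (ht₁ : IsUnit t₁) (W₀ W₁ W₂ W₃ W₄ : ZMod (p ^ (2 * g + 1)))
    (h1 : IsUnit W₁) (h3 : IsUnit W₃) (h4 : IsUnit W₄)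
    (E4 : ZMod.castHom (pow_dvd_pow p (by omega : g ≤ 2 * g + 1)) (ZMod (p ^ g)) (D4 kk t₁ W₀ W₁ W₂ W₃) = 0)
    (E3 : ZMod.castHom (pow_dvd_pow p (by omega : g ≤ 2 * g + 1)) (ZMod (p ^ g)) (D3 kk t₁ W₀ W₁ W₂ W₄) = 0)
    (E2 : ZMod.castHom (pow_dvd_pow p (by omega : g ≤ 2 * g + 1)) (ZMod (p ^ g)) (D2 kk t₂ W₀ W₁ W₃ W₄) = 0)
    (E1 : ZMod.castHom (pow_dvd_pow p (by omega : g ≤ 2 * g + 1)) (ZMod (p ^ g)) (D1 kk t₂ W₀ W₂ W₃ W₄) = 0)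
    (E0 : ZMod.castHom (pow_dvd_pow p (by omega : g ≤ 2 * g + 1)) (ZMod (p ^ g)) (D0 kk t₁ t₂ W₁ W₂ W₃ W₄) = 0) :
    ‖∑ s₄ ∈ range p, ∑ s₃ ∈ range p, ∑ s₂ ∈ range p, ∑ s₁ ∈ range p, ∑ s₀ ∈ range p,
        (ZMod.stdAddChar (F311 kk t₁ t₂
          (W₀ + ((p ^ g : ℕ) : ZMod (p ^ (2 * g + 1))) * ((s₀ : ℕ) : ZMod (p ^ (2 * g + 1))))
          (W₁ + ((p ^ g : ℕ) : ZMod (p ^ (2 * g + 1))) * ((s₁ : ℕ) : ZMod (p ^ (2 * g + 1))))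
          (W₂ + ((p ^ g : ℕ) : ZMod (p ^ (2 * g + 1))) * ((s₂ : ℕ) : ZMod (p ^ (2 * g + 1))))
          (W₃ + ((p ^ g : ℕ) : ZMod (p ^ (2 * g + 1))) * ((s₃ : ℕ) : ZMod (p ^ (2 * g + 1))))
          (W₄ + ((p ^ g : ℕ) : ZMod (p ^ (2 * g + 1))) * ((s₄ : ℕ) : ZMod (p ^ (2 * g + 1))))) : ℂ)‖ ≤
      (p : ℝ) ^ 3 := by
  obtain ⟨hW, R1, R2, hj0⟩ := norm_sq_inner5_le_card hg kk t₁ t₂ ht₁ W₀ W₁ W₂ W₃ W₄ h1 h3 h4 E4 E3 E2 E1 E0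
  set ρ := ZMod.castHom (dvd_pow_self p (by omega : 2 * g + 1 ≠ 0)) (ZMod p) with hρ
  have hk := card_kernel_le hp2 (K := ρ kk) (T₂ := ρ t₂) hj0 (ht₁.map ρ).ne_zero (h1.map ρ).ne_zero
    (h3.map ρ).ne_zero R1 R2
  have hk' := (Nat.cast_le (α := ℝ)).mpr hk
  have hp0 : (0 : ℝ) ≤ p := Nat.cast_nonneg p
  have hsq := hW.trans ((mul_le_mul_of_nonneg_left hk' (by positivity)).trans
    (le_of_eq (show (p : ℝ) ^ 5 * (p : ℕ) = ((p : ℝ) ^ 3) ^ 2 by ring)))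
  exact (pow_le_pow_iff_left₀ (norm_nonneg _) (by positivity) two_ne_zero).mp hsq

/-- **The inner sum at a critical point has modulus `≤ p^{5/2}` when `p ∤ 3k`** (`p` odd; rank `5`:
`#ker M = 1`, since `k m₁³ = t₁(m₃ − m₁)` forces `m₃ ≢ m₁` when `p ∤ k`).
[cite: HeathBrown1986d3, Lemma 3 (f odd)] -/
theorem norm_sq_inner5_le (hp2 : p ≠ 2) {g : ℕ} (hg : 1 ≤ g) (kk t₁ t₂ : ZMod (p ^ (2 * g + 1)))
    (ht₁ : IsUnit t₁) (h3k : ZMod.castHom (dvd_pow_self p (by omega : 2 * g + 1 ≠ 0)) (ZMod p) (3 * kk) ≠ 0)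
    (W₀ W₁ W₂ W₃ W₄ : ZMod (p ^ (2 * g + 1)))
    (h1 : IsUnit W₁) (h3 : IsUnit W₃) (h4 : IsUnit W₄)
    (E4 : ZMod.castHom (pow_dvd_pow p (by omega : g ≤ 2 * g + 1)) (ZMod (p ^ g)) (D4 kk t₁ W₀ W₁ W₂ W₃) = 0)
    (E3 : ZMod.castHom (pow_dvd_pow p (by omega : g ≤ 2 * g + 1)) (ZMod (p ^ g)) (D3 kk t₁ W₀ W₁ W₂ W₄) = 0)
    (E2 : ZMod.castHom (pow_dvd_pow p (by omega : g ≤ 2 * g + 1)) (ZMod (p ^ g)) (D2 kk t₂ W₀ W₁ W₃ W₄) = 0)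
    (E1 : ZMod.castHom (pow_dvd_pow p (by omega : g ≤ 2 * g + 1)) (ZMod (p ^ g)) (D1 kk t₂ W₀ W₂ W₃ W₄) = 0)
    (E0 : ZMod.castHom (pow_dvd_pow p (by omega : g ≤ 2 * g + 1)) (ZMod (p ^ g)) (D0 kk t₁ t₂ W₁ W₂ W₃ W₄) = 0) :
    ‖∑ s₄ ∈ range p, ∑ s₃ ∈ range p, ∑ s₂ ∈ range p, ∑ s₁ ∈ range p, ∑ s₀ ∈ range p,
        (ZMod.stdAddChar (F311 kk t₁ t₂
          (W₀ + ((p ^ g : ℕ) : ZMod (p ^ (2 * g + 1))) * ((s₀ : ℕ) : ZMod (p ^ (2 * g + 1))))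
          (W₁ + ((p ^ g : ℕ) : ZMod (p ^ (2 * g + 1))) * ((s₁ : ℕ) : ZMod (p ^ (2 * g + 1))))
          (W₂ + ((p ^ g : ℕ) : ZMod (p ^ (2 * g + 1))) * ((s₂ : ℕ) : ZMod (p ^ (2 * g + 1))))
          (W₃ + ((p ^ g : ℕ) : ZMod (p ^ (2 * g + 1))) * ((s₃ : ℕ) : ZMod (p ^ (2 * g + 1))))
          (W₄ + ((p ^ g : ℕ) : ZMod (p ^ (2 * g + 1))) * ((s₄ : ℕ) : ZMod (p ^ (2 * g + 1))))) : ℂ)‖ ^ 2 ≤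
      (p : ℝ) ^ 5 := by
  obtain ⟨hW, R1, R2, hj0⟩ := norm_sq_inner5_le_card hg kk t₁ t₂ ht₁ W₀ W₁ W₂ W₃ W₄ h1 h3 h4 E4 E3 E2 E1 E0
  set ρ := ZMod.castHom (dvd_pow_self p (by omega : 2 * g + 1 ≠ 0)) (ZMod p) with hρ
  have hm1 : ρ W₁ ≠ 0 := (h1.map ρ).ne_zero
  -- `3 (m₃ − m₁) ≠ 0`
  have h3' : (3 : ZMod p) * (ρ W₃ - ρ W₁) ≠ 0 := by
    rw [map_mul] at h3k
    have h3ne : ρ 3 ≠ 0 := fun h => h3k (by rw [h, zero_mul])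
    have hkne : ρ kk ≠ 0 := fun h => h3k (by rw [h, mul_zero])
    have hdiff : ρ W₃ - ρ W₁ ≠ 0 := by
      intro h0
      rw [h0, mul_zero] at R1
      exact (mul_ne_zero hkne (pow_ne_zero 3 hm1)) R1
    rw [map_ofNat] at h3ne
    exact mul_ne_zero h3ne hdiff
  have hk := card_kernel_le_one hp2 (K := ρ kk) (T₂ := ρ t₂) hj0 (ht₁.map ρ).ne_zero hm1
    (h3.map ρ).ne_zero R1 R2 h3'
  have hk' := (Nat.cast_le (α := ℝ)).mpr hk
  have hp0 : (0 : ℝ) ≤ p := Nat.cast_nonneg p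
  refine hW.trans ?_
  calc (p : ℝ) ^ 5 * _ ≤ (p : ℝ) ^ 5 * ((1 : ℕ) : ℝ) := mul_le_mul_of_nonneg_left hk' (by positivity)
    _ = (p : ℝ) ^ 5 := by simp

set_option maxHeartbeats 1600000 in
/-- **Lemma 3, odd exponent — assembly**: if every inner sum at a critical point has modulus `≤ B`, then
`|S(k, t₁, t₂, 1, 1; p^{2g+1})| ≤ 12 (k, p^g) p^{5g} B`. [cite: HeathBrown1986d3, Lemma 3 (f odd)] -/
theorem norm_SS_odd_le_of_inner {g : ℕ} (hg : 1 ≤ g) (kk t₁ t₂ : ZMod (p ^ (2 * g + 1)))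
    (ht₁ : IsUnit t₁) {B : ℝ} (hB0 : 0 ≤ B)
    (hB : ∀ w₄ w₃ w₂ w₁ w₀ : ℕ, (IsUnit ((w₁ : ℕ) : ZMod (p ^ (2 * g + 1))) ∧ IsUnit ((w₂ : ℕ) : ZMod (p ^ (2 * g + 1))) ∧
              IsUnit ((w₃ : ℕ) : ZMod (p ^ (2 * g + 1))) ∧ IsUnit ((w₄ : ℕ) : ZMod (p ^ (2 * g + 1)))) ∧
            ZMod.castHom (pow_dvd_pow p (by omega : g ≤ 2 * g + 1)) (ZMod (p ^ g))
              (D4 kk t₁ (w₀ : ZMod (p ^ (2 * g + 1))) w₁ w₂ w₃) = 0 ∧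
            ZMod.castHom (pow_dvd_pow p (by omega : g ≤ 2 * g + 1)) (ZMod (p ^ g))
              (D3 kk t₁ (w₀ : ZMod (p ^ (2 * g + 1))) w₁ w₂ w₄) = 0 ∧
            ZMod.castHom (pow_dvd_pow p (by omega : g ≤ 2 * g + 1)) (ZMod (p ^ g))
              (D2 kk t₂ (w₀ : ZMod (p ^ (2 * g + 1))) w₁ w₃ w₄) = 0 ∧
            ZMod.castHom (pow_dvd_pow p (by omega : g ≤ 2 * g + 1)) (ZMod (p ^ g))
              (D1 kk t₂ (w₀ : ZMod (p ^ (2 * g + 1))) w₂ w₃ w₄) = 0 ∧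
            ZMod.castHom (pow_dvd_pow p (by omega : g ≤ 2 * g + 1)) (ZMod (p ^ g))
              (D0 kk t₁ t₂ (w₁ : ZMod (p ^ (2 * g + 1))) w₂ w₃ w₄) = 0 →
      ‖∑ s₄ ∈ range p, ∑ s₃ ∈ range p, ∑ s₂ ∈ range p, ∑ s₁ ∈ range p, ∑ s₀ ∈ range p,
            (ZMod.stdAddChar (F311 kk t₁ t₂ ((w₀ + p ^ g * s₀ : ℕ) : ZMod (p ^ (2 * g + 1)))
              ((w₁ + p ^ g * s₁ : ℕ) : ZMod (p ^ (2 * g + 1))) ((w₂ + p ^ g * s₂ : ℕ) : ZMod (p ^ (2 * g + 1)))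
              ((w₃ + p ^ g * s₃ : ℕ) : ZMod (p ^ (2 * g + 1))) ((w₄ + p ^ g * s₄ : ℕ) : ZMod (p ^ (2 * g + 1)))) : ℂ)‖ ≤ B) :
    ‖SS (p ^ (2 * g + 1)) kk t₁ t₂ 1 1‖ ≤ 12 * ((p : ℝ) ^ g) ^ 5 * B *
      Nat.gcd (ZMod.castHom (pow_dvd_pow p (by omega : g ≤ 2 * g + 1)) (ZMod (p ^ g)) kk).val (p ^ g) := by
  classical
  refine (norm_SS_odd_stage1 hg kk t₁ t₂).trans ?_
  have hp0 : (0 : ℝ) ≤ p := Nat.cast_nonneg p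
  have hstep : ∀ w₄ w₃ w₂ w₁ w₀ : ℕ,
      (if (IsUnit ((w₁ : ℕ) : ZMod (p ^ (2 * g + 1))) ∧ IsUnit ((w₂ : ℕ) : ZMod (p ^ (2 * g + 1))) ∧
              IsUnit ((w₃ : ℕ) : ZMod (p ^ (2 * g + 1))) ∧ IsUnit ((w₄ : ℕ) : ZMod (p ^ (2 * g + 1)))) ∧
            ZMod.castHom (pow_dvd_pow p (by omega : g ≤ 2 * g + 1)) (ZMod (p ^ g))
              (D4 kk t₁ (w₀ : ZMod (p ^ (2 * g + 1))) w₁ w₂ w₃) = 0 ∧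
            ZMod.castHom (pow_dvd_pow p (by omega : g ≤ 2 * g + 1)) (ZMod (p ^ g))
              (D3 kk t₁ (w₀ : ZMod (p ^ (2 * g + 1))) w₁ w₂ w₄) = 0 ∧
            ZMod.castHom (pow_dvd_pow p (by omega : g ≤ 2 * g + 1)) (ZMod (p ^ g))
              (D2 kk t₂ (w₀ : ZMod (p ^ (2 * g + 1))) w₁ w₃ w₄) = 0 ∧
            ZMod.castHom (pow_dvd_pow p (by omega : g ≤ 2 * g + 1)) (ZMod (p ^ g))
              (D1 kk t₂ (w₀ : ZMod (p ^ (2 * g + 1))) w₂ w₃ w₄) = 0 ∧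
            ZMod.castHom (pow_dvd_pow p (by omega : g ≤ 2 * g + 1)) (ZMod (p ^ g))
              (D0 kk t₁ t₂ (w₁ : ZMod (p ^ (2 * g + 1))) w₂ w₃ w₄) = 0
          then ‖∑ s₄ ∈ range p, ∑ s₃ ∈ range p, ∑ s₂ ∈ range p, ∑ s₁ ∈ range p, ∑ s₀ ∈ range p,
            (ZMod.stdAddChar (F311 kk t₁ t₂ ((w₀ + p ^ g * s₀ : ℕ) : ZMod (p ^ (2 * g + 1)))
              ((w₁ + p ^ g * s₁ : ℕ) : ZMod (p ^ (2 * g + 1))) ((w₂ + p ^ g * s₂ : ℕ) : ZMod (p ^ (2 * g + 1)))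
              ((w₃ + p ^ g * s₃ : ℕ) : ZMod (p ^ (2 * g + 1))) ((w₄ + p ^ g * s₄ : ℕ) : ZMod (p ^ (2 * g + 1)))) : ℂ)‖
          else 0) ≤
      B * (if (IsUnit ((w₁ : ℕ) : ZMod (p ^ (2 * g + 1))) ∧ IsUnit ((w₂ : ℕ) : ZMod (p ^ (2 * g + 1))) ∧
              IsUnit ((w₃ : ℕ) : ZMod (p ^ (2 * g + 1))) ∧ IsUnit ((w₄ : ℕ) : ZMod (p ^ (2 * g + 1)))) ∧
            ZMod.castHom (pow_dvd_pow p (by omega : g ≤ 2 * g + 1)) (ZMod (p ^ g))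
              (D4 kk t₁ (w₀ : ZMod (p ^ (2 * g + 1))) w₁ w₂ w₃) = 0 ∧
            ZMod.castHom (pow_dvd_pow p (by omega : g ≤ 2 * g + 1)) (ZMod (p ^ g))
              (D3 kk t₁ (w₀ : ZMod (p ^ (2 * g + 1))) w₁ w₂ w₄) = 0 ∧
            ZMod.castHom (pow_dvd_pow p (by omega : g ≤ 2 * g + 1)) (ZMod (p ^ g))
              (D2 kk t₂ (w₀ : ZMod (p ^ (2 * g + 1))) w₁ w₃ w₄) = 0 ∧
            ZMod.castHom (pow_dvd_pow p (by omega : g ≤ 2 * g + 1)) (ZMod (p ^ g))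
              (D1 kk t₂ (w₀ : ZMod (p ^ (2 * g + 1))) w₂ w₃ w₄) = 0 ∧
            ZMod.castHom (pow_dvd_pow p (by omega : g ≤ 2 * g + 1)) (ZMod (p ^ g))
              (D0 kk t₁ t₂ (w₁ : ZMod (p ^ (2 * g + 1))) w₂ w₃ w₄) = 0
          then (1 : ℝ) else 0) := by
    intro w₄ w₃ w₂ w₁ w₀
    split_ifs with hc
    · rw [mul_one]
      exact hB w₄ w₃ w₂ w₁ w₀ hc
    · rw [mul_zero]
  calc ((p : ℝ) ^ g) ^ 5 * _ ≤ ((p : ℝ) ^ g) ^ 5 * (B *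
        ∑ w₄ ∈ range (p ^ g), ∑ w₃ ∈ range (p ^ g), ∑ w₂ ∈ range (p ^ g), ∑ w₁ ∈ range (p ^ g),
        ∑ w₀ ∈ range (p ^ g),
        (if (IsUnit ((w₁ : ℕ) : ZMod (p ^ (2 * g + 1))) ∧ IsUnit ((w₂ : ℕ) : ZMod (p ^ (2 * g + 1))) ∧
              IsUnit ((w₃ : ℕ) : ZMod (p ^ (2 * g + 1))) ∧ IsUnit ((w₄ : ℕ) : ZMod (p ^ (2 * g + 1)))) ∧
            ZMod.castHom (pow_dvd_pow p (by omega : g ≤ 2 * g + 1)) (ZMod (p ^ g))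
              (D4 kk t₁ (w₀ : ZMod (p ^ (2 * g + 1))) w₁ w₂ w₃) = 0 ∧
            ZMod.castHom (pow_dvd_pow p (by omega : g ≤ 2 * g + 1)) (ZMod (p ^ g))
              (D3 kk t₁ (w₀ : ZMod (p ^ (2 * g + 1))) w₁ w₂ w₄) = 0 ∧
            ZMod.castHom (pow_dvd_pow p (by omega : g ≤ 2 * g + 1)) (ZMod (p ^ g))
              (D2 kk t₂ (w₀ : ZMod (p ^ (2 * g + 1))) w₁ w₃ w₄) = 0 ∧
            ZMod.castHom (pow_dvd_pow p (by omega : g ≤ 2 * g + 1)) (ZMod (p ^ g))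
              (D1 kk t₂ (w₀ : ZMod (p ^ (2 * g + 1))) w₂ w₃ w₄) = 0 ∧
            ZMod.castHom (pow_dvd_pow p (by omega : g ≤ 2 * g + 1)) (ZMod (p ^ g))
              (D0 kk t₁ t₂ (w₁ : ZMod (p ^ (2 * g + 1))) w₂ w₃ w₄) = 0
          then (1 : ℝ) else 0)) := by
        gcongr ((p : ℝ) ^ g) ^ 5 * ?_
        simp_rw [Finset.mul_sum]
        exact Finset.sum_le_sum fun w₄ _ => Finset.sum_le_sum fun w₃ _ => Finset.sum_le_sum fun w₂ _ =>
          Finset.sum_le_sum fun w₁ _ => Finset.sum_le_sum fun w₀ _ => hstep w₄ w₃ w₂ w₁ w₀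
    _ ≤ ((p : ℝ) ^ g) ^ 5 * (B * (12 *
        Nat.gcd (ZMod.castHom (pow_dvd_pow p (by omega : g ≤ 2 * g + 1)) (ZMod (p ^ g)) kk).val (p ^ g))) := by
        rw [sum_range5_indicator_eq_card_odd hg]
        have hc := card_critical_le (ZMod.castHom (pow_dvd_pow p (by omega : g ≤ 2 * g + 1)) (ZMod (p ^ g)) kk)
          (ZMod.castHom (pow_dvd_pow p (by omega : g ≤ 2 * g + 1)) (ZMod (p ^ g)) t₁)
          (ZMod.castHom (pow_dvd_pow p (by omega : g ≤ 2 * g + 1)) (ZMod (p ^ g)) t₂) (ht₁.map _)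
        gcongr
        exact_mod_cast hc
    _ = _ := by ring

/-- **Heath-Brown's Lemma 3, odd exponent, rank-`≥ 4` form** (`p` odd, `g ≥ 1`, `p ∤ t₁`):
`|S(k, t₁, t₂, 1, 1; p^{2g+1})| ≤ 12 (k, p^g) p^{5g+3}`. [cite: HeathBrown1986d3, Lemma 3 (f odd)] -/
theorem norm_SS_odd_le_gcd (hp2 : p ≠ 2) {g : ℕ} (hg : 1 ≤ g) (kk t₁ t₂ : ZMod (p ^ (2 * g + 1)))
    (ht₁ : IsUnit t₁) :
    ‖SS (p ^ (2 * g + 1)) kk t₁ t₂ 1 1‖ ≤ 12 * ((p : ℝ) ^ g) ^ 5 * (p : ℝ) ^ 3 *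
      Nat.gcd (ZMod.castHom (pow_dvd_pow p (by omega : g ≤ 2 * g + 1)) (ZMod (p ^ g)) kk).val (p ^ g) := by
  refine norm_SS_odd_le_of_inner hg kk t₁ t₂ ht₁ (by positivity) fun w₄ w₃ w₂ w₁ w₀ hc => ?_
  obtain ⟨⟨h1, _, h3, h4⟩, E4, E3, E2, E1, E0⟩ := hc
  have := norm_inner5_le hp2 hg kk t₁ t₂ ht₁ (w₀ : ZMod (p ^ (2 * g + 1))) w₁ w₂ w₃ w₄ h1 h3 h4
    E4 E3 E2 E1 E0
  simpa only [Nat.cast_add, Nat.cast_mul] using this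

/-- **Heath-Brown's Lemma 3, odd exponent, as printed** (`p` odd, `g ≥ 1`, `p ∤ t₁`):
`|S(k, t₁, t₂, 1, 1; p^{2g+1})| ≤ 12 (k, p^g) p^{5g+5/2} (3k, p)^{1/2}` (HB has `(k,p)^{1/2}`; the extra
`(3,p)` only matters at `p = 3`). [cite: HeathBrown1986d3, Lemma 3 (f odd)] -/
theorem norm_SS_odd_le_gcd_sqrt (hp2 : p ≠ 2) {g : ℕ} (hg : 1 ≤ g) (kk t₁ t₂ : ZMod (p ^ (2 * g + 1)))
    (ht₁ : IsUnit t₁) :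
    ‖SS (p ^ (2 * g + 1)) kk t₁ t₂ 1 1‖ ≤ 12 * ((p : ℝ) ^ g) ^ 5 *
      ((p : ℝ) ^ 2 * Real.sqrt p * Real.sqrt (Nat.gcd (3 * kk.val) p)) *
      Nat.gcd (ZMod.castHom (pow_dvd_pow p (by omega : g ≤ 2 * g + 1)) (ZMod (p ^ g)) kk).val (p ^ g) := by
  refine norm_SS_odd_le_of_inner hg kk t₁ t₂ ht₁ (by positivity) fun w₄ w₃ w₂ w₁ w₀ hc => ?_
  obtain ⟨⟨h1, _, h3, h4⟩, E4, E3, E2, E1, E0⟩ := hc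
  have hp0 : (0 : ℝ) ≤ p := Nat.cast_nonneg p
  have hsq5 : Real.sqrt ((p : ℝ) ^ 5) = (p : ℝ) ^ 2 * Real.sqrt p := by
    rw [show (p : ℝ) ^ 5 = ((p : ℝ) ^ 2) ^ 2 * p by ring, Real.sqrt_mul (by positivity), Real.sqrt_sq (by positivity)]
  by_cases h3k : ZMod.castHom (dvd_pow_self p (by omega : 2 * g + 1 ≠ 0)) (ZMod p) (3 * kk) = 0
  · -- `p ∣ 3k`: `(3k, p) = p`, and the rank-`≥ 4` bound `p³ = p² √p √p`
    have hg3 : Nat.gcd (3 * kk.val) p = p := by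
      refine Nat.gcd_eq_right ?_
      rw [← ZMod.natCast_eq_zero_iff, ← h3k, map_mul, Nat.cast_mul, Nat.cast_ofNat, map_ofNat,
        ZMod.castHom_apply, ZMod.cast_eq_val]
    rw [hg3, mul_assoc, Real.mul_self_sqrt hp0, ← pow_succ]
    have := norm_inner5_le hp2 hg kk t₁ t₂ ht₁ (w₀ : ZMod (p ^ (2 * g + 1))) w₁ w₂ w₃ w₄ h1 h3 h4
      E4 E3 E2 E1 E0
    simpa only [Nat.cast_add, Nat.cast_mul] using this
  · have hsq := norm_sq_inner5_le hp2 hg kk t₁ t₂ ht₁ h3k (w₀ : ZMod (p ^ (2 * g + 1))) w₁ w₂ w₃ w₄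
      h1 h3 h4 E4 E3 E2 E1 E0
    have h1le : (1 : ℝ) ≤ Real.sqrt (Nat.gcd (3 * kk.val) p) := by
      rw [← Real.sqrt_one]
      exact Real.sqrt_le_sqrt (by exact_mod_cast Nat.pos_of_ne_zero (Nat.gcd_ne_zero_right hp.out.ne_zero))
    have hle := Real.sqrt_le_sqrt hsq
    rw [Real.sqrt_sq (norm_nonneg _), hsq5] at hle
    calc _ = ‖∑ s₄ ∈ range p, ∑ s₃ ∈ range p, ∑ s₂ ∈ range p, ∑ s₁ ∈ range p, ∑ s₀ ∈ range p,
        (ZMod.stdAddChar (F311 kk t₁ t₂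
          ((w₀ : ZMod (p ^ (2 * g + 1))) + ((p ^ g : ℕ) : ZMod (p ^ (2 * g + 1))) * ((s₀ : ℕ) : ZMod (p ^ (2 * g + 1))))
          ((w₁ : ZMod (p ^ (2 * g + 1))) + ((p ^ g : ℕ) : ZMod (p ^ (2 * g + 1))) * ((s₁ : ℕ) : ZMod (p ^ (2 * g + 1))))
          ((w₂ : ZMod (p ^ (2 * g + 1))) + ((p ^ g : ℕ) : ZMod (p ^ (2 * g + 1))) * ((s₂ : ℕ) : ZMod (p ^ (2 * g + 1))))
          ((w₃ : ZMod (p ^ (2 * g + 1))) + ((p ^ g : ℕ) : ZMod (p ^ (2 * g + 1))) * ((s₃ : ℕ) : ZMod (p ^ (2 * g + 1))))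
          ((w₄ : ZMod (p ^ (2 * g + 1))) + ((p ^ g : ℕ) : ZMod (p ^ (2 * g + 1))) * ((s₄ : ℕ) : ZMod (p ^ (2 * g + 1))))) : ℂ)‖ := by
          simp only [Nat.cast_add, Nat.cast_mul]
      _ ≤ (p : ℝ) ^ 2 * Real.sqrt p := hle
      _ ≤ (p : ℝ) ^ 2 * Real.sqrt p * Real.sqrt (Nat.gcd (3 * kk.val) p) :=
          le_mul_of_one_le_right (by positivity) h1le

/-- **Lemma 3, odd exponent, all primes** (including `p = 2`; trivial inner bound `p⁵`):
`|S(k, t₁, t₂, 1, 1; p^{2g+1})| ≤ 12 (k, p^g) p^{5g+5}`. [cite: HeathBrown1986d3, Lemma 3 (f odd)] -/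
theorem norm_SS_odd_le_gcd_triv {g : ℕ} (hg : 1 ≤ g) (kk t₁ t₂ : ZMod (p ^ (2 * g + 1)))
    (ht₁ : IsUnit t₁) :
    ‖SS (p ^ (2 * g + 1)) kk t₁ t₂ 1 1‖ ≤ 12 * ((p : ℝ) ^ g) ^ 5 * (p : ℝ) ^ 5 *
      Nat.gcd (ZMod.castHom (pow_dvd_pow p (by omega : g ≤ 2 * g + 1)) (ZMod (p ^ g)) kk).val (p ^ g) := by
  refine norm_SS_odd_le_of_inner hg kk t₁ t₂ ht₁ (by positivity) fun w₄ w₃ w₂ w₁ w₀ _ => ?_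
  have hp1 : ∀ (f : ℕ → ℂ) (C : ℝ), (∀ n, ‖f n‖ ≤ C) → ‖∑ n ∈ range p, f n‖ ≤ p * C := fun f C hf =>
    (norm_sum_le _ _).trans ((Finset.sum_le_sum fun n _ => hf n).trans (by simp))
  refine (hp1 _ _ fun s₄ => hp1 _ _ fun s₃ => hp1 _ _ fun s₂ => hp1 _ _ fun s₁ => hp1 _ (1 : ℝ) fun s₀ =>
    ?_).trans (le_of_eq (by ring))
  exact (norm_stdAddChar _).le

omit hp in
/-- **At a critical point `t₂ − t₁ ∈ (k)`**: `T₂ − T₁ = K m₁² (τ² + τ + 1)` with `τ = m₃ m₁⁻¹`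
(from `τ³ = T₁⁻¹T₂` and `K m₁² = T₁(τ − 1)`). [cite: HeathBrown1986d3, Lemma 3 (p.39, vanishing clause)] -/
theorem critical_sub_eq {K T₁ T₂ j m₁ m₂ m₃ m₄ : ZMod q} (hT₁ : IsUnit T₁)
    (h1 : IsUnit m₁) (h4 : IsUnit m₄)
    (E4 : D4 K T₁ j m₁ m₂ m₃ = 0) (E3 : D3 K T₁ j m₁ m₂ m₄ = 0) (E2 : D2 K T₂ j m₁ m₃ m₄ = 0)
    (E1 : D1 K T₂ j m₂ m₃ m₄ = 0) (E0 : D0 K T₁ T₂ m₁ m₂ m₃ m₄ = 0) :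
    T₂ - T₁ = K * (m₁ ^ 2 * ((m₃ * m₁⁻¹) ^ 2 + m₃ * m₁⁻¹ + 1)) := by
  obtain ⟨_, _, cτ, cK, _⟩ := critical_structure hT₁ h1 h4 E4 E3 E2 E1 E0
  have iT := ZMod.mul_inv_of_unit _ hT₁
  linear_combination (-((m₃ * m₁⁻¹) ^ 2 + m₃ * m₁⁻¹ + 1)) * cK + (-T₁) * cτ + (-T₂) * iT

omit hp in
/-- Hence `(k, q) ∣ t₂ − t₁` (on canonical representatives). [cite: HeathBrown1986d3, Lemma 3 (p.39)] -/
theorem gcd_val_dvd_of_critical {K T₁ T₂ j m₁ m₂ m₃ m₄ : ZMod q} (hT₁ : IsUnit T₁)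
    (h1 : IsUnit m₁) (h4 : IsUnit m₄)
    (E4 : D4 K T₁ j m₁ m₂ m₃ = 0) (E3 : D3 K T₁ j m₁ m₂ m₄ = 0) (E2 : D2 K T₂ j m₁ m₃ m₄ = 0)
    (E1 : D1 K T₂ j m₂ m₃ m₄ = 0) (E0 : D0 K T₁ T₂ m₁ m₂ m₃ m₄ = 0) :
    Nat.gcd K.val q ∣ (T₂ - T₁).val := by
  rw [critical_sub_eq hT₁ h1 h4 E4 E3 E2 E1 E0, ZMod.val_mul]
  exact (Nat.dvd_mod_iff (Nat.gcd_dvd_right _ _)).mpr (dvd_mul_of_dvd_left (Nat.gcd_dvd_left _ _) _)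

/-- **Lemma 3, vanishing clause, even exponent**: `S(k, t₁, t₂, 1, 1; p^{2g}) = 0` unless
`(k, p^g) ∣ t₂ − t₁` (`g ≥ 1`, `p ∤ t₁`). [cite: HeathBrown1986d3, Lemma 3] -/
theorem SS_even_eq_zero_of_not_dvd {g : ℕ} (hg : 1 ≤ g) (k t₁ t₂ : ZMod (p ^ (g + g))) (ht₁ : IsUnit t₁)
    (hnd : ¬ Nat.gcd (ZMod.castHom (pow_dvd_pow p (Nat.le_add_left g g)) (ZMod (p ^ g)) k).val (p ^ g) ∣
      (ZMod.castHom (pow_dvd_pow p (Nat.le_add_left g g)) (ZMod (p ^ g)) t₂ -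
        ZMod.castHom (pow_dvd_pow p (Nat.le_add_left g g)) (ZMod (p ^ g)) t₁).val) :
    SS (p ^ (g + g)) k t₁ t₂ 1 1 = 0 := by
  classical
  have h := norm_SS_even_le hg k t₁ t₂
  set π := ZMod.castHom (pow_dvd_pow p (Nat.le_add_left g g)) (ZMod (p ^ g)) with hπ
  have hcond : ∀ u₄ u₃ u₂ u₁ u₀ : ℕ,
      ¬ ((IsUnit ((u₁ : ℕ) : ZMod (p ^ (g + g))) ∧ IsUnit ((u₂ : ℕ) : ZMod (p ^ (g + g))) ∧
              IsUnit ((u₃ : ℕ) : ZMod (p ^ (g + g))) ∧ IsUnit ((u₄ : ℕ) : ZMod (p ^ (g + g)))) ∧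
            π (D4 k t₁ (u₀ : ZMod (p ^ (g + g))) u₁ u₂ u₃) = 0 ∧
            π (D3 k t₁ (u₀ : ZMod (p ^ (g + g))) u₁ u₂ u₄) = 0 ∧
            π (D2 k t₂ (u₀ : ZMod (p ^ (g + g))) u₁ u₃ u₄) = 0 ∧
            π (D1 k t₂ (u₀ : ZMod (p ^ (g + g))) u₂ u₃ u₄) = 0 ∧
            π (D0 k t₁ t₂ (u₁ : ZMod (p ^ (g + g))) u₂ u₃ u₄) = 0) := by
    rintro u₄ u₃ u₂ u₁ u₀ ⟨⟨h1, _, _, h4⟩, E4, E3, E2, E1, E0⟩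
    exact hnd (gcd_val_dvd_of_critical (K := π k) (T₂ := π t₂) (j := π u₀) (ht₁.map π) (h1.map π)
      (h4.map π) (by rw [D4_def, ← map_D4]; exact E4) (by rw [D3_def, ← map_D3]; exact E3)
      (by rw [D2_def, ← map_D2]; exact E2) (by rw [D1_def, ← map_D1]; exact E1)
      (by rw [D0_def, ← map_D0]; exact E0))
  simp only [if_neg (hcond _ _ _ _ _), Finset.sum_const_zero, mul_zero] at h
  exact norm_le_zero_iff.mp h

/-- **Lemma 3, vanishing clause, odd exponent**: `S(k, t₁, t₂, 1, 1; p^{2g+1}) = 0` unless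
`(k, p^g) ∣ t₂ − t₁` (`g ≥ 1`, `p ∤ t₁`). [cite: HeathBrown1986d3, Lemma 3] -/
theorem SS_odd_eq_zero_of_not_dvd {g : ℕ} (hg : 1 ≤ g) (kk t₁ t₂ : ZMod (p ^ (2 * g + 1)))
    (ht₁ : IsUnit t₁)
    (hnd : ¬ Nat.gcd (ZMod.castHom (pow_dvd_pow p (by omega : g ≤ 2 * g + 1)) (ZMod (p ^ g)) kk).val (p ^ g) ∣
      (ZMod.castHom (pow_dvd_pow p (by omega : g ≤ 2 * g + 1)) (ZMod (p ^ g)) t₂ -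
        ZMod.castHom (pow_dvd_pow p (by omega : g ≤ 2 * g + 1)) (ZMod (p ^ g)) t₁).val) :
    SS (p ^ (2 * g + 1)) kk t₁ t₂ 1 1 = 0 := by
  classical
  have h := norm_SS_odd_stage1 hg kk t₁ t₂
  set π := ZMod.castHom (pow_dvd_pow p (by omega : g ≤ 2 * g + 1)) (ZMod (p ^ g)) with hπ
  have hcond : ∀ w₄ w₃ w₂ w₁ w₀ : ℕ,
      ¬ ((IsUnit ((w₁ : ℕ) : ZMod (p ^ (2 * g + 1))) ∧ IsUnit ((w₂ : ℕ) : ZMod (p ^ (2 * g + 1))) ∧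
              IsUnit ((w₃ : ℕ) : ZMod (p ^ (2 * g + 1))) ∧ IsUnit ((w₄ : ℕ) : ZMod (p ^ (2 * g + 1)))) ∧
            π (D4 kk t₁ (w₀ : ZMod (p ^ (2 * g + 1))) w₁ w₂ w₃) = 0 ∧
            π (D3 kk t₁ (w₀ : ZMod (p ^ (2 * g + 1))) w₁ w₂ w₄) = 0 ∧
            π (D2 kk t₂ (w₀ : ZMod (p ^ (2 * g + 1))) w₁ w₃ w₄) = 0 ∧
            π (D1 kk t₂ (w₀ : ZMod (p ^ (2 * g + 1))) w₂ w₃ w₄) = 0 ∧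
            π (D0 kk t₁ t₂ (w₁ : ZMod (p ^ (2 * g + 1))) w₂ w₃ w₄) = 0) := by
    rintro w₄ w₃ w₂ w₁ w₀ ⟨⟨h1, _, _, h4⟩, E4, E3, E2, E1, E0⟩
    exact hnd (gcd_val_dvd_of_critical (K := π kk) (T₂ := π t₂) (j := π w₀) (ht₁.map π) (h1.map π)
      (h4.map π) (by rw [D4_def, ← map_D4]; exact E4) (by rw [D3_def, ← map_D3]; exact E3)
      (by rw [D2_def, ← map_D2]; exact E2) (by rw [D1_def, ← map_D1]; exact E1)
      (by rw [D0_def, ← map_D0]; exact E0))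
  simp only [if_neg (hcond _ _ _ _ _), Finset.sum_const_zero, mul_zero] at h
  exact norm_le_zero_iff.mp h

end OddInner
end HeathBrown1986

end Literature.NumberTheory.Sieve

end
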